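import Mathlib
import Literature.MathematicalPhysics.QuantumFieldTheory.Balaban1983to89.Beta.GaussianIntegral
import Literature.MathematicalPhysics.QuantumFieldTheory.Balaban1983to89.Beta.ConstraintElimination
import Literature.MathematicalPhysics.QuantumFieldTheory.Balaban1983to89.Beta.CompositionSingular
import Literature.MathematicalPhysics.QuantumFieldTheory.Balaban1983to89.B9H163

/-! # `Balaban1983to89.B9SectECov` — the COVARIANCE IDENTITIES of B9 Sect. E, kernel-checked: the Gaussian
# generating function with a source (Lebesgue measure on `ι → ℝ`), (3.157) "`C^{(k)}(Λ) = C(C*Δ_kC)⁻¹C*`" with the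
# uniqueness of the covariance, (3.158) `(C*Δ_kC)⁻¹ = C^{(k)}(Λ)↾_Λ̃`, (3.174)/(3.175) `C′^{(k)}(Λ) = Q′𝒢̃Q′*`,
# `𝒢̃ = 𝒢 + H′C′^{(k)}(Λ)H′*`, (3.186) `G̃₂ = G₂ − G₂Q̃*(Q̃G₂Q̃*)⁻¹Q̃G₂`, a CONSTRAINED WOODBURY identity, B10 (63)'s
# representation "`(C*Δ_kC + xI)⁻¹ = (I + D̄μ)QG̃₃(x)Q*(I + μ*D̄*)↾`" as a KERNEL CONSEQUENCE of (3.185), and (§8) p. 426 /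
# B6 (2.25)–(2.27) "`R = Δ𝒢Δ`", "`𝒢 = G′² − G′²Q′*(Q′G′²Q′*)⁻¹Q′G′²`", (3.172) "`G′R = 𝒢Δ`", (3.152) ⇐ (3.151), with the
# Gaussian MEANS of (3.151)/(3.164), and (§9) p. 425 / p. 426 L9: the two facts Sect. D's operator algebra needs —
# "(3.124)" for `G₁` and "`RD*G₁DR = R`" — for the explicit projection (3.25), from (3.152), (3.115), (3.23) —
# [folklore] finite-dimensional Gaussian / bordered-matrix algebra over the printed formulas, over the β tree BY NAME

CITATION HEADER (lean-in-tree rule).  Paper sub-cell `b2b-balaban-b09` (gen 13, journal claims B9-SECTE-COV [v1],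
B9-SECTE-3173 [v1.1 = v1 + the APPEND-ONLY §7] and B9-SECTE-R226 [v1.2 = v1.1 + the APPEND-ONLY §8 + DOCFIX-1 (pv19-g5
XREAD of v1: (3.162)–(3.164) are printed on p. 429 [PDF 41], not p. 430) — docstrings only, every earlier declaration
byte-identical] and B9-SECTE-P425 [v1.3 = v1.2 + the APPEND-ONLY §9 + DOCFIX-2 (pv09-g8 XREAD of v1.1: in (3.173)'s
second member the print integrates `dλ` against `δ(Q′λ′)`; v1.1/v1.2's §7 banner and `eq_3173_fibre` docstring wrote
`dλ′`) — docstrings only, every earlier declaration byte-identical], cell pub-balaban) on T. Bałaban,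
*Propagators for lattice gauge theories in a background field*, Commun. Math. Phys. **99** (1985) 389–434
[`Balaban1985BackgroundPropagators`] (= B9; held `paper:balaban1985-cmp99-background-propagators`; journal page =
PDF page + 388), pp. 393–394 [PDF 5–6] ((3.17), (3.20)–(3.25): context only, typed by `B9Eq320Gauss` / `B9Eq325Proj`),
p. 418 [PDF 30] ((3.115)), p. 420 [PDF 32] ((3.124)), pp. 425–426 [PDF 37–38], pp. 427–428 [PDF 39–40], p. 429 [PDF
41], p. 430 [PDF 42], p. 431 [PDF 43], p. 432 [PDF 44];
T. Bałaban, *Propagators and renormalization transformations for lattice gauge theories. II*, Commun. Math. Phys.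
**96** (1984) 223–250 [`Balaban1984PropagatorsII`] (= B6 = B9's reference [4]; journal page = PDF page + 222), pp.
226–227 [PDF 4–5]; and T. Bałaban, *Ultraviolet stability of three-dimensional lattice pure gauge field theories*,
Commun. Math. Phys. **102** (1985) 255–275 [`Balaban1985UV3`] (= B10; journal page = PDF page + 254), p. 272 [PDF
18].  Renders `b2b-balaban-ref1/pages/1985-cmp99-background-propagators/…-p005-x2.png`, `…-p006-x2.png`,
`…-p030-x2.png`, `…-p032-x2.png`, `…-p037-x2.png`, `…-p038-x2.png`, `…-p040-x2.png`, `…-p041-x2.png`, `…-p042-x2.png`,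
`…-p043-x2.png`, `…-p044-x2.png`,
`…/1984-cmp96-propagators-rt-II/…-p004-x2.png`, `…-p005-x2.png` and `…/1985-cmp102-uv-stability-3d/…-p018-x2.png`
READ AS IMAGES by this seat (gen 13).  ABSOLUTE RULE: nothing is cited
beyond verbatim print with page references; B9 is not cited for any disputed step — the factorisation (3.185), every
bound, and the δ-function bookkeeping (3.159)–(3.184) are NOT used: where (3.185) enters (§6) it is an explicit
HYPOTHESIS (`h3185`); §7 PROVES the one δ-function/translation chain the paper displays, (3.173), under the
kernel-parametrisation reading of its δ-functions (it does not cite it); §8 PROVES "R = Δ𝒢Δ" / (2.27) / (3.172) for the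
explicit operator (3.25) and takes (3.151) — whose derivation is Faddeev–Popov bookkeeping — only as a HYPOTHESIS
(`h3151`) where (3.152) is derived from it; §9 PROVES, for the explicit (3.25), the two facts p. 425 says Sect. D's
operator algebra needs, taking (3.115) and (3.23) as HYPOTHESES (`h3115`, `hDD`) — it does not type (3.124) for Sect.
D's own `G`, nor its Gaussian proof (3.125).  Imports Mathlib + the β-lineage modules
`Beta.GaussianIntegral` (pv16), `Beta.ConstraintElimination` (pv03), `Beta.CompositionSingular` (an2) and [adv1's]
`B9H163`, all consumed BY NAME (nothing of theirs is restated or modified; one-writer rule).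

WHAT IS PRINTED (verbatim).
* B9 p. 428 [PDF 40], after (3.156): *"This form is considered on the subspace {B: B = 0 on Λᶜ, B = 0 on
  ⋃_{y∈Λ′}Ax(y), Q₁B = 0}. We can parametrize this subspace in the same way as in [4] (2.154–2.155), using part of the
  variables B, which we denote by B̃. These are variables B restricted to the set of bonds Λ̃ = Λ∖(⋃_{y∈Λ′}Ax(y) ∪
  ⋃_{c∈Λ′}B(c)∩c). … Variables B depend linearly on B̃ and we have B = CB̃, where C is a linear operator. It is an
  identity operator on almost all bonds, except the bonds b₀ for which a value (CB̃)(b₀) is equal to a solution of the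
  equation (QB)(c) = 0, considered as an equation on the variable B(b₀). … Of course we have as in (2.155) [4]
  e^{(1/2)⟨g,C^{(k)}(Λ)g⟩} = (Z′^{(k)}(Λ))⁻¹ ∫dB̃ exp[−½⟨B̃, C*Δ_kCB̃⟩ + ⟨B̃, C*g⟩] = e^{(1/2)⟨C*g,(C*Δ_kC)⁻¹C*g⟩},
  (3.157) hence C^{(k)}(Λ) = C(C*Δ_kC)⁻¹C*, or (C*Δ_kC)⁻¹ = C̃^{(k)}(Λ) = C^{(k)}(Λ)↾_Λ̃. (3.158) These equalities
  allow us to express one of the operators C̃^{(k)}(Λ), C^{(k)}(Λ) by the other. It is more convenient to work with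
  the operator C̃^{(k)}(Λ), because it is defined by a positive definite operator C*Δ_kC with a lower bound γ₀ > 0
  independent of k and U."*
* B9 p. 431 [PDF 43]: *"hence it is enough to relate 𝒢 and 𝒢̃. From (3.171) we obtain e^{1/2⟨f,𝒢̃f⟩} = Z̃′⁻¹∫dμ↾_Λ
  δ(Q′₁μ)∫dλ δ(Q′λ − μ)e^{−(1/2)‖Δλ‖² + ⟨λ,f⟩} = Z̃′⁻¹∫dμ↾_Λ δ(Q′₁μ)∫dλ δ(Q′λ′) exp[−½‖Δλ′‖² − ½‖ΔH′μ‖² + ⟨λ′,f⟩ +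
  ⟨H′μ,f⟩] = e^{1/2⟨f,𝒢f⟩}Z̃′⁻¹Z′∫dμ δ(Q′₁μ) exp[−½‖ΔH′μ‖² + ⟨μ,H′*f⟩] = e^{1/2⟨f,𝒢f⟩}e^{1/2⟨f,H′C′^{(k)}(Λ)H′*f⟩}.
  (3.173) The second equality was obtained by the translation λ = λ′ + H′μ, and C′^{(k)}(Λ) denotes a unit lattice
  covariance with Dirichlet boundary conditions outside Λ, determined by the last integral above. Doing the
  calculations in a reversed order we obtain easily the representation C′^{(k)}(Λ) = Q′𝒢̃Q′*. (3.174) It implies all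
  properties of C′^{(k)}(Λ), especially a random walk expansion. The equality (3.173) gives 𝒢̃ = 𝒢 + H′C′^{(k)}(Λ)H′*,
  (3.175)"*; p. 429 [PDF 41], (3.162)–(3.164): the minimiser `H′` of `‖Δλ‖²` under `Q′λ = μ` ([adv1's] `B9H163.Hmin`,
  by name; locator corrected in v1.2 after pv19-g5's cross-read — v1/v1.1 printed "p. 430 [PDF 42]" here).
* B9 p. 432 [PDF 44]: (3.183) = a Gaussian integral `Z̃⁻¹∫dA δ(Q̃A) exp[−½(quadratic form in A) + ⟨H₁D̃^{(2)}(QA +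
  D̄μ(QA)),J⟩ + ⟨QA + D̄μ(QA),g⟩]` equal to `exp(½⟨g,C^{(k)}(Λ)g⟩)`, then: *"Let us denote a covariance operator of
  the Gaussian integral in (3.183) by G̃₂, then we obtain C^{(k)}(Λ) = (I + D̄μ)QG̃₂Q*(I + μ*D̄*). (3.185) It is the
  formula we are looking for. The operator G̃² [sic] can be related in a simple way to the operator G₂ defined by the
  Gaussian integral (3.183), but with the δ-function δ(Q̃A) replaced by exp[−½⟨Q̃A,aQ̃A⟩]. We have G̃₂ = G₂ −
  G₂Q̃*(Q̃G₂Q̃*)⁻¹Q̃G₂. (3.186)"*.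
* (§8) B9 p. 425 [PDF 37], (3.151): *"Let us derive more identities. We have RD*G₁J = Z⁻¹(J)∫dA exp[−½⟨A,G₁⁻¹A⟩ +
  ⟨A,J⟩]RD*A = Z⁻¹(J)|det(Δ↾_{N(Q′)})|∫dA δ_R(RD*A)exp[−½⟨A,G₁⁻¹A⟩ + ⟨A,J⟩]·∫dλ δ(Q′λ)exp[−½‖Δλ‖² + ⟨Dλ,J⟩]Δλ
  = Δ𝒢D*J, (3.151)"*; p. 426 [PDF 38] L1–8: *"where 𝒢 is a covariance of the last Gaussian integral in λ. Let us
  notice that 𝒢 is also a covariance of the integral (3.17) defining the operator R, and from this integral we get R =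
  Δ𝒢Δ. It is the formula (2.26) in [4], and we have also the formula (2.27): 𝒢 = G′² − G′²Q′*(Q′G′²Q′*)⁻¹Q′G′². It can
  be easily proved by the usual Lagrange function argument. From these identities we get Q′𝒢 = 𝒢Q′* = 0 and Δ𝒢D*J =
  Δ𝒢(Δ + Q′*aQ′)G′D*J = Δ𝒢ΔG′D*J = RG′D*J, hence (3.151) gives RD*G₁ = RG′D*, and G₁DR = DG′R. (3.152)"*; p. 430
  [PDF 42]: *"After the equality (3.151) we have noticed that R = Δ𝒢Δ, where 𝒢 is a covariance of the Gaussian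
  integral e^{1/2⟨f,𝒢f⟩} = Z′⁻¹∫dλ δ(Q′λ)e^{−1/2‖Δλ‖²+⟨λ,f⟩}, (3.171) and that 𝒢 is given by the formula (2.27) in [4].
  This implies G′R = 𝒢Δ, G̃′R̃ = 𝒢̃Δ, (3.172)"*; with (3.25) p. 394 [PDF 6] *"Rf = (I − G′Q′*(Q′G′²Q′*)⁻¹Q′G′)f, (3.25)
  where G′ = G′(U) = (Δ′_a)⁻¹"* and (3.20)–(3.21) p. 394 *"R = R(U) is an orthogonal projection in the Hilbert space
  L²(Ω₀,𝔤) onto the subspace R = Δ^η_U N(Q′), N(Q′) = {λ : Q′λ = 0}. (3.21)"* (typed at the abstract level by this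
  lineage's gen-6 `B9Eq325Proj`, `B9Eq320Gauss`; quoted here as the definition of the letter R).
* (§8) B6 p. 226 [PDF 4]: *"At first we will write an integral representation of the operator R, analogous to the
  representation (1.27). By the formula (2.17) and properties of Gaussian integrals we have e^{−1/2⟨f,Rf⟩} =
  e^{−1/2‖f‖²}(Z′⁻¹∫dλδ(Q′λ)e^{−1/2‖f−Δλ‖²})⁻¹ (2.24) or e^{1/2⟨f,Rf⟩} = Z′⁻¹∫dλδ(Q′λ)e^{−1/2‖Δλ‖²+⟨Δf,λ⟩}. (2.25) Let
  us denote by 𝒢 a covariance of the Gaussian integral on the right-hand side above. Thus we have R = Δ𝒢Δ. (2.26)"*;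
  p. 227 [PDF 5]: *"It is easy to see that 𝒢 = G′² − G′²Q′*(Q′G′²Q′*)⁻¹Q′G′². (2.27) This formula, the equality (2.26)
  and the equalities Q′𝒢 = 𝒢Q′* = 0 imply the representation (2.17)."*
* (§9) B9 p. 425 [PDF 37], after (3.147) `𝔓 = I − G₁Q*(QG₁Q*)⁻¹Q − G₁DRD*`: *"It is easy to verify explicitly properties
  of the operator 𝔓, i.e. Q𝔓 = 0, RD*𝔓 = 0, 𝔓² = 𝔓, … Verifying the above properties we need to know only the
  identities (3.124) and RD*G₁DR = R. The last can be proved by the same method as used in the proof of (3.124), and in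
  the proof of the same identity in (2.30) [4]."*; p. 426 [PDF 38] L9, after (3.152): *"Let us notice that these
  identities imply the identities (3.124), because QG₁DR = QDG′R = D¹Q′G′R = 0."*; (3.124) p. 420 [PDF 32]: *"RD*GQ* =
  0, hence QGDR = 0. (3.124)"* (printed for Sect. D's `G` with `G⁻¹ = Δ_π + DRD* + Q*aQ` and proved there by the
  Gaussian computation (3.125); p. 425: "the identities (3.129), which hold also for the operator G₁"); (3.115) p. 418
  [PDF 30]: *"Q_jDλ = D^{L^jη}_{Ū^j}Q′_jλ = D̄^jQ′_jλ, (3.115) where the last equality is a definition of the symbol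
  D̄^j"*; (3.23) p. 394 [PDF 6]: *"Δ^η_U = D^{η*}_U D^η_U"*.
* B10 p. 272 [PDF 18], after (63): *"The operator under the integral has a representation similar to (C*Δ_kC)⁻¹. More
  exactly the operator C(C*Δ_kC + xI)⁻¹C* is represented by the integral (3.183) [5] with the additional term
  −1/2x‖χ̃(QA + D̄μ(QA))‖² under the exponential function, where χ̃ is the characteristic function of the set of bonds
  corresponding to variables Λ̃. This term determines a non-negative, bounded and almost local operator. The integral
  yields the representation analogous to (3.185) (C*Δ_kC + xI)⁻¹ = (I + D̄μ)QG̃₃(x)Q*(I + μ*D̄*)↾_{B(Λ_{k+1})}, where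
  G̃₃(x) is defined as G̃₂, but with this additional operator."*

THE READING (typing choices; DIVERGENCE D-b09.44 — a dictionary, every arrow "↦" is a reading of print, not print).
(a) FIELDS AND FORMS are finite real (or, where no integral is taken, field-valued) vectors and matrices: the free
    coordinates B̃ ∈ `ι → ℝ`, all bond variables B ∈ `κ → ℝ`, the parametrisation `C : Matrix κ ι`, the form ⟨B, Δ_kB⟩
    ↦ `Δ : Matrix κ κ ℝ`, so ⟨B̃, C*Δ_kCB̃⟩ ↦ `v ⬝ᵥ (Cᵀ * Δ * C) *ᵥ v` and the source ⟨B̃, C*g⟩ ↦ `v ⬝ᵥ (Cᵀ *ᵥ g)`;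
    ∫dB̃ ↦ Lebesgue measure `volume` on `ι → ℝ`; (Z′^{(k)}(Λ))⁻¹ ↦ the inverse of the source-free integral.  CAVEAT:
    in (3.156) the print folds the `J`-linear term `−2⟨H₁D̃⁽²⁾(B),J⟩` into the notation ⟨B,Δ_kB⟩; the typed (3.157)
    takes `Δ` to be a genuine symmetric (positive definite after restriction) form — a linear term shifts only the
    mean, not the covariance (`integral_exp_source_add`), which is all (3.157)'s conclusion about `C^{(k)}(Λ)` uses.
    C^{(k)}(Λ) = C(C*Δ_kC)⁻¹C* ↦ `Beta.LogDetHessian.cov Δ C` (β sub-cell, BY NAME).  The colour structure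
    (𝔤-valued bond functions) is suppressed: all identities here are ENTRYWISE-AGNOSTIC linear algebra (cf.
    `B9Eq3187Op` for the block-kernel level).
(b) δ-FUNCTION GAUSSIANS ↦ THE BORDERED INVERSE.  A Gaussian `exp(−½⟨A, KA⟩)` integrated against `δ(Q̃A)` has
    covariance ("covariance operator of the Gaussian integral") ↦ `flucCov K Q̃ = ([[K, Q̃ᵀ],[Q̃, 0]]⁻¹)₁₁`, minimiser
    ↦ `minOp`, effective form ↦ `effForm` ([an2's] `Beta.CompositionSingular`, BY NAME; its §8 `blocks_eq_kernelBasis`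
    is the equality of this reading with (a)'s `cov` in a kernel basis — used in `eq_3157_flucCov`, not re-proved).
    So: 𝒢 ↦ `flucCov H Q′` with `H` ↦ Δ² (the form ‖Δλ‖²), 𝒢̃ ↦ `flucCov H (Q₂Q′)` (`Q₂` ↦ the extra constraints
    δ(Q′₁μ), μ = 0 off Λ), H′ ↦ `minOp H Q′` (= [adv1's] `B9H163.Hmin Δ Q′` for `H = Δ·Δ`, `Hmin_eq_minOp`),
    C′^{(k)}(Λ) ↦ `flucCov (effForm H Q′) Q₂` (the covariance of `exp[−½‖ΔH′μ‖²]` under δ(Q′₁μ): `effForm = H′ᵀHH′`,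
    an2's `transpose_minOp_mul_mul_minOp`); G̃₂ ↦ `flucCov K Q̃`, G₂ ↦ `(K + Q̃ᵀAQ̃)⁻¹` (`a` ↦ any matrix weight `A`,
    scalar `a` ↦ `a • 1`); (3.185)'s observation A ↦ QA + D̄μ(QA) = (I + D̄μ)QA ↦ a matrix `P`, so (3.185) ∧ (3.157) ↦
    the HYPOTHESIS `P * flucCov K Q̃ * Pᵀ = C * T⁻¹ * Cᵀ`, `T = C*Δ_kC`; χ̃ (restriction to the bonds of Λ̃) ↦ `χ`
    with `χ * C = 1` ("identity operator on almost all bonds": B̃ = χB, B = CB̃); B10's additional term −½x‖χ̃(QA +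
    D̄μ(QA))‖² ↦ the tilt `K + (χP)ᵀ(x • 1)(χP)`; G̃₃(x) ↦ `flucCov (K + (χP)ᵀ(x•1)(χP)) Q̃`.
(c) HYPOTHESES are invertibility / positivity only: `PosDef (CᵀΔC)` (B9: "positive definite … γ₀ > 0"), `IsUnit (kkt ·
    ·).det` (the bordered matrices), `IsUnit` of the printed inverses, `x ≠ 0` (B10: x ∈ (0, 2γ₁]); over ℝ with `T >
    0`, `x > 0` the B10 statement needs only the bordered hypothesis (`b10_rep63_real`).
(d) (§8, DIVERGENCE D-b09.46) `R` ↦ [adv1's] `B9H163.R Δ Q′ a = 1 − G′Q′ᵀ(Q′G′²Q′ᵀ)⁻¹Q′G′` ((3.25), with `G′ =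
    B9H163.G' = (Δ + a•Q′ᵀQ′)⁻¹` (3.24) for the printed SCALAR `a`, `M′ = B9H163.M' = Q′G′²Q′ᵀ`; all BY NAME, nothing of
    adv1's restated); `𝒢` ("a covariance of the … Gaussian integral … δ(Q′λ)e^{−½‖Δλ‖²…}") ↦ `flucCov (Δ * Δ) Q′` as in
    (b); `δ(Q′λ)dλ` ↦ the kernel parametrisation `λ = Nz`, `Q′N = 0`, with `n ≃ τ ⊕ m`, `NᵀN` and `Q′Q′ᵀ` nonsingular
    (so `[N | Q′ᵀ…]` spans), Lebesgue `dz`; `‖Δλ‖²` ↦ `λᵀ(Δ·Δ)λ` for SYMMETRIC `Δ` (hypothesis `Δ.IsSymm`; in print `Δ =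
    Δ^η_U = D*D`, (3.23)); the sources `⟨λ,f⟩`, `⟨Δf,λ⟩`, `⟨Dλ,J⟩` ↦ `(Nz)ᵀf`, `(Nz)ᵀ(Δf)`, `(DNz)ᵀJ`; `Z′⁻¹` ↦ the
    inverse of the source-free integral; (3.151)'s `D`, `J`, `G₁` ↦ ARBITRARY real matrices / vectors of compatible
    shape (`G₁` symmetric where (3.152)'s second identity is obtained by transposition) — (3.151) itself enters only as
    the operator HYPOTHESIS `RDᵀG₁ = Δ𝒢Dᵀ`.  Invertibility HYPOTHESES of §8: `IsUnit (Δ + a•Q′ᵀQ′)` (B9 p. 394: Δ′_a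
    has the inverse G′), `IsUnit (NᵀΔ²N).det` (`PosDef` at measure level); the invertibility of `M′ = Q′G′²Q′ᵀ`, used
    silently in (3.25), is DERIVED (`isUnit_M'`); `Δ` itself is NOT assumed invertible except in the (3.164) edge
    `h164_mean_kernelBasis` (adv1's `Hmin = Δ⁻²Q′ᵀ(Q′Δ⁻²Q′ᵀ)⁻¹`).
(e) (§9, DIVERGENCE D-b09.47) the covariant derivative `D` (sites → bonds) ↦ `D : Matrix p n ℝ`, the propagator `G₁` ↦
    `G₁ : Matrix p p ℝ` (symmetric where an adjoint is taken), the BOND average `Q` = `Q_j` ↦ `Qv : Matrix q p ℝ`, `D̄^j`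
    (p. 426's `D¹`) ↦ `Dbar : Matrix q m ℝ` — all ARBITRARY; (3.115) `Q_jD = D̄^jQ′_j` ↦ the HYPOTHESIS `Qv * D = Dbar *
    Q′` (`h3115`); (3.23) `Δ = D*D` ↦ the HYPOTHESIS `Dᵀ * D = Δ` (`hDD`); (3.152) ↦ the hypothesis `h152b` (or derived
    from `h3151` as in (d)); `R`, `G′`, `M′` as in (d).  The targets are typed in EXACTLY the shapes [r1's] ring-level
    `B9.lean` Sect. D algebra takes as hypotheses (`h124 : q*g*d*r = 0`, `h124 : r*ds*g*qs = 0`, `hR : r*ds*g*d*r = r`,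
    `hR : r*g'*ds*d*r = r`, `h152a`, `h152b`), with `r ↦ B9H163.R Δ Q′ a`, `g' ↦ B9H163.G' Δ Q′ a`, `g ↦ G₁`, `d ↦ D`, `ds
    ↦ Dᵀ`, `q ↦ Qv`, `qs ↦ Qvᵀ` — r1's theorems (one ring, square data) are neither restated nor instantiated.

WHAT THIS FILE PROVES (kernel-checked, no `sorry`; [folklore] = standard finite-dimensional Gaussian/linear algebra).
§1 `complete_square`; `integral_exp_source`: ∫ exp(−½vᵀAv + hᵀv) dv = exp(½hᵀA⁻¹h)·√(2π)^{|ι|}/√det A for `A` positive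
definite (translation invariance of Lebesgue measure + [pv16's] `GaussianIntegral.integral_exp_neg_half_quadForm`, by
name — the tree had the source-free normalisation only); `genFun_eq` (normalised); `integral_exp_source_add` (a
`J`-type linear term shifts the mean, not the covariance); `genFun_map` (law of `Mv`: covariance `M T⁻¹ Mᵀ`);
`eq_of_quadForm_eq` / `eq_of_genFun_eq` (polarization: a symmetric matrix is determined by its generating function).
§2 `eq_3157` = the displayed (3.157) with `cov Δ C` on the right; `cov_eq_of_genFun` = "hence C^{(k)}(Λ) =
C(C*Δ_kC)⁻¹C*" (the symmetric operator DEFINED by the left member of (3.157) is `cov Δ C`); `eq_3157_flucCov` (the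
same generating function equals exp(½⟨g, flucCov Δ Q g⟩) in a kernel basis `QC = 0`).  §3 `eq_3158`: χC = 1 ⇒
χ(CT⁻¹Cᵀ)χᵀ = T⁻¹ (any commutative ring); `restrict_mul_elim` / `restrict_conj_eq_toBlocks₁₁` / `eq_3158_elim`: for
[pv03's] elimination parametrisation `ConstraintElimination.elim Qσ Qκ = [1; −Qκ⁻¹Qσ]` the principal Λ̃-block of `C
T⁻¹ Cᵀ` is `T⁻¹`.  §4 `eq_3175`, `eq_3175_symm`, `eq_3174` (any field; the `G = 0` case of an2's `flucCov_compForm` +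
the block identities `Q𝒢 = 0`, `QH′ = 1`, `H′ᴸQᵀ = 1`); `Hmin_eq_minOp`.  §5 `eq_3186`, `eq_3186_scalar` (an2's
`blocks_eq_of_reg` with `Envelope.constrProp` unfolded; `K` may be singular).  §6 `kkt_add_tilt`, `flucCov_add_tilt`
(CONSTRAINED WOODBURY: `flucCov (K + RᵀVR) Q̃ = 𝒢 − 𝒢Rᵀ(V⁻¹ + R𝒢Rᵀ)⁻¹R𝒢`, Mathlib's `Matrix.add_mul_mul_inv_eq_sub` on
the bordered matrix), `obs_flucCov_add_tilt`, `inv_add_smul_one`, and `b10_rep63_of_3185` / `b10_rep63_restrict` /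
`b10_rep63_real`: (3.185) ∧ (3.157) ∧ (χC = 1) ⇒ `P·G̃₃(x)·Pᵀ = C(T + x)⁻¹Cᵀ` and `χ(P·G̃₃(x)·Pᵀ)χᵀ = (T + x)⁻¹` —
B10's "represented by the integral (3.183) [5] with the additional term" follows from (3.185) by algebra, WITHOUT
re-running (3.159)–(3.184) with the extra term.  §7 (v1.1) `integrable_exp_source`; `action_translation` (the
translation λ = λ′ + H′μ: no cross term, an2's `transpose_mul_mul_minOp_eq_zero`), `eq_3173_fibre`, `integral_kernelBasis`,
`eq_3173_iterated` (the chain (3.173) = `Z_N·Z₁·e^{½fᵀ𝒢f}·e^{½fᵀH′C′H′ᵀf}`, `C′ = flucCov (effForm H Q′) Q′₁`);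
`posDef_fromBlocks_diag`, `jointParam_kernel`, `jointParam_form` (`PᵀHP = diag(N₁ᵀH_effN₁, NᵀHN)`), `jointParam_gram`,
`jointConstraint_gram` (the joint parametrisation `P = [H′N₁ | N]` is a kernel basis of `Q′₁Q′`), `eq_3173_joint`
(Fubini: Lebesgue measure on `σ ⊕ τ → ℝ` = product, Mathlib's `volume_measurePreserving_sumPiEquivProdPi_symm`), and
`eq_3175_measure`: `flucCov H (Q′₁Q′) = flucCov H Q′ + H′·flucCov (effForm H Q′) Q′₁·H′ᵀ` BY GAUSSIAN INTEGRATION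
(uniqueness of the covariance) — independent of §4's algebraic route through an2's `flucCov_compForm`.  §8 (v1.2)
`G'_mul_Δ_mul_kernel` (`G′ΔN = N`), `kernel_orth_G'Qt` (`NᵀΔ·G′Q′ᵀ = 0`), `isUnit_M'`, `R_mul_Δ_mul_kernel` (`R` fixes
`ΔN(Q′)`), `R_transpose`, `R_eq_kernelBasis`: `R = ΔN(NᵀΔ²N)⁻¹NᵀΔ` = the orthogonal projection onto `ΔN(Q′)` in
coordinates (the `Matrix`/scalar-`a` counterpart of gen-6's abstract `B9Eq325Proj.R325_eq_starProjection_fd`; hence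
`R_indep`: the same operator for every admissible `a`), `R_eq_226`: **R = Δ𝒢Δ** (B6 (2.26) / p. 426 L3), `eq_3172`: **G′R
= 𝒢Δ**, `frakG_mul_Δ'`, `eq_p426_chain` (the displayed chain `Δ𝒢 = Δ𝒢Δ′_aG′ = Δ𝒢ΔG′ = RG′`), `frakG_mul_Δ_mul_G'`,
`eq_227`: **𝒢 = G′² − G′²Q′ᵀM′⁻¹Q′G′²** (B6 (2.27) / p. 426 L4 — from `R = Δ𝒢Δ`, not by a Lagrange argument),
`frakG_constraints` (`Q′𝒢 = 𝒢Q′ᵀ = 0`), `eq_3152_of_3151` ((3.151) as hypothesis ⇒ both lines of (3.152));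
`integrable_exp_source_smul`, `integral_exp_source_smul` (the MEAN of the tilted Gaussian is `A⁻¹h`: translation +
[adv1's] odd-moment lemma `B9H163.integral_smul_even_eq_zero`), `mean_kernelBasis` (mean response of the δ-function
Gaussian = `𝒢g`), `eq_3151_mean` (the last equality of (3.151) in the normalised-mean reading), `h164_mean_kernelBasis`
([adv1's] measure-level (3.164) `B9H163.h164_mean` with its three integrability/normalisation hypotheses DISCHARGED for
Lebesgue measure on a kernel basis), `eq_3171` ((3.171) with 𝒢 in the (2.27) form), `eq_B6_225` (B6 (2.25) for `R` =
(3.25): the generating-function form; the density form (3.17) = (3.20) is gen-6's `B9Eq320Gauss`).  §9 (v1.3)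
`Q_mul_G'_mul_R` (`Q′G′R = 0`), `R_mul_R` (`R² = R`), `G'_mul_Δ`, `Δ_mul_G'` (`G′Δ = I − aG′Q′*Q′`, `ΔG′ = I − aQ′*Q′G′`),
`Δ_mul_G'_mul_R` (`ΔG′R = R`), `R_mul_G'_mul_Δ` (`RG′Δ = R`), `R_mul_Δ_mul_G'_mul_R`, `R_mul_G'_mul_Δ_mul_R` (`RΔG′R =
RG′ΔR = R`), `R_mul_G'_mul_DtD_mul_R` (**`RG′D*DR = R`** from (3.23) alone), `eq_p425_RDG₁DR` (**p. 425 `RD*G₁DR = R`**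
from (3.152) + (3.23)), `eq_3124_of_3152` (**p. 426 L9: `QG₁DR = QDG′R = D̄Q′G′R = 0`**, the three printed links),
`eq_3124a_of_3152` (`RD*G₁Q* = 0`), `sectD_hypotheses_of_3151` (from (3.151), (3.115), (3.23): (3.152), (3.124) for
`G₁`, and both `R`-identities — every hypothesis of [r1's] `B9.frakP_of_3146` / `q_mul_frakP` / `rds_mul_frakP` /
`frakG_3150` / `frakG_3153` except the inverse definitions `hg`, `hc`, in the matrix reading).

WHAT IT DOES NOT PROVE.  (3.185) itself, i.e. the identification of `K`, `P = (I + D̄μ)Q`, `Q̃` with the objects built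
in (3.159)–(3.184) and the δ-function/Jacobian bookkeeping with THOSE operators (C-B9-57 residual (i) — OPEN, by hand
only; §7 certifies the pattern on the displayed instance (3.171)–(3.175) only, in the kernel-parametrisation reading,
with the constant Jacobians absorbed into `Z_N`, `Z₁`); C′^{(k)}(Λ)'s "Dirichlet boundary conditions outside Λ" /
unit-lattice structure (not modelled: `Q′₁`, `N₁` are abstract); any BOUND: γ₀
(G-B9-09R), the random-walk expansions and the locality/decay of G̃₂, G̃₃(x), Q′𝒢̃Q′* (G-B9-10 (a)(b)(c), C-adv8-2;
B10's "non-negative, bounded and almost local", "the same properties as G̃₂" — G-B10-06 (ii)); the bond/orientation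
conventions of Λ̃ (G-adv8-1); B10's restriction `↾_{B(Λ_{k+1})}` and the (63) misprints (G-adv2-9 / D-adv2-1 /
D-b10.2); the identification of the `J`-dependent part of (3.156) (mean shift only, see the CAVEAT in (a)); B10's
endpoint `x = 0` of `∫₀^{2γ₁}` (there the statement is (3.185) with (3.158) itself; typed for `x ≠ 0`); the limit `a →
∞` behind "δ replaced by exp[−½⟨Q̃A,aQ̃A⟩]" (only the algebraic identity (3.186) at finite `a` is proved, which is
what is printed); (§8) the first two equalities of (3.151) — the `A`-integral, `δ_R(RD*A)`, `|det(Δ↾_{N(Q′)})|`, `Z⁻¹(J)`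
and the claim that this prefactor times the λ-integral's mass is 1 (Faddeev–Popov bookkeeping, C-B9-57 (i)): (3.152)
is derived FROM (3.151) taken as a hypothesis; that (3.25) is the operator "defined by the integral (3.17)" is not
re-derived here (gen-6 `B9Eq320Gauss`/`B9Eq325Proj` type (3.17) → (3.20)–(3.25) abstractly; §8 works with (3.25) :=
[adv1's] `B9H163.R`); the wavy half `G̃′R̃ = 𝒢̃Δ` of (3.172) is the same theorem for the wavy data and is not separately
typed; B6's "imply the representation (2.17)" is not typed (p. 426 L9's "(3.152) imply (3.124)" IS, §9); B6's own
definitions of G′, Q′ (its Sect. 2) are not re-read — (2.25)–(2.27) are typed over the B9 dictionary; (§9) (3.124) for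
Sect. D's own `G` (`G⁻¹ = Δ_π + DRD* + Q*aQ`, p. 420), its Gaussian proof (3.125), (3.129), B6 (2.30)/(2.34), and the
p. 425 route "by the same method as used in the proof of (3.124)" are NOT typed — `RD*G₁DR = R` is obtained from
(3.152) and (3.23) by algebra instead; (3.115) and (3.23) are hypotheses, not derived from lattice definitions; the 𝔓-,
𝔊-identities (3.147), (3.150), (3.153) themselves are [r1's] ring theorems and are not instantiated at rectangular data.
Value = kernel certificate that the covariance identities (3.157), (3.158), (3.174), (3.175), (3.186), B10's
(63)-representation GIVEN (3.185), "R = Δ𝒢Δ" / (2.27) / (3.172) / (3.152) ⇐ (3.151), and (§9) (3.152) ⇒ "(3.124) for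
G₁" ∧ "RD*G₁DR = R" are exact finite-dimensional algebra/Gaussian calculus with the stated invertibility hypotheses —
located bookkeeping, NOT summit progress (not continuum, not Clay). -/

namespace Literature.MathematicalPhysics.QuantumFieldTheory.Balaban1983to89.B9SectECov

open MeasureTheory Matrix Real
open scoped Matrix
open Literature.MathematicalPhysics.QuantumFieldTheory.Balaban1983to89.Beta.Composition (kkt blockProp compForm)
open Literature.MathematicalPhysics.QuantumFieldTheory.Balaban1983to89.Beta.CompositionSingular
open Literature.MathematicalPhysics.QuantumFieldTheory.Balaban1983to89.Beta (GaussianIntegral.integral_exp_neg_half_quadForm)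

/-! ## §1  The Gaussian generating function with a source on `ι → ℝ` -/

section GenFun

variable {ι : Type*} [Fintype ι] [DecidableEq ι]

/-- COMPLETING THE SQUARE: `−½(v + A⁻¹h)ᵀA(v + A⁻¹h) + hᵀ(v + A⁻¹h) = −½ vᵀAv + ½ hᵀA⁻¹h` for symmetric
nonsingular `A`. [folklore] -/
theorem complete_square (A : Matrix ι ι ℝ) (hAT : Aᵀ = A) (hA : IsUnit A.det) (h v : ι → ℝ) :
    -(1/2 : ℝ) * ((v + A⁻¹ *ᵥ h) ⬝ᵥ A *ᵥ (v + A⁻¹ *ᵥ h)) + h ⬝ᵥ (v + A⁻¹ *ᵥ h) =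
      -(1/2 : ℝ) * (v ⬝ᵥ A *ᵥ v) + (1/2 : ℝ) * (h ⬝ᵥ A⁻¹ *ᵥ h) := by
  set u := A⁻¹ *ᵥ h with hu
  have hAu : A *ᵥ u = h := by rw [hu, mulVec_mulVec, mul_nonsing_inv _ hA, one_mulVec]
  have h1 : u ⬝ᵥ (A *ᵥ v) = h ⬝ᵥ v := by
    rw [dotProduct_mulVec, ← mulVec_transpose, hAT, hAu]
  have h2 : v ⬝ᵥ h = h ⬝ᵥ v := dotProduct_comm _ _
  have h3 : u ⬝ᵥ h = h ⬝ᵥ u := dotProduct_comm _ _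
  simp only [mulVec_add, hAu, add_dotProduct, dotProduct_add, h1, h2, h3]
  ring

omit [Fintype ι] [DecidableEq ι] in
/-- Symmetry of a real positive definite matrix as `Aᵀ = A`. [folklore] -/
theorem transpose_eq_of_posDef {A : Matrix ι ι ℝ} (hA : A.PosDef) : Aᵀ = A :=
  (Matrix.isHermitian_iff_isSymm.mp hA.isHermitian)

/-- The normalisation `Z_A = √(2π)^{|ι|}/√(det A)` is positive. [folklore] -/
theorem gaussNorm_pos {A : Matrix ι ι ℝ} (hA : A.PosDef) :
    0 < Real.sqrt (2 * π) ^ Fintype.card ι / Real.sqrt A.det :=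
  div_pos (pow_pos (Real.sqrt_pos.mpr (by positivity)) _) (Real.sqrt_pos.mpr hA.det_pos)

/-- THE GAUSSIAN GENERATING FUNCTION WITH A SOURCE (Lebesgue measure on `ι → ℝ`, `A` positive definite):
`∫ exp(−½ vᵀAv + hᵀv) dv = exp(½ hᵀA⁻¹h) · √(2π)^{|ι|}/√(det A)` — translation `v ↦ v + A⁻¹h` (Lebesgue measure is
translation invariant) and `Beta.GaussianIntegral.integral_exp_neg_half_quadForm` (consumed by name). [folklore] -/
theorem integral_exp_source (A : Matrix ι ι ℝ) (hA : A.PosDef) (h : ι → ℝ) :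
    ∫ v : ι → ℝ, Real.exp (-(1/2 : ℝ) * (v ⬝ᵥ A *ᵥ v) + h ⬝ᵥ v) =
      Real.exp ((1/2 : ℝ) * (h ⬝ᵥ A⁻¹ *ᵥ h)) * (Real.sqrt (2 * π) ^ Fintype.card ι / Real.sqrt A.det) := by
  have hAT : Aᵀ = A := transpose_eq_of_posDef hA
  have hAd : IsUnit A.det := (Matrix.isUnit_iff_isUnit_det _).mp hA.isUnit
  calc ∫ v : ι → ℝ, Real.exp (-(1/2 : ℝ) * (v ⬝ᵥ A *ᵥ v) + h ⬝ᵥ v)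
      = ∫ v : ι → ℝ, Real.exp (-(1/2 : ℝ) * ((v + A⁻¹ *ᵥ h) ⬝ᵥ A *ᵥ (v + A⁻¹ *ᵥ h)) +
          h ⬝ᵥ (v + A⁻¹ *ᵥ h)) :=
        (integral_add_right_eq_self (μ := (volume : Measure (ι → ℝ)))
          (fun v : ι → ℝ => Real.exp (-(1/2 : ℝ) * (v ⬝ᵥ A *ᵥ v) + h ⬝ᵥ v)) (A⁻¹ *ᵥ h)).symm
    _ = ∫ v : ι → ℝ, Real.exp (-(1/2 : ℝ) * (v ⬝ᵥ A *ᵥ v)) * Real.exp ((1/2 : ℝ) * (h ⬝ᵥ A⁻¹ *ᵥ h)) := by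
        congr 1
        funext v
        rw [complete_square A hAT hAd h v, Real.exp_add]
    _ = Real.exp ((1/2 : ℝ) * (h ⬝ᵥ A⁻¹ *ᵥ h)) * (Real.sqrt (2 * π) ^ Fintype.card ι / Real.sqrt A.det) := by
        rw [integral_mul_const, GaussianIntegral.integral_exp_neg_half_quadForm A hA, mul_comm]

/-- NORMALISED FORM: `Z_A⁻¹ ∫ exp(−½ vᵀAv + hᵀv) dv = exp(½ hᵀA⁻¹h)`, `Z_A := ∫ exp(−½ vᵀAv) dv`. [folklore] -/
theorem genFun_eq (A : Matrix ι ι ℝ) (hA : A.PosDef) (h : ι → ℝ) :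
    (∫ v : ι → ℝ, Real.exp (-(1/2 : ℝ) * (v ⬝ᵥ A *ᵥ v)))⁻¹ *
        ∫ v : ι → ℝ, Real.exp (-(1/2 : ℝ) * (v ⬝ᵥ A *ᵥ v) + h ⬝ᵥ v) =
      Real.exp ((1/2 : ℝ) * (h ⬝ᵥ A⁻¹ *ᵥ h)) := by
  rw [integral_exp_source A hA h, GaussianIntegral.integral_exp_neg_half_quadForm A hA, mul_left_comm,
    inv_mul_cancel₀ (gaussNorm_pos hA).ne', mul_one]

/-- SHIFTED SOURCE (the non-centred Gaussian, a linear `J`-type term `jᵀv` already present):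
`∫ exp(−½ vᵀAv + (j + h)ᵀv) dv = exp(hᵀA⁻¹j + ½ hᵀA⁻¹h) · ∫ exp(−½ vᵀAv + jᵀv) dv` — the `h`-quadratic part
(the covariance) does not see `j`. [folklore] -/
theorem integral_exp_source_add (A : Matrix ι ι ℝ) (hA : A.PosDef) (j h : ι → ℝ) :
    ∫ v : ι → ℝ, Real.exp (-(1/2 : ℝ) * (v ⬝ᵥ A *ᵥ v) + (j + h) ⬝ᵥ v) =
      Real.exp (h ⬝ᵥ A⁻¹ *ᵥ j + (1/2 : ℝ) * (h ⬝ᵥ A⁻¹ *ᵥ h)) *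
        ∫ v : ι → ℝ, Real.exp (-(1/2 : ℝ) * (v ⬝ᵥ A *ᵥ v) + j ⬝ᵥ v) := by
  have hAT : Aᵀ = A := transpose_eq_of_posDef hA
  have hiT : (A⁻¹)ᵀ = A⁻¹ := by rw [transpose_nonsing_inv, hAT]
  have hjh : j ⬝ᵥ A⁻¹ *ᵥ h = h ⬝ᵥ A⁻¹ *ᵥ j := by
    rw [dotProduct_mulVec, ← mulVec_transpose, hiT, dotProduct_comm]
  rw [integral_exp_source A hA (j + h), integral_exp_source A hA j, ← mul_assoc, ← Real.exp_add]
  congr 2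
  simp only [mulVec_add, add_dotProduct, dotProduct_add, hjh]
  ring

variable {κ : Type*} [Fintype κ]

omit [DecidableEq ι] in
/-- `(Mᵀg)ᵀv = gᵀ(Mv)`: a source coupled through a linear observation map. [folklore] -/
theorem transpose_mulVec_dotProduct (M : Matrix κ ι ℝ) (g : κ → ℝ) (v : ι → ℝ) :
    (Mᵀ *ᵥ g) ⬝ᵥ v = g ⬝ᵥ (M *ᵥ v) := by
  rw [mulVec_transpose, ← dotProduct_mulVec]

omit [DecidableEq ι] in
/-- `(Mᵀg)ᵀ T (Mᵀg) = gᵀ (M T Mᵀ) g`. [folklore] -/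
theorem transpose_mulVec_quadForm (M : Matrix κ ι ℝ) (T : Matrix ι ι ℝ) (g : κ → ℝ) :
    (Mᵀ *ᵥ g) ⬝ᵥ T *ᵥ (Mᵀ *ᵥ g) = g ⬝ᵥ (M * T * Mᵀ) *ᵥ g := by
  rw [transpose_mulVec_dotProduct, mulVec_mulVec, mulVec_mulVec]

/-- THE GENERATING FUNCTION OF A LINEAR OBSERVABLE: for `T` positive definite on `ι → ℝ` and any `M : κ × ι`,
`Z_T⁻¹ ∫ exp(−½ vᵀTv + vᵀ(Mᵀg)) dv = exp(½ gᵀ(M T⁻¹ Mᵀ)g)` — the law of `Mv` has covariance `M T⁻¹ Mᵀ`. [folklore] -/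
theorem genFun_map (T : Matrix ι ι ℝ) (hT : T.PosDef) (M : Matrix κ ι ℝ) (g : κ → ℝ) :
    (∫ v : ι → ℝ, Real.exp (-(1/2 : ℝ) * (v ⬝ᵥ T *ᵥ v)))⁻¹ *
        ∫ v : ι → ℝ, Real.exp (-(1/2 : ℝ) * (v ⬝ᵥ T *ᵥ v) + v ⬝ᵥ (Mᵀ *ᵥ g)) =
      Real.exp ((1/2 : ℝ) * (g ⬝ᵥ (M * T⁻¹ * Mᵀ) *ᵥ g)) := by
  simp_rw [dotProduct_comm _ (Mᵀ *ᵥ g)]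
  rw [genFun_eq T hT, transpose_mulVec_quadForm]

omit [Fintype κ] in
/-- The observed covariance `M T⁻¹ Mᵀ` is symmetric for symmetric `T`. [folklore] -/
theorem transpose_obsCov (M : Matrix κ ι ℝ) (T : Matrix ι ι ℝ) (hT : Tᵀ = T) :
    (M * T⁻¹ * Mᵀ)ᵀ = M * T⁻¹ * Mᵀ := by
  rw [transpose_mul, transpose_mul, transpose_transpose, transpose_nonsing_inv, hT, Matrix.mul_assoc]

/-- A symmetric real matrix with vanishing quadratic form vanishes (polarization). [folklore] -/
theorem eq_zero_of_quadForm_eq_zero {D : Matrix κ κ ℝ} (hD : Dᵀ = D) (h0 : ∀ g : κ → ℝ, g ⬝ᵥ D *ᵥ g = 0) :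
    D = 0 := by
  have hbil : ∀ x y : κ → ℝ, x ⬝ᵥ D *ᵥ y = 0 := by
    intro x y
    have hxy := h0 (x + y)
    have hyx : y ⬝ᵥ D *ᵥ x = x ⬝ᵥ D *ᵥ y := by
      rw [dotProduct_mulVec, ← mulVec_transpose, hD, dotProduct_comm]
    rw [mulVec_add, add_dotProduct, dotProduct_add, dotProduct_add, h0 x, h0 y, hyx] at hxy
    linarith
  refine Matrix.ext_iff_mulVec.mpr fun y => ?_
  rw [zero_mulVec]
  exact dotProduct_self_eq_zero.mp (hbil (D *ᵥ y) y)

/-- UNIQUENESS OF THE COVARIANCE: two symmetric real matrices with the same quadratic form are equal. [folklore] -/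
theorem eq_of_quadForm_eq {M N : Matrix κ κ ℝ} (hM : Mᵀ = M) (hN : Nᵀ = N)
    (h : ∀ g : κ → ℝ, g ⬝ᵥ M *ᵥ g = g ⬝ᵥ N *ᵥ g) : M = N := by
  have hD : M - N = 0 :=
    eq_zero_of_quadForm_eq_zero (D := M - N) (by rw [transpose_sub, hM, hN]) fun g => by
      rw [sub_mulVec, dotProduct_sub, h g, sub_self]
  exact sub_eq_zero.mp hD

/-- … hence two symmetric matrices with the same Gaussian generating function `g ↦ exp(½ gᵀ·g)` are equal. [folklore] -/
theorem eq_of_genFun_eq {M N : Matrix κ κ ℝ} (hM : Mᵀ = M) (hN : Nᵀ = N)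
    (h : ∀ g : κ → ℝ, Real.exp ((1/2 : ℝ) * (g ⬝ᵥ M *ᵥ g)) = Real.exp ((1/2 : ℝ) * (g ⬝ᵥ N *ᵥ g))) :
    M = N :=
  eq_of_quadForm_eq hM hN fun g =>
    mul_left_cancel₀ (by norm_num : (1/2 : ℝ) ≠ 0) (Real.exp_eq_exp.mp (h g))

end GenFun

/-! ## §2  (3.157): `exp(½⟨g, C^{(k)}(Λ)g⟩) = Z′⁻¹ ∫ dB̃ exp[−½⟨B̃, C*Δ_kCB̃⟩ + ⟨B̃, C*g⟩] = exp(½⟨C*g,(C*Δ_kC)⁻¹C*g⟩)`,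
## "hence `C^{(k)}(Λ) = C(C*Δ_kC)⁻¹C*`" -/

section Eq3157

variable {ι κ : Type*} [Fintype ι] [Fintype κ] [DecidableEq ι]

/-- **(3.157)**, the displayed chain of equalities, literally: for `C : κ × ι` real with `CᵀΔC` positive definite
(B9: "a positive definite operator C*Δ_kC with a lower bound γ₀ > 0"),
`Z′⁻¹ ∫_{ι → ℝ} exp[−½⟨B̃, CᵀΔC B̃⟩ + ⟨B̃, Cᵀg⟩] dB̃ = exp(½⟨g, C(CᵀΔC)⁻¹Cᵀ g⟩)` with `C(CᵀΔC)⁻¹Cᵀ = Beta.LogDetHessian.cov Δ C`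
(consumed by name). [cite: Balaban1985BackgroundPropagators, (3.157) p.428] -/
theorem eq_3157 (Δ : Matrix κ κ ℝ) (C : Matrix κ ι ℝ) (hT : (Cᵀ * Δ * C).PosDef) (g : κ → ℝ) :
    (∫ v : ι → ℝ, Real.exp (-(1/2 : ℝ) * (v ⬝ᵥ (Cᵀ * Δ * C) *ᵥ v)))⁻¹ *
        ∫ v : ι → ℝ, Real.exp (-(1/2 : ℝ) * (v ⬝ᵥ (Cᵀ * Δ * C) *ᵥ v) + v ⬝ᵥ (Cᵀ *ᵥ g)) =
      Real.exp ((1/2 : ℝ) * (g ⬝ᵥ (Beta.LogDetHessian.cov Δ C) *ᵥ g)) :=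
  genFun_map (Cᵀ * Δ * C) hT C g

/-- `Beta.LogDetHessian.cov Δ C = C(CᵀΔC)⁻¹Cᵀ` is symmetric when `CᵀΔC` is. [folklore] -/
theorem transpose_cov (Δ : Matrix κ κ ℝ) (C : Matrix κ ι ℝ) (hT : (Cᵀ * Δ * C)ᵀ = Cᵀ * Δ * C) :
    (Beta.LogDetHessian.cov Δ C)ᵀ = Beta.LogDetHessian.cov Δ C :=
  transpose_obsCov C (Cᵀ * Δ * C) hT

/-- **"hence `C^{(k)}(Λ) = C(C*Δ_kC)⁻¹C*`"**: the symmetric operator `𝒞` DEFINED by the generating function on the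
left of (3.157) (`exp(½⟨g, 𝒞g⟩) = Z′⁻¹∫dB̃ exp[−½⟨B̃, C*Δ_kCB̃⟩ + ⟨B̃, C*g⟩]` for all `g`) IS `C(C*Δ_kC)⁻¹C*` — uniqueness
of a symmetric covariance from its generating function (`eq_of_genFun_eq`). [cite: Balaban1985BackgroundPropagators, (3.157) p.428] -/
theorem cov_eq_of_genFun (Δ : Matrix κ κ ℝ) (C : Matrix κ ι ℝ) (hT : (Cᵀ * Δ * C).PosDef)
    (𝒞 : Matrix κ κ ℝ) (h𝒞 : 𝒞ᵀ = 𝒞)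
    (hgen : ∀ g : κ → ℝ, Real.exp ((1/2 : ℝ) * (g ⬝ᵥ 𝒞 *ᵥ g)) =
      (∫ v : ι → ℝ, Real.exp (-(1/2 : ℝ) * (v ⬝ᵥ (Cᵀ * Δ * C) *ᵥ v)))⁻¹ *
        ∫ v : ι → ℝ, Real.exp (-(1/2 : ℝ) * (v ⬝ᵥ (Cᵀ * Δ * C) *ᵥ v) + v ⬝ᵥ (Cᵀ *ᵥ g))) :
    𝒞 = Beta.LogDetHessian.cov Δ C :=
  eq_of_genFun_eq h𝒞 (transpose_cov Δ C (transpose_eq_of_posDef hT)) fun g => by rw [hgen g, eq_3157 Δ C hT g]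

/-- THE SAME COVARIANCE IN THE BORDERED (δ-function) PICTURE: under the kernel-basis hypotheses of
`Beta.CompositionSingular.blocks_eq_kernelBasis` (`QC = 0`, `CᵀC`, `QQᵀ` nonsingular, `κ ≃ ι ⊕ τ`) the generating
function of (3.157) is `exp(½⟨g, flucCov Δ Q g⟩)` — the fluctuation covariance of `⟨B, ΔB⟩` on `{QB = 0}` read off the
bordered inverse `[[Δ, Qᵀ],[Q, 0]]⁻¹` (consumed by name; this is the "δ(QB)"-form of the same Gaussian integral, B9
(3.155)–(3.156)). [cite: Balaban1985BackgroundPropagators, (3.155)-(3.157) pp.427-428] -/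
theorem eq_3157_flucCov [DecidableEq κ] {τ : Type*} [Fintype τ] [DecidableEq τ] (e : κ ≃ ι ⊕ τ) (Δ : Matrix κ κ ℝ)
    (Q : Matrix τ κ ℝ) (C : Matrix κ ι ℝ) (hQC : Q * C = 0) (hA : IsUnit (Cᵀ * C).det)
    (hM : IsUnit (Q * Qᵀ).det) (hT : (Cᵀ * Δ * C).PosDef) (g : κ → ℝ) :
    (∫ v : ι → ℝ, Real.exp (-(1/2 : ℝ) * (v ⬝ᵥ (Cᵀ * Δ * C) *ᵥ v)))⁻¹ *
        ∫ v : ι → ℝ, Real.exp (-(1/2 : ℝ) * (v ⬝ᵥ (Cᵀ * Δ * C) *ᵥ v) + v ⬝ᵥ (Cᵀ *ᵥ g)) =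
      Real.exp ((1/2 : ℝ) * (g ⬝ᵥ (flucCov Δ Q) *ᵥ g)) := by
  rw [eq_3157 Δ C hT g,
    (blocks_eq_kernelBasis e Δ Q C hQC hA hM ((Matrix.isUnit_iff_isUnit_det _).mp hT.isUnit)).1]

end Eq3157

/-! ## §3  (3.158): `(C*Δ_kC)⁻¹ = C̃^{(k)}(Λ) = C^{(k)}(Λ)↾_Λ̃` — restriction to the free coordinates -/

section Eq3158

variable {R : Type*} [CommRing R]
variable {κ σ : Type*} [Fintype κ] [Fintype σ] [DecidableEq σ]

/-- **(3.158)**, abstractly: if `χ` is a left inverse of the parametrisation `C` (`χC = 1`: "B̃ = variables B restricted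
to the set of bonds Λ̃", `χ` = restriction to `Λ̃`, `C` = "identity operator on almost all bonds"), then the restriction of
the covariance `C T⁻¹ Cᵀ` to those coordinates is `T⁻¹`: `χ (C T⁻¹ Cᵀ) χᵀ = T⁻¹`. [cite: Balaban1985BackgroundPropagators, (3.158) p.428] -/
theorem eq_3158 (χ : Matrix σ κ R) (C : Matrix κ σ R) (T : Matrix σ σ R) (hχ : χ * C = 1) :
    χ * (C * T⁻¹ * Cᵀ) * χᵀ = T⁻¹ := by
  have hχ' : Cᵀ * χᵀ = 1 := by rw [← transpose_mul, hχ, transpose_one]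
  calc χ * (C * T⁻¹ * Cᵀ) * χᵀ = (χ * C) * T⁻¹ * (Cᵀ * χᵀ) := by simp only [Matrix.mul_assoc]
    _ = T⁻¹ := by rw [hχ, hχ', Matrix.one_mul, Matrix.mul_one]

/-- One-sided forms: `(C T⁻¹ Cᵀ) χᵀ = C T⁻¹` and `χ (C T⁻¹ Cᵀ) = T⁻¹ Cᵀ`. [folklore] -/
theorem cov_mul_transpose_restrict (χ : Matrix σ κ R) (C : Matrix κ σ R) (T : Matrix σ σ R) (hχ : χ * C = 1) :
    C * T⁻¹ * Cᵀ * χᵀ = C * T⁻¹ ∧ χ * (C * T⁻¹ * Cᵀ) = T⁻¹ * Cᵀ := by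
  have hχ' : Cᵀ * χᵀ = 1 := by rw [← transpose_mul, hχ, transpose_one]
  constructor
  · rw [Matrix.mul_assoc, hχ', Matrix.mul_one]
  · rw [← Matrix.mul_assoc, ← Matrix.mul_assoc, hχ, Matrix.one_mul]

/-- THE INSTANCE OF [pv03's] `Beta.ConstraintElimination.elim`: the elimination parametrisation
`C = fromRows 1 (−Qκ⁻¹Qσ) : (σ ⊕ κ) × σ` ("identity on the bonds of Λ̃, solved for on the bonds b₀(c)") has the
coordinate restriction `χ = fromCols 1 0` (keep the `σ`-coordinates) as a left inverse. [cite: Balaban1985BackgroundPropagators, (3.156)-(3.158) p.428] -/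
theorem restrict_mul_elim [DecidableEq κ] (Qσ : Matrix κ σ R) (Qκ : Matrix κ κ R) :
    fromCols (1 : Matrix σ σ R) (0 : Matrix σ κ R) * Beta.ConstraintElimination.elim Qσ Qκ = 1 := by
  rw [Beta.ConstraintElimination.elim, fromCols_mul_fromRows, Matrix.one_mul, Matrix.zero_mul, add_zero]

/-- The restriction `χ X χᵀ` by `χ = fromCols 1 0` IS the principal `σ × σ` block of `X`. [folklore] -/
theorem restrict_conj_eq_toBlocks₁₁ (X : Matrix (σ ⊕ κ) (σ ⊕ κ) R) :
    fromCols (1 : Matrix σ σ R) (0 : Matrix σ κ R) * X * (fromCols (1 : Matrix σ σ R) (0 : Matrix σ κ R))ᵀ =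
      X.toBlocks₁₁ := by
  conv_lhs => rw [← fromBlocks_toBlocks X]
  rw [fromCols_mul_fromBlocks, transpose_fromCols, fromCols_mul_fromRows]
  simp

/-- **(3.158) for the elimination parametrisation**: with `C = elim Qσ Qκ` and `T := CᵀΔC`, the principal
`Λ̃ × Λ̃` block of `C T⁻¹ Cᵀ` is `T⁻¹` — "`(C*Δ_kC)⁻¹ = C̃^{(k)}(Λ) = C^{(k)}(Λ)↾_Λ̃`". [cite: Balaban1985BackgroundPropagators, (3.158) p.428] -/
theorem eq_3158_elim [DecidableEq κ] (Qσ : Matrix κ σ R) (Qκ : Matrix κ κ R) (T : Matrix σ σ R) :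
    (Beta.ConstraintElimination.elim Qσ Qκ * T⁻¹ * (Beta.ConstraintElimination.elim Qσ Qκ)ᵀ).toBlocks₁₁ = T⁻¹ := by
  rw [← restrict_conj_eq_toBlocks₁₁, eq_3158 _ _ T (restrict_mul_elim Qσ Qκ)]

end Eq3158

/-! ## §4  (3.173)–(3.175): `𝒢̃ = 𝒢 + H′C′^{(k)}(Λ)H′*` and `C′^{(k)}(Λ) = Q′𝒢̃Q′*` — the two-step (marginal)
## identities of the bordered calculus, G = 0 case of `Beta.CompositionSingular.flucCov_compForm` -/

section Marginal

variable {𝕜 : Type*} [Field 𝕜]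
variable {ν μ κ : Type*} [Fintype ν] [Fintype μ] [Fintype κ] [DecidableEq ν] [DecidableEq μ] [DecidableEq κ]

omit [Fintype ν] [Fintype κ] [DecidableEq ν] [DecidableEq μ] [DecidableEq κ] in
/-- `compForm H Q 0 = H`. [folklore] -/
theorem compForm_zero (H : Matrix ν ν 𝕜) (Q : Matrix μ ν 𝕜) : compForm H Q 0 = H := by
  rw [compForm, Matrix.mul_zero, Matrix.zero_mul, add_zero]

/-- **(3.175)** `𝒢̃ = 𝒢 + H′ C′^{(k)}(Λ) H′*` in the bordered calculus: the fluctuation covariance of `H` about the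
COMPOSITE constraint `Q₂Q₁` (`𝒢̃`: fix `Q′₁(Q′λ)` and the rest of `Q′λ` off `Λ`) equals the one about the fine constraint `Q₁`
(`𝒢`: fix `Q′λ`) plus the minimiser `H′ = minOp H Q₁` ("the translation λ = λ′ + H′μ") applied to the covariance
`C′^{(k)}(Λ) = flucCov (effForm H Q₁) Q₂` of the block variable `μ` under `exp[−½‖ΔH′μ‖²]` (`effForm = H′ᵀ H H′`,
`transpose_minOp_mul_mul_minOp`) constrained by `Q₂`.  The `G = 0` case of `flucCov_compForm` (consumed by name).
[cite: Balaban1985BackgroundPropagators, (3.173),(3.175) p.431] -/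
theorem eq_3175 (H : Matrix ν ν 𝕜) (Q₁ : Matrix μ ν 𝕜) (Q₂ : Matrix κ μ 𝕜) (h1 : IsUnit (kkt H Q₁).det)
    (h2 : IsUnit (kkt (effForm H Q₁) Q₂).det) :
    flucCov H (Q₂ * Q₁) = flucCov H Q₁ + minOp H Q₁ * flucCov (effForm H Q₁) Q₂ * minOpL H Q₁ := by
  have h := flucCov_compForm H Q₁ 0 Q₂ h1 (by rwa [add_zero])
  rwa [add_zero, compForm_zero] at h

/-- **(3.174)** `C′^{(k)}(Λ) = Q′ 𝒢̃ Q′*`: observing the composite-constraint fluctuation through `Q₁` returns the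
block covariance — from (3.175) with `Q₁𝒢 = 0`, `Q₁H′ = 1`, `H′ᴸQ₁ᵀ = 1` ("doing the calculations in a reversed order").
[cite: Balaban1985BackgroundPropagators, (3.174) p.431] -/
theorem eq_3174 (H : Matrix ν ν 𝕜) (Q₁ : Matrix μ ν 𝕜) (Q₂ : Matrix κ μ 𝕜) (h1 : IsUnit (kkt H Q₁).det)
    (h2 : IsUnit (kkt (effForm H Q₁) Q₂).det) :
    Q₁ * flucCov H (Q₂ * Q₁) * Q₁ᵀ = flucCov (effForm H Q₁) Q₂ := by
  rw [eq_3175 H Q₁ Q₂ h1 h2, Matrix.mul_add, Matrix.add_mul, mul_flucCov H Q₁ h1, Matrix.zero_mul, zero_add,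
    ← Matrix.mul_assoc, ← Matrix.mul_assoc, mul_minOp H Q₁ h1, Matrix.one_mul, Matrix.mul_assoc,
    minOpL_mul_transpose H Q₁ h1, Matrix.mul_one]

/-- For SYMMETRIC `H` the left companion is the transpose, so (3.175) reads literally `𝒢̃ = 𝒢 + H′ C′ H′ᵀ`.
[cite: Balaban1985BackgroundPropagators, (3.175) p.431] -/
theorem eq_3175_symm (H : Matrix ν ν 𝕜) (Q₁ : Matrix μ ν 𝕜) (Q₂ : Matrix κ μ 𝕜) (hH : Hᵀ = H)
    (h1 : IsUnit (kkt H Q₁).det) (h2 : IsUnit (kkt (effForm H Q₁) Q₂).det) :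
    flucCov H (Q₂ * Q₁) = flucCov H Q₁ + minOp H Q₁ * flucCov (effForm H Q₁) Q₂ * (minOp H Q₁)ᵀ := by
  rw [eq_3175 H Q₁ Q₂ h1 h2, (minOpL_eq_transpose H Q₁ hH).1]

end Marginal

/-! ### The edge to [adv1's] `B9H163`: `H′` of (3.164) IS the bordered minimiser of `‖Δλ‖²` -/

section H163

variable {n m : Type*} [Fintype n] [Fintype m] [DecidableEq n] [DecidableEq m]

omit [Fintype m] [DecidableEq m] in
/-- `Q (Δ·Δ)⁻¹ Qᵀ = B9H163.M Δ Q` (`= Q Δ⁻¹Δ⁻¹ Qᵀ`). [folklore] -/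
theorem blockProp_sq_eq_M (Δ : Matrix n n ℝ) (Q : Matrix m n ℝ) : blockProp (Δ * Δ) Q = B9H163.M Δ Q := by
  rw [blockProp, B9H163.M, B9H163.G, Matrix.mul_inv_rev]
  simp only [Matrix.mul_assoc]

/-- `H′ = minOp (Δ²) Q′`: the explicit minimiser `H′ = Δ⁻²Q′*(Q′Δ⁻²Q′*)⁻¹` of (3.164) ([adv1's] `B9H163.Hmin`, by name)
is the `₁₂` block of the bordered inverse `[[Δ², Q′ᵀ],[Q′, 0]]⁻¹` ([an2's] `Beta.CompositionSingular.minOp`, by name) —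
so "the translation λ = λ′ + H′μ" of (3.173) is the one whose cross term vanishes. [cite: Balaban1985BackgroundPropagators, (3.164) p.429, (3.173) p.431] -/
theorem Hmin_eq_minOp (Δ : Matrix n n ℝ) (Q : Matrix m n ℝ) (hΔ : IsUnit Δ.det)
    (hM : IsUnit (B9H163.M Δ Q).det) : B9H163.Hmin Δ Q = minOp (Δ * Δ) Q := by
  have hΔΔ : IsUnit (Δ * Δ).det := by rw [det_mul]; exact hΔ.mul hΔ
  have hP : IsUnit (blockProp (Δ * Δ) Q).det := by rwa [blockProp_sq_eq_M]
  rw [minOp_eq_minMap (Δ * Δ) Q hΔΔ hP, blockProp_sq_eq_M, B9H163.Hmin, B9H163.G, Matrix.mul_inv_rev]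

end H163

/-! ## §5  (3.186): `G̃₂ = G₂ − G₂Q̃*(Q̃G₂Q̃*)⁻¹Q̃G₂` — the δ-function as the limit of the `a`-regularised weight -/

section Eq3186

variable {𝕜 : Type*} [Field 𝕜]
variable {ν μ : Type*} [Fintype ν] [Fintype μ] [DecidableEq ν] [DecidableEq μ]

/-- **(3.186)** `G̃₂ = G₂ − G₂Q̃*(Q̃G₂Q̃*)⁻¹Q̃G₂`: the covariance `G̃₂ = flucCov K Q̃` of the Gaussian `exp(−½⟨A, KA⟩)` with
`δ(Q̃A)` in terms of the covariance `G₂ = (K + Q̃*aQ̃)⁻¹` of the same Gaussian "with the δ-function δ(Q̃A) replaced by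
exp[−½⟨Q̃A, aQ̃A⟩]" (`a ↦ A` any `μ × μ` matrix making `K + Q̃ᵀAQ̃` and `Q̃G₂Q̃ᵀ` nonsingular; `K` itself may be singular).
`Beta.CompositionSingular.blocks_eq_of_reg` with `Beta.Envelope.constrProp` unfolded (both by name).
[cite: Balaban1985BackgroundPropagators, (3.186) p.432] -/
theorem eq_3186 (K : Matrix ν ν 𝕜) (Q : Matrix μ ν 𝕜) (A : Matrix μ μ 𝕜) (hG : IsUnit (K + Qᵀ * A * Q).det)
    (hP : IsUnit (Q * (K + Qᵀ * A * Q)⁻¹ * Qᵀ).det) :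
    flucCov K Q = (K + Qᵀ * A * Q)⁻¹ -
      (K + Qᵀ * A * Q)⁻¹ * Qᵀ * (Q * (K + Qᵀ * A * Q)⁻¹ * Qᵀ)⁻¹ * Q * (K + Qᵀ * A * Q)⁻¹ := by
  rw [(blocks_eq_of_reg K Q A hG hP).2.2]
  rfl

/-- (3.186) with Bałaban's scalar weight `a`: `G₂ = (K + a Q̃ᵀQ̃)⁻¹`. [cite: Balaban1985BackgroundPropagators, (3.186) p.432] -/
theorem eq_3186_scalar (K : Matrix ν ν 𝕜) (Q : Matrix μ ν 𝕜) (a : 𝕜) (hG : IsUnit (K + a • (Qᵀ * Q)).det)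
    (hP : IsUnit (Q * (K + a • (Qᵀ * Q))⁻¹ * Qᵀ).det) :
    flucCov K Q = (K + a • (Qᵀ * Q))⁻¹ -
      (K + a • (Qᵀ * Q))⁻¹ * Qᵀ * (Q * (K + a • (Qᵀ * Q))⁻¹ * Qᵀ)⁻¹ * Q * (K + a • (Qᵀ * Q))⁻¹ := by
  have h : Qᵀ * (a • (1 : Matrix μ μ 𝕜)) * Q = a • (Qᵀ * Q) := by
    rw [Matrix.mul_smul, Matrix.mul_one, Matrix.smul_mul]
  have := eq_3186 K Q (a • (1 : Matrix μ μ 𝕜)) (by rwa [h]) (by rwa [h])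
  rwa [h] at this

end Eq3186

/-! ## §6  The CONSTRAINED WOODBURY identity and the B10 (63) representation as a consequence of (3.185) -/

section Tilt

variable {𝕜 : Type*} [Field 𝕜]
variable {ν μ ρ : Type*} [Fintype ν] [Fintype μ] [Fintype ρ] [DecidableEq ν] [DecidableEq μ] [DecidableEq ρ]

omit [Fintype ν] [Fintype μ] [DecidableEq ν] [DecidableEq μ] [DecidableEq ρ] in
/-- A quadratic TILT `K ↦ K + RᵀVR` of the form is a low-rank update of the BORDERED matrix:
`kkt (K + RᵀVR) Q = kkt K Q + [Rᵀ; 0]·V·[R 0]`. [folklore] -/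
theorem kkt_add_tilt (K : Matrix ν ν 𝕜) (Q : Matrix μ ν 𝕜) (R : Matrix ρ ν 𝕜) (V : Matrix ρ ρ 𝕜) :
    kkt (K + Rᵀ * V * R) Q = kkt K Q + fromRows Rᵀ (0 : Matrix μ ρ 𝕜) * V * fromCols R (0 : Matrix ρ μ 𝕜) := by
  rw [kkt_eq_fromBlocks, kkt_eq_fromBlocks, fromRows_mul, fromRows_mul_fromCols, fromBlocks_add]
  simp

omit [DecidableEq ν] [DecidableEq μ] [DecidableEq ρ] in
/-- The `₁₁` block of a bordered conjugation `W·[U; 0]·N·[V 0]·W` is `W₁₁ U N V W₁₁`. [folklore] -/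
theorem toBlocks₁₁_border_conj (W : Matrix (ν ⊕ μ) (ν ⊕ μ) 𝕜) (U : Matrix ν ρ 𝕜) (N : Matrix ρ ρ 𝕜)
    (V : Matrix ρ ν 𝕜) :
    (W * fromRows U (0 : Matrix μ ρ 𝕜) * N * fromCols V (0 : Matrix ρ μ 𝕜) * W).toBlocks₁₁ =
      W.toBlocks₁₁ * U * N * V * W.toBlocks₁₁ := by
  conv_lhs => rw [← fromBlocks_toBlocks W]
  rw [fromBlocks_mul_fromRows, fromRows_mul, fromRows_mul_fromCols, fromBlocks_multiply, toBlocks_fromBlocks₁₁]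
  simp [Matrix.mul_assoc]

omit [Fintype ν] [Fintype μ] [DecidableEq ν] [DecidableEq μ] in
/-- `toBlocks₁₁` is additive. [folklore] -/
theorem toBlocks₁₁_sub (X Y : Matrix (ν ⊕ μ) (ν ⊕ μ) 𝕜) : (X - Y).toBlocks₁₁ = X.toBlocks₁₁ - Y.toBlocks₁₁ := rfl

omit [Fintype ρ] [DecidableEq ρ] in
/-- `[R 0]·(kkt K Q)⁻¹·[Rᵀ; 0] = R 𝒢 Rᵀ`, `𝒢 = flucCov K Q`. [folklore] -/
theorem obs_kktInv (K : Matrix ν ν 𝕜) (Q : Matrix μ ν 𝕜) (R : Matrix ρ ν 𝕜) :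
    fromCols R (0 : Matrix ρ μ 𝕜) * (kkt K Q)⁻¹ * fromRows Rᵀ (0 : Matrix μ ρ 𝕜) = R * flucCov K Q * Rᵀ := by
  rw [kktInv_eq_fromBlocks, fromCols_mul_fromBlocks, fromCols_mul_fromRows]
  simp

/-- **CONSTRAINED WOODBURY**: tilting the form by `RᵀVR` changes the fluctuation covariance ABOUT THE SAME CONSTRAINT
by the usual rank-`|ρ|` correction, `flucCov (K + RᵀVR) Q = 𝒢 − 𝒢Rᵀ(V⁻¹ + R𝒢Rᵀ)⁻¹R𝒢`, `𝒢 = flucCov K Q` — Mathlib's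
Woodbury identity `Matrix.add_mul_mul_inv_eq_sub` applied to the BORDERED matrix (`kkt_add_tilt`), `K` possibly singular.
[folklore] -/
theorem flucCov_add_tilt (K : Matrix ν ν 𝕜) (Q : Matrix μ ν 𝕜) (R : Matrix ρ ν 𝕜) (V : Matrix ρ ρ 𝕜)
    (hW : IsUnit (kkt K Q).det) (hV : IsUnit V.det) (hM : IsUnit (V⁻¹ + R * flucCov K Q * Rᵀ).det) :
    flucCov (K + Rᵀ * V * R) Q =
      flucCov K Q - flucCov K Q * Rᵀ * (V⁻¹ + R * flucCov K Q * Rᵀ)⁻¹ * R * flucCov K Q := by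
  have hW' : IsUnit (kkt K Q) := (Matrix.isUnit_iff_isUnit_det _).mpr hW
  have hV' : IsUnit V := (Matrix.isUnit_iff_isUnit_det _).mpr hV
  have hM' : IsUnit (V⁻¹ + fromCols R (0 : Matrix ρ μ 𝕜) * (kkt K Q)⁻¹ * fromRows Rᵀ (0 : Matrix μ ρ 𝕜)) := by
    rw [obs_kktInv]; exact (Matrix.isUnit_iff_isUnit_det _).mpr hM
  have key := Matrix.add_mul_mul_inv_eq_sub (kkt K Q) (fromRows Rᵀ (0 : Matrix μ ρ 𝕜)) V
    (fromCols R (0 : Matrix ρ μ 𝕜)) hW' hV' hM'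
  rw [obs_kktInv, ← kkt_add_tilt] at key
  change ((kkt (K + Rᵀ * V * R) Q)⁻¹).toBlocks₁₁ = _
  rw [key, toBlocks₁₁_sub, toBlocks₁₁_border_conj]
  rfl

variable {α σ : Type*} [Fintype α] [Fintype σ] [DecidableEq σ]

/-- OBSERVED FORM: tilting by `x ↦ ½(χPx)ᵀV(χPx)` (a weight on PART `χ` of an observable `P`) changes the observed
covariance `S = P𝒢Pᵀ` to `S − Sχᵀ(V⁻¹ + χSχᵀ)⁻¹χS`. [folklore] -/
theorem obs_flucCov_add_tilt (K : Matrix ν ν 𝕜) (Q : Matrix μ ν 𝕜) (P : Matrix α ν 𝕜) (χ : Matrix σ α 𝕜)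
    (V : Matrix σ σ 𝕜) (hW : IsUnit (kkt K Q).det) (hV : IsUnit V.det)
    (hM : IsUnit (V⁻¹ + χ * (P * flucCov K Q * Pᵀ) * χᵀ).det) :
    P * flucCov (K + (χ * P)ᵀ * V * (χ * P)) Q * Pᵀ =
      P * flucCov K Q * Pᵀ -
        P * flucCov K Q * Pᵀ * χᵀ * (V⁻¹ + χ * (P * flucCov K Q * Pᵀ) * χᵀ)⁻¹ * χ * (P * flucCov K Q * Pᵀ) := by
  have hRS : χ * P * flucCov K Q * (χ * P)ᵀ = χ * (P * flucCov K Q * Pᵀ) * χᵀ := by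
    rw [transpose_mul]; simp only [Matrix.mul_assoc]
  rw [flucCov_add_tilt K Q (χ * P) V hW hV (by rwa [hRS]), hRS, transpose_mul]
  simp only [Matrix.mul_sub, Matrix.sub_mul, Matrix.mul_assoc]

/-- `(x·1)(y·1) = (xy)·1`. [folklore] -/
theorem smul_one_mul_smul_one (x y : 𝕜) :
    (x • (1 : Matrix σ σ 𝕜)) * (y • (1 : Matrix σ σ 𝕜)) = (x * y) • (1 : Matrix σ σ 𝕜) := by
  rw [Matrix.smul_mul, Matrix.mul_smul, Matrix.one_mul, smul_smul]

/-- `(x·1)⁻¹ = x⁻¹·1` for `x ≠ 0`. [folklore] -/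
theorem inv_smul_one {x : 𝕜} (hx : x ≠ 0) : (x • (1 : Matrix σ σ 𝕜))⁻¹ = x⁻¹ • (1 : Matrix σ σ 𝕜) :=
  Matrix.inv_eq_left_inv (A := x • (1 : Matrix σ σ 𝕜)) (B := x⁻¹ • (1 : Matrix σ σ 𝕜))
    (by rw [smul_one_mul_smul_one, inv_mul_cancel₀ hx, one_smul])

/-- SCALAR WOODBURY: `(T + x)⁻¹ = T⁻¹ − T⁻¹(x⁻¹ + T⁻¹)⁻¹T⁻¹`. [folklore] -/
theorem inv_add_smul_one (T : Matrix σ σ 𝕜) (x : 𝕜) (hx : x ≠ 0) (hT : IsUnit T.det)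
    (hM : IsUnit (x⁻¹ • (1 : Matrix σ σ 𝕜) + T⁻¹).det) :
    (T + x • (1 : Matrix σ σ 𝕜))⁻¹ = T⁻¹ - T⁻¹ * (x⁻¹ • (1 : Matrix σ σ 𝕜) + T⁻¹)⁻¹ * T⁻¹ := by
  have hx1 : IsUnit (x • (1 : Matrix σ σ 𝕜)) :=
    ⟨⟨x • 1, x⁻¹ • 1, by rw [smul_one_mul_smul_one, mul_inv_cancel₀ hx, one_smul],
      by rw [smul_one_mul_smul_one, inv_mul_cancel₀ hx, one_smul]⟩, rfl⟩
  have key := Matrix.add_mul_mul_inv_eq_sub T (1 : Matrix σ σ 𝕜) (x • (1 : Matrix σ σ 𝕜)) (1 : Matrix σ σ 𝕜)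
    ((Matrix.isUnit_iff_isUnit_det _).mpr hT) hx1
    (by rw [inv_smul_one hx, Matrix.one_mul, Matrix.mul_one]; exact (Matrix.isUnit_iff_isUnit_det _).mpr hM)
  rw [Matrix.one_mul, Matrix.mul_one, inv_smul_one hx, Matrix.mul_one, Matrix.one_mul, Matrix.mul_one] at key
  exact key

/-- **B10 (63)'s representation as a KERNEL CONSEQUENCE OF (3.185).**  Abstractly: let `𝒢 = flucCov K Q̃` be the
covariance `G̃₂` of the Gaussian integral (3.183) (form `K` in the variable `A`, constraint `δ(Q̃A)`), `P` the observation
`A ↦ QA + D̄μ(QA) = (I + D̄μ)QA`, and ASSUME (3.185) with (3.157): `P·G̃₂·Pᵀ = C^{(k)}(Λ) = C T⁻¹ Cᵀ`, `T = C*Δ_kC`, and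
the Λ̃-coordinates `χ` with `χC = 1` ((3.158)).  Then the integral (3.183) "with the additional term
`−½x‖χ̃(QA + D̄μ(QA))‖²` under the exponential function", i.e. the form `K + x(χP)ᵀ(χP)` with the SAME δ-function, has
`P`-covariance `C(T + x)⁻¹Cᵀ`: "the operator `C(C*Δ_kC + xI)⁻¹C*` is represented by the integral (3.183) [5] with the
additional term".  Hypotheses: the bordered matrix of `(K, Q̃)`, `T` and `x⁻¹ + T⁻¹` nonsingular, `x ≠ 0` (over `ℝ` with
`T > 0`, `x > 0`: `b10_rep63_real`).  [cite: Balaban1985UV3, (63) p.272; Balaban1985BackgroundPropagators, (3.183),(3.185) p.432] -/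
theorem b10_rep63_of_3185 (K : Matrix ν ν 𝕜) (Q : Matrix μ ν 𝕜) (P : Matrix α ν 𝕜) (χ : Matrix σ α 𝕜)
    (C : Matrix α σ 𝕜) (T : Matrix σ σ 𝕜) (x : 𝕜) (hx : x ≠ 0) (hW : IsUnit (kkt K Q).det) (hT : IsUnit T.det)
    (hM : IsUnit (x⁻¹ • (1 : Matrix σ σ 𝕜) + T⁻¹).det)
    (h3185 : P * flucCov K Q * Pᵀ = C * T⁻¹ * Cᵀ) (hχ : χ * C = 1) :
    P * flucCov (K + (χ * P)ᵀ * (x • (1 : Matrix σ σ 𝕜)) * (χ * P)) Q * Pᵀ = C * (T + x • (1 : Matrix σ σ 𝕜))⁻¹ * Cᵀ := by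
  have hV : IsUnit (x • (1 : Matrix σ σ 𝕜)).det := by
    rw [det_smul, det_one, mul_one]; exact (hx.isUnit).pow _
  have hres : χ * (C * T⁻¹ * Cᵀ) * χᵀ = T⁻¹ := eq_3158 χ C T hχ
  obtain ⟨hr, hl⟩ := cov_mul_transpose_restrict χ C T hχ
  have hM' : IsUnit ((x • (1 : Matrix σ σ 𝕜))⁻¹ + χ * (P * flucCov K Q * Pᵀ) * χᵀ).det := by
    rwa [h3185, hres, inv_smul_one hx]
  rw [obs_flucCov_add_tilt K Q P χ _ hW hV hM', h3185, hres, inv_smul_one hx, hr, Matrix.mul_assoc _ χ (C * T⁻¹ * Cᵀ),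
    hl, inv_add_smul_one T x hx hT hM]
  simp only [Matrix.mul_sub, Matrix.sub_mul, Matrix.mul_assoc]

/-- … and restricted to the Λ̃-coordinates: "`(C*Δ_kC + xI)⁻¹ = (I + D̄μ)QG̃₃(x)Q*(I + μ*D̄*)↾`" — the `χ`-block of the
tilted observed covariance is `(T + x)⁻¹`. [cite: Balaban1985UV3, (63) p.272] -/
theorem b10_rep63_restrict (K : Matrix ν ν 𝕜) (Q : Matrix μ ν 𝕜) (P : Matrix α ν 𝕜) (χ : Matrix σ α 𝕜)
    (C : Matrix α σ 𝕜) (T : Matrix σ σ 𝕜) (x : 𝕜) (hx : x ≠ 0) (hW : IsUnit (kkt K Q).det) (hT : IsUnit T.det)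
    (hM : IsUnit (x⁻¹ • (1 : Matrix σ σ 𝕜) + T⁻¹).det)
    (h3185 : P * flucCov K Q * Pᵀ = C * T⁻¹ * Cᵀ) (hχ : χ * C = 1) :
    χ * (P * flucCov (K + (χ * P)ᵀ * (x • (1 : Matrix σ σ 𝕜)) * (χ * P)) Q * Pᵀ) * χᵀ =
      (T + x • (1 : Matrix σ σ 𝕜))⁻¹ := by
  rw [b10_rep63_of_3185 K Q P χ C T x hx hW hT hM h3185 hχ, eq_3158 χ C _ hχ]

end Tilt

/-! ### Over `ℝ`: the invertibility hypotheses from positivity (`T = C*Δ_kC > 0`, `x > 0`) -/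

section RealTilt

variable {ν μ α σ : Type*} [Fintype ν] [Fintype μ] [Fintype α] [Fintype σ]
variable [DecidableEq ν] [DecidableEq μ] [DecidableEq σ]

/-- For `T` positive definite and `x > 0`, `x⁻¹·1 + T⁻¹` is positive definite, hence nonsingular. [folklore] -/
theorem posDef_inv_smul_add_inv (T : Matrix σ σ ℝ) (hT : T.PosDef) {x : ℝ} (hx : 0 < x) :
    (x⁻¹ • (1 : Matrix σ σ ℝ) + T⁻¹).PosDef :=
  (Matrix.PosDef.one.smul (inv_pos.mpr hx)).add hT.inv

/-- **B10 (63) ⇐ (3.185), real form**: for `T = C*Δ_kC` positive definite ("with a lower bound γ₀ > 0") and `x > 0`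
(B10 integrates `x ∈ (0, 2γ₁)`), the only remaining hypothesis is the nonsingularity of the bordered matrix of (3.183).
[cite: Balaban1985UV3, (63) p.272; Balaban1985BackgroundPropagators, (3.185) p.432] -/
theorem b10_rep63_real (K : Matrix ν ν ℝ) (Q : Matrix μ ν ℝ) (P : Matrix α ν ℝ) (χ : Matrix σ α ℝ)
    (C : Matrix α σ ℝ) (T : Matrix σ σ ℝ) (hT : T.PosDef) {x : ℝ} (hx : 0 < x) (hW : IsUnit (kkt K Q).det)
    (h3185 : P * flucCov K Q * Pᵀ = C * T⁻¹ * Cᵀ) (hχ : χ * C = 1) :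
    P * flucCov (K + (χ * P)ᵀ * (x • (1 : Matrix σ σ ℝ)) * (χ * P)) Q * Pᵀ = C * (T + x • (1 : Matrix σ σ ℝ))⁻¹ * Cᵀ ∧
      χ * (P * flucCov (K + (χ * P)ᵀ * (x • (1 : Matrix σ σ ℝ)) * (χ * P)) Q * Pᵀ) * χᵀ =
        (T + x • (1 : Matrix σ σ ℝ))⁻¹ := by
  have hTu : IsUnit T.det := (Matrix.isUnit_iff_isUnit_det _).mp hT.isUnit
  have hM : IsUnit (x⁻¹ • (1 : Matrix σ σ ℝ) + T⁻¹).det :=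
    (Matrix.isUnit_iff_isUnit_det _).mp (posDef_inv_smul_add_inv T hT hx).isUnit
  exact ⟨b10_rep63_of_3185 K Q P χ C T x hx.ne' hW hTu hM h3185 hχ,
    b10_rep63_restrict K Q P χ C T x hx.ne' hW hTu hM h3185 hχ⟩

end RealTilt

/-! ## §7  (3.173) AT MEASURE LEVEL (v1.1): the δ-functions as kernel parametrisations, the translation
`λ = λ′ + H′μ`, Fubini, and (3.175) BY GAUSSIAN INTEGRATION

B9 p. 431 [PDF 43]: *"From (3.171) we obtain e^{1/2⟨f,𝒢̃f⟩} = Z̃′⁻¹∫dμ↾_Λ δ(Q′₁μ)∫dλ δ(Q′λ − μ)e^{−(1/2)‖Δλ‖² + ⟨λ,f⟩} =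
Z̃′⁻¹∫dμ↾_Λ δ(Q′₁μ)∫dλ δ(Q′λ′) exp[−½‖Δλ′‖² − ½‖ΔH′μ‖² + ⟨λ′,f⟩ + ⟨H′μ,f⟩] = e^{1/2⟨f,𝒢f⟩}Z̃′⁻¹Z′∫dμ δ(Q′₁μ)
exp[−½‖ΔH′μ‖² + ⟨μ,H′*f⟩] = e^{1/2⟨f,𝒢f⟩}e^{1/2⟨f,H′C′^{(k)}(Λ)H′*f⟩}. (3.173) The second equality was obtained by
the translation λ = λ′ + H′μ … The equality (3.173) gives 𝒢̃ = 𝒢 + H′C′^{(k)}(Λ)H′*, (3.175)"*.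
READING (D-b09.45, extending (b) above): `∫dλ δ(Q′λ − μ) F(λ)` ↦ `∫ F(H′μ + Nz) dz`, Lebesgue measure on the coordinates
`z : τ → ℝ` of a kernel basis `N` of `Q′` (`Q′N = 0`, `NᵀN` and `Q′Q′ᵀ` nonsingular, `ι ≃ τ ⊕ κ`; `H′ = minOp H Q′`, so
`Q′(H′μ + Nz) = μ`); `∫dμ↾_Λ δ(Q′₁μ) Φ(μ)` ↦ `∫ Φ(N₁w) dw` likewise (`Q′₁N₁ = 0`, `κ ≃ σ ⊕ ρ`); the action `½‖Δλ‖²` ↦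
`½ λᵀHλ` with `H` symmetric and positive definite on both kernels (`NᵀHN > 0`, `N₁ᵀH_effN₁ > 0`).  The constant
Jacobians of these parametrisations and `Z′`, `Z̃′` ↦ the explicit normalisations `Z_N = √(2π)^{|τ|}/√det(NᵀHN)`,
`Z₁ = √(2π)^{|σ|}/√det(N₁ᵀH_effN₁)`, which cancel in every normalised generating function (as in print).  Under this
reading the chain (3.173) is PROVED equality by equality (`action_translation`, `eq_3173_fibre`, `eq_3173_iterated`),
the joint δ-function Gaussian of (3.171) is a Gaussian over the joint kernel basis `P = [H′N₁ | N]` of `Q′₁Q′`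
(`jointParam_kernel/_form/_gram`, `jointConstraint_gram`, Fubini `eq_3173_joint`), and "(3.173) gives (3.175)" is
`eq_3175_measure` — a second, measure-theoretic derivation of §4's `eq_3175_symm`, by uniqueness of the covariance
(§1 `eq_of_genFun_eq`).  The (3.159)–(3.184) instance with the paper's concrete operators (C-B9-57 (i)) and every
locality statement ("unit lattice covariance with Dirichlet boundary conditions outside Λ") stay OUTSIDE this file. -/

open Literature.MathematicalPhysics.QuantumFieldTheory.Balaban1983to89.Beta (GaussianIntegral.integrable_exp_neg_half_quadForm)

section Translation

variable {ι κ τ : Type*} [Fintype ι] [Fintype κ] [Fintype τ] [DecidableEq ι] [DecidableEq κ] [DecidableEq τ]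

omit [Fintype κ] [DecidableEq ι] [DecidableEq κ] [DecidableEq τ] in
/-- The action of a parametrised configuration: `(Cv)ᵀ Δ (Cv) = vᵀ (CᵀΔC) v`. [folklore] -/
theorem config_quadForm (C : Matrix ι τ ℝ) (Δ : Matrix ι ι ℝ) (v : τ → ℝ) :
    (C *ᵥ v) ⬝ᵥ Δ *ᵥ (C *ᵥ v) = v ⬝ᵥ (Cᵀ * Δ * C) *ᵥ v := by
  rw [Matrix.mul_assoc, ← mulVec_mulVec, ← mulVec_mulVec, dotProduct_mulVec _ Cᵀ, vecMul_transpose]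

omit [Fintype κ] [DecidableEq ι] [DecidableEq κ] [DecidableEq τ] in
/-- The source of a parametrised configuration: `(Cv)ᵀ g = vᵀ (Cᵀ g)`. [folklore] -/
theorem config_source (C : Matrix ι τ ℝ) (g : ι → ℝ) (v : τ → ℝ) : (C *ᵥ v) ⬝ᵥ g = v ⬝ᵥ (Cᵀ *ᵥ g) := by
  rw [dotProduct_comm, ← transpose_mulVec_dotProduct, dotProduct_comm]

omit [Fintype κ] [Fintype τ] [DecidableEq κ] [DecidableEq τ] in
/-- INTEGRABILITY WITH A SOURCE: `v ↦ exp(−½ vᵀAv + hᵀv)` is Lebesgue integrable for `A` positive definite (completion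
of the square + translation invariance over pv16's `GaussianIntegral.integrable_exp_neg_half_quadForm`). [folklore] -/
theorem integrable_exp_source (A : Matrix ι ι ℝ) (hA : A.PosDef) (h : ι → ℝ) :
    Integrable (fun v : ι → ℝ => Real.exp (-(1/2 : ℝ) * (v ⬝ᵥ A *ᵥ v) + h ⬝ᵥ v)) := by
  have hAT : Aᵀ = A := transpose_eq_of_posDef hA
  have hAd : IsUnit A.det := (Matrix.isUnit_iff_isUnit_det _).mp hA.isUnit
  have key : (fun v : ι → ℝ => Real.exp (-(1/2 : ℝ) * (v ⬝ᵥ A *ᵥ v) + h ⬝ᵥ v)) =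
      fun v => Real.exp (-(1/2 : ℝ) * ((v - A⁻¹ *ᵥ h) ⬝ᵥ A *ᵥ (v - A⁻¹ *ᵥ h))) *
        Real.exp ((1/2 : ℝ) * (h ⬝ᵥ A⁻¹ *ᵥ h)) := by
    funext v
    rw [← Real.exp_add, ← complete_square A hAT hAd h (v - A⁻¹ *ᵥ h), sub_add_cancel]
  rw [key]
  exact ((GaussianIntegral.integrable_exp_neg_half_quadForm A hA).comp_sub_right (A⁻¹ *ᵥ h)).mul_const _

omit [DecidableEq τ] in
/-- THE TRANSLATION `λ = λ′ + H′μ` (B9 p. 431: "The second equality was obtained by the translation λ = λ′ + H′μ"),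
pointwise: for symmetric `H`, `Q N = 0` and `λ = H′y + Nz` (`H′ = minOp H Q`), the action splits with NO cross term,
`λᵀHλ = (H′y)ᵀH(H′y) + (Nz)ᵀH(Nz)` — an2's first-order condition `Nᵀ H H′ = 0`
(`CompositionSingular.transpose_mul_mul_minOp_eq_zero`, by name). [folklore] -/
theorem action_translation (H : Matrix ι ι ℝ) (Q : Matrix κ ι ℝ) (hH : Hᵀ = H) (hW : IsUnit (kkt H Q).det)
    (N : Matrix ι τ ℝ) (hN : Q * N = 0) (y : κ → ℝ) (z : τ → ℝ) :
    (minOp H Q *ᵥ y + N *ᵥ z) ⬝ᵥ H *ᵥ (minOp H Q *ᵥ y + N *ᵥ z) =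
      (minOp H Q *ᵥ y) ⬝ᵥ H *ᵥ (minOp H Q *ᵥ y) + (N *ᵥ z) ⬝ᵥ H *ᵥ (N *ᵥ z) := by
  have h0 : Nᵀ * H * minOp H Q = 0 := transpose_mul_mul_minOp_eq_zero H Q hW N hN
  have c1 : (N *ᵥ z) ⬝ᵥ H *ᵥ (minOp H Q *ᵥ y) = 0 := by
    rw [mulVec_mulVec, config_source, mulVec_mulVec, ← Matrix.mul_assoc, h0, zero_mulVec, dotProduct_zero]
  have c2 : (minOp H Q *ᵥ y) ⬝ᵥ H *ᵥ (N *ᵥ z) = 0 := by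
    rw [dotProduct_mulVec, ← mulVec_transpose, hH, dotProduct_comm]; exact c1
  rw [mulVec_add, add_dotProduct, dotProduct_add, dotProduct_add, c1, c2, add_zero, zero_add]

/-- The value of the action on the minimiser: `(H′y)ᵀ H (H′y) = yᵀ H_eff y` (an2's value identity
`transpose_minOp_mul_mul_minOp`, by name) — B9's `‖ΔH′μ‖²`. [folklore] -/
theorem action_minOp (H : Matrix ι ι ℝ) (Q : Matrix κ ι ℝ) (hW : IsUnit (kkt H Q).det) (y : κ → ℝ) :
    (minOp H Q *ᵥ y) ⬝ᵥ H *ᵥ (minOp H Q *ᵥ y) = y ⬝ᵥ effForm H Q *ᵥ y := by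
  rw [config_quadForm, transpose_minOp_mul_mul_minOp H Q hW]

omit [DecidableEq τ] in
/-- (3.173), SECOND EQUALITY — the fibre integral over `{λ : Q′λ = μ}` parametrised as `λ = H′μ + Nz` FACTORISES:
`∫dz exp[−½(H′y+Nz)ᵀH(H′y+Nz) + (H′y+Nz)ᵀf] = (∫dz exp[−½(Nz)ᵀH(Nz) + (Nz)ᵀf]) · exp[−½ yᵀH_eff y + (H′y)ᵀf]`
(B9: `∫dλ δ(Q′λ − μ)e^{−½‖Δλ‖² + ⟨λ,f⟩} = ∫dλ δ(Q′λ′) exp[−½‖Δλ′‖² − ½‖ΔH′μ‖² + ⟨λ′,f⟩ + ⟨H′μ,f⟩]` — the print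
keeps the measure symbol `dλ` after the substitution; v1.1/v1.2 wrote `dλ′` here, corrected in v1.3 after pv09-g8's
cross-read). [folklore] -/
theorem eq_3173_fibre (H : Matrix ι ι ℝ) (Q : Matrix κ ι ℝ) (hH : Hᵀ = H) (hW : IsUnit (kkt H Q).det)
    (N : Matrix ι τ ℝ) (hN : Q * N = 0) (f : ι → ℝ) (y : κ → ℝ) :
    ∫ z : τ → ℝ, Real.exp (-(1/2 : ℝ) * ((minOp H Q *ᵥ y + N *ᵥ z) ⬝ᵥ H *ᵥ (minOp H Q *ᵥ y + N *ᵥ z)) +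
        (minOp H Q *ᵥ y + N *ᵥ z) ⬝ᵥ f) =
      (∫ z : τ → ℝ, Real.exp (-(1/2 : ℝ) * ((N *ᵥ z) ⬝ᵥ H *ᵥ (N *ᵥ z)) + (N *ᵥ z) ⬝ᵥ f)) *
        Real.exp (-(1/2 : ℝ) * (y ⬝ᵥ effForm H Q *ᵥ y) + (minOp H Q *ᵥ y) ⬝ᵥ f) := by
  rw [← integral_mul_const]
  congr 1
  funext z
  rw [action_translation H Q hH hW N hN y z, action_minOp H Q hW y, add_dotProduct, ← Real.exp_add]
  congr 1
  ring

/-- THE GAUSSIAN INTEGRAL OVER A KERNEL BASIS, un-normalised: for a kernel basis `N` of `Q` (`QN = 0`, `NᵀN` and `QQᵀ`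
nonsingular, `ι ≃ τ ⊕ κ`) with `NᵀHN` positive definite,
`∫dz exp[−½(Nz)ᵀH(Nz) + (Nz)ᵀf] = Z_N · exp(½ fᵀ 𝒢 f)`, `𝒢 = flucCov H Q`, `Z_N = √(2π)^{|τ|}/√det(NᵀHN)`
(§2's `eq_3157_flucCov`). [folklore] -/
theorem integral_kernelBasis (e : ι ≃ τ ⊕ κ) (H : Matrix ι ι ℝ) (Q : Matrix κ ι ℝ) (N : Matrix ι τ ℝ)
    (hQN : Q * N = 0) (hNA : IsUnit (Nᵀ * N).det) (hQM : IsUnit (Q * Qᵀ).det) (hT : (Nᵀ * H * N).PosDef)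
    (f : ι → ℝ) :
    ∫ z : τ → ℝ, Real.exp (-(1/2 : ℝ) * ((N *ᵥ z) ⬝ᵥ H *ᵥ (N *ᵥ z)) + (N *ᵥ z) ⬝ᵥ f) =
      (Real.sqrt (2 * π) ^ Fintype.card τ / Real.sqrt (Nᵀ * H * N).det) *
        Real.exp ((1/2 : ℝ) * (f ⬝ᵥ flucCov H Q *ᵥ f)) := by
  simp_rw [config_quadForm, config_source N f]
  rw [← eq_3157_flucCov e H Q N hQN hNA hQM hT f, GaussianIntegral.integral_exp_neg_half_quadForm _ hT,
    ← mul_assoc, mul_inv_cancel₀ (gaussNorm_pos hT).ne', one_mul]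

end Translation

section Iterated

variable {ι κ τ σ ρ : Type*} [Fintype ι] [Fintype κ] [Fintype τ] [Fintype σ] [Fintype ρ]
  [DecidableEq ι] [DecidableEq κ] [DecidableEq τ] [DecidableEq σ] [DecidableEq ρ]

/-- (3.173), THIRD AND FOURTH EQUALITIES — the iterated integral EVALUATED: with `μ = N₁w` a kernel parametrisation of
`δ(Q′₁μ)` and `λ = H′μ + Nz` one of `δ(Q′λ − μ)`,
`∫dw ∫dz exp[−½λᵀHλ + λᵀf] = Z_N · Z₁ · e^{½ fᵀ𝒢f} · e^{½ fᵀ H′C′H′ᵀ f}`,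
where `𝒢 = flucCov H Q′`, `H′ = minOp H Q′`, and `C′ = flucCov (effForm H Q′) Q′₁` is the covariance "determined by the
last integral above" (`∫dμ δ(Q′₁μ) exp[−½‖ΔH′μ‖² + ⟨μ,H′*f⟩]`, B9's `C′^{(k)}(Λ)`). [folklore] -/
theorem eq_3173_iterated (e : ι ≃ τ ⊕ κ) (e₁ : κ ≃ σ ⊕ ρ) (H : Matrix ι ι ℝ) (hH : Hᵀ = H)
    (Q : Matrix κ ι ℝ) (N : Matrix ι τ ℝ) (hQN : Q * N = 0) (hNA : IsUnit (Nᵀ * N).det)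
    (hQM : IsUnit (Q * Qᵀ).det) (hT : (Nᵀ * H * N).PosDef)
    (Q₁ : Matrix ρ κ ℝ) (N₁ : Matrix κ σ ℝ) (hQN₁ : Q₁ * N₁ = 0) (hN₁A : IsUnit (N₁ᵀ * N₁).det)
    (hQ₁M : IsUnit (Q₁ * Q₁ᵀ).det) (hT₁ : (N₁ᵀ * effForm H Q * N₁).PosDef) (f : ι → ℝ) :
    ∫ w : σ → ℝ, ∫ z : τ → ℝ,
        Real.exp (-(1/2 : ℝ) * ((minOp H Q *ᵥ (N₁ *ᵥ w) + N *ᵥ z) ⬝ᵥ H *ᵥ (minOp H Q *ᵥ (N₁ *ᵥ w) + N *ᵥ z)) +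
          (minOp H Q *ᵥ (N₁ *ᵥ w) + N *ᵥ z) ⬝ᵥ f) =
      (Real.sqrt (2 * π) ^ Fintype.card τ / Real.sqrt (Nᵀ * H * N).det) *
        (Real.sqrt (2 * π) ^ Fintype.card σ / Real.sqrt (N₁ᵀ * effForm H Q * N₁).det) *
        (Real.exp ((1/2 : ℝ) * (f ⬝ᵥ flucCov H Q *ᵥ f)) *
          Real.exp ((1/2 : ℝ) * (f ⬝ᵥ (minOp H Q * flucCov (effForm H Q) Q₁ * (minOp H Q)ᵀ) *ᵥ f))) := by
  have hW : IsUnit (kkt H Q).det :=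
    isUnit_kkt_det_of_kernelBasis e H Q N hQN hNA hQM ((Matrix.isUnit_iff_isUnit_det _).mp hT.isUnit)
  simp_rw [eq_3173_fibre H Q hH hW N hQN f, integral_kernelBasis e H Q N hQN hNA hQM hT f]
  -- the outer integral: source `(H′N₁w)ᵀf = wᵀ(N₁ᵀ(H′ᵀf))`
  have hsrc : ∀ w : σ → ℝ, (minOp H Q *ᵥ (N₁ *ᵥ w)) ⬝ᵥ f = (N₁ *ᵥ w) ⬝ᵥ ((minOp H Q)ᵀ *ᵥ f) := fun w => by
    rw [config_source]
  simp_rw [hsrc]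
  rw [integral_const_mul, integral_kernelBasis e₁ (effForm H Q) Q₁ N₁ hQN₁ hN₁A hQ₁M hT₁ ((minOp H Q)ᵀ *ᵥ f),
    transpose_mulVec_quadForm]
  ring

end Iterated

section Joint

variable {ι κ τ σ ρ : Type*} [Fintype ι] [Fintype κ] [Fintype τ] [Fintype σ] [Fintype ρ]
  [DecidableEq ι] [DecidableEq κ] [DecidableEq τ] [DecidableEq σ] [DecidableEq ρ]

omit [DecidableEq τ] [DecidableEq σ] in
/-- A block-diagonal matrix with positive definite diagonal blocks is positive definite. [folklore] -/
theorem posDef_fromBlocks_diag {A : Matrix σ σ ℝ} {D : Matrix τ τ ℝ} (hA : A.PosDef) (hD : D.PosDef) :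
    (fromBlocks A 0 0 D).PosDef := by
  refine PosDef.of_dotProduct_mulVec_pos (IsHermitian.fromBlocks hA.1 (by simp) hD.1) fun x hx => ?_
  set a := x ∘ Sum.inl
  set b := x ∘ Sum.inr
  have hx' : x = Sum.elim a b := (Sum.elim_comp_inl_inr x).symm
  have key : star x ⬝ᵥ fromBlocks A 0 0 D *ᵥ x = star a ⬝ᵥ A *ᵥ a + star b ⬝ᵥ D *ᵥ b := by
    rw [star_trivial, star_trivial, star_trivial, hx', fromBlocks_mulVec, Sum.elim_comp_inl, Sum.elim_comp_inr,
      zero_mulVec, zero_mulVec, add_zero, zero_add, sumElim_dotProduct_sumElim]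
  rw [key]
  by_cases h1 : a = 0
  · have h2 : b ≠ 0 := by
      intro h2; apply hx; rw [hx', h1, h2]; ext i; cases i <;> rfl
    rw [h1, star_zero, zero_dotProduct, zero_add]
    exact hD.dotProduct_mulVec_pos h2
  · exact add_pos_of_pos_of_nonneg (hA.dotProduct_mulVec_pos h1) (hD.posSemidef.dotProduct_mulVec_nonneg _)

omit [Fintype τ] [Fintype σ] [Fintype ρ] [DecidableEq τ] [DecidableEq σ] [DecidableEq ρ] in
/-- THE JOINT PARAMETRISATION `P = [H′N₁ | N]` of the doubly constrained configurations `{λ : Q′₁Q′λ = 0}` lies in the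
kernel of `Q′₁Q′` (`Q′H′ = 1`, `Q′N = 0`, `Q′₁N₁ = 0`). [folklore] -/
theorem jointParam_kernel (H : Matrix ι ι ℝ) (Q : Matrix κ ι ℝ) (hW : IsUnit (kkt H Q).det) (N : Matrix ι τ ℝ)
    (hQN : Q * N = 0) (Q₁ : Matrix ρ κ ℝ) (N₁ : Matrix κ σ ℝ) (hQN₁ : Q₁ * N₁ = 0) :
    (Q₁ * Q) * fromCols (minOp H Q * N₁) N = 0 := by
  rw [mul_fromCols, Matrix.mul_assoc, ← Matrix.mul_assoc Q, mul_minOp H Q hW, Matrix.one_mul, hQN₁,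
    Matrix.mul_assoc, hQN, Matrix.mul_zero]
  ext i j; cases j <;> rfl

omit [Fintype τ] [Fintype σ] [DecidableEq τ] [DecidableEq σ] in
/-- In the joint parametrisation the action is BLOCK DIAGONAL: `Pᵀ H P = diag(N₁ᵀ H_eff N₁, Nᵀ H N)` (symmetric `H`;
no cross term by an2's first-order condition, value by an2's value identity). [folklore] -/
theorem jointParam_form (H : Matrix ι ι ℝ) (hH : Hᵀ = H) (Q : Matrix κ ι ℝ) (hW : IsUnit (kkt H Q).det)
    (N : Matrix ι τ ℝ) (hQN : Q * N = 0) (N₁ : Matrix κ σ ℝ) :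
    (fromCols (minOp H Q * N₁) N)ᵀ * H * fromCols (minOp H Q * N₁) N =
      fromBlocks (N₁ᵀ * effForm H Q * N₁) 0 0 (Nᵀ * H * N) := by
  have h0 : Nᵀ * H * minOp H Q = 0 := transpose_mul_mul_minOp_eq_zero H Q hW N hQN
  have h0' : (minOp H Q)ᵀ * H * N = 0 := by
    have := congrArg Matrix.transpose h0
    rwa [transpose_mul, transpose_mul, transpose_transpose, hH, transpose_zero, ← Matrix.mul_assoc] at this
  rw [transpose_fromCols, fromRows_mul, fromRows_mul_fromCols, transpose_mul]
  congr 1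
  · rw [Matrix.mul_assoc _ H, Matrix.mul_assoc, ← Matrix.mul_assoc (minOp H Q)ᵀ,
      ← Matrix.mul_assoc ((minOp H Q)ᵀ * H) (minOp H Q) N₁, transpose_minOp_mul_mul_minOp H Q hW,
      ← Matrix.mul_assoc]
  · rw [Matrix.mul_assoc _ (minOp H Q)ᵀ, Matrix.mul_assoc, h0', Matrix.mul_zero]
  · rw [← Matrix.mul_assoc, h0, Matrix.zero_mul]

omit [DecidableEq ι] in
/-- A kernel basis is injective: `NᵀN` nonsingular and `N z = 0` force `z = 0`. [folklore] -/
theorem eq_zero_of_kernelBasis {N : Matrix ι τ ℝ} (hNA : IsUnit (Nᵀ * N).det) {z : τ → ℝ} (hz : N *ᵥ z = 0) :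
    z = 0 :=
  Matrix.eq_zero_of_mulVec_eq_zero hNA.ne_zero (by rw [← mulVec_mulVec, hz, mulVec_zero])

/-- The joint parametrisation is a KERNEL BASIS, (i): `PᵀP` is nonsingular (`P` is injective: apply `Q′`, then use the
injectivity of `N₁` and `N`). [folklore] -/
theorem jointParam_gram (H : Matrix ι ι ℝ) (Q : Matrix κ ι ℝ) (hW : IsUnit (kkt H Q).det) (N : Matrix ι τ ℝ)
    (hQN : Q * N = 0) (hNA : IsUnit (Nᵀ * N).det) (N₁ : Matrix κ σ ℝ) (hN₁A : IsUnit (N₁ᵀ * N₁).det) :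
    IsUnit ((fromCols (minOp H Q * N₁) N)ᵀ * fromCols (minOp H Q * N₁) N).det := by
  set P := fromCols (minOp H Q * N₁) N with hP
  have hinj : Function.Injective P.mulVec := by
    intro v₁ v₂ h
    rw [← sub_eq_zero] at h ⊢
    rw [← mulVec_sub] at h
    set v := v₁ - v₂
    have hv : P *ᵥ v = minOp H Q *ᵥ (N₁ *ᵥ (v ∘ Sum.inl)) + N *ᵥ (v ∘ Sum.inr) := by
      rw [hP, fromCols_mulVec, mulVec_mulVec]
    have hQ : N₁ *ᵥ (v ∘ Sum.inl) = 0 := by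
      have := congrArg (Q.mulVec) h
      rwa [hv, mulVec_add, mulVec_mulVec, mulVec_mulVec, mul_minOp H Q hW, Matrix.one_mul, mulVec_mulVec, hQN,
        zero_mulVec, add_zero, mulVec_zero] at this
    have h1 : v ∘ Sum.inl = 0 := eq_zero_of_kernelBasis hN₁A hQ
    have h2 : v ∘ Sum.inr = 0 := by
      refine eq_zero_of_kernelBasis hNA ?_
      have := h; rwa [hv, hQ, mulVec_zero, zero_add] at this
    rw [← Sum.elim_comp_inl_inr v, h1, h2]
    ext i; cases i <;> rfl
  have hpd : (Pᵀ * P).PosDef := by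
    simpa only [conjTranspose_eq_transpose_of_trivial] using Matrix.PosDef.conjTranspose_mul_self P hinj
  exact (Matrix.isUnit_iff_isUnit_det _).mp hpd.isUnit

omit [DecidableEq ι] in
/-- A constraint map with `QQᵀ` nonsingular is onto: `x ᵥ* Q = 0` forces `x = 0`. [folklore] -/
theorem eq_zero_of_constraint {Q : Matrix κ ι ℝ} (hQM : IsUnit (Q * Qᵀ).det) {x : κ → ℝ} (hx : x ᵥ* Q = 0) :
    x = 0 :=
  Matrix.eq_zero_of_vecMul_eq_zero hQM.ne_zero (by rw [← vecMul_vecMul, hx, zero_vecMul])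

omit [DecidableEq ι] in
/-- The joint parametrisation is a kernel basis, (ii): the composite constraint `Q′₁Q′` is onto. [folklore] -/
theorem jointConstraint_gram (Q : Matrix κ ι ℝ) (hQM : IsUnit (Q * Qᵀ).det) (Q₁ : Matrix ρ κ ℝ)
    (hQ₁M : IsUnit (Q₁ * Q₁ᵀ).det) : IsUnit ((Q₁ * Q) * (Q₁ * Q)ᵀ).det := by
  have hinj : Function.Injective (Q₁ * Q).vecMul := by
    intro x₁ x₂ h
    rw [← sub_eq_zero] at h ⊢
    rw [← sub_vecMul, ← vecMul_vecMul] at h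
    exact eq_zero_of_constraint hQ₁M (eq_zero_of_constraint hQM h)
  have hpd : ((Q₁ * Q) * (Q₁ * Q)ᵀ).PosDef := by
    simpa only [conjTranspose_eq_transpose_of_trivial] using Matrix.PosDef.mul_conjTranspose_self (Q₁ * Q) hinj
  exact (Matrix.isUnit_iff_isUnit_det _).mp hpd.isUnit

/-- FUBINI FOR THE JOINT δ-FUNCTION GAUSSIAN: the integral over the joint parametrisation `λ = P v`, `v : σ ⊕ τ → ℝ`,
is the iterated integral over `(w, z)` (Lebesgue measure on `σ ⊕ τ → ℝ` is the product of those on `σ → ℝ` and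
`τ → ℝ`, Mathlib's `volume_measurePreserving_sumPiEquivProdPi_symm`; integrability from the positive definite
block-diagonal form). [folklore] -/
theorem eq_3173_joint (H : Matrix ι ι ℝ) (hH : Hᵀ = H) (Q : Matrix κ ι ℝ) (hW : IsUnit (kkt H Q).det)
    (N : Matrix ι τ ℝ) (hQN : Q * N = 0) (hT : (Nᵀ * H * N).PosDef) (N₁ : Matrix κ σ ℝ)
    (hT₁ : (N₁ᵀ * effForm H Q * N₁).PosDef) (f : ι → ℝ) :
    ∫ v : σ ⊕ τ → ℝ, Real.exp (-(1/2 : ℝ) * ((fromCols (minOp H Q * N₁) N *ᵥ v) ⬝ᵥ H *ᵥ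
        (fromCols (minOp H Q * N₁) N *ᵥ v)) + (fromCols (minOp H Q * N₁) N *ᵥ v) ⬝ᵥ f) =
      ∫ w : σ → ℝ, ∫ z : τ → ℝ,
        Real.exp (-(1/2 : ℝ) * ((minOp H Q *ᵥ (N₁ *ᵥ w) + N *ᵥ z) ⬝ᵥ H *ᵥ (minOp H Q *ᵥ (N₁ *ᵥ w) + N *ᵥ z)) +
          (minOp H Q *ᵥ (N₁ *ᵥ w) + N *ᵥ z) ⬝ᵥ f) := by
  set P := fromCols (minOp H Q * N₁) N with hP
  set g : (σ ⊕ τ → ℝ) → ℝ := fun v => Real.exp (-(1/2 : ℝ) * ((P *ᵥ v) ⬝ᵥ H *ᵥ (P *ᵥ v)) + (P *ᵥ v) ⬝ᵥ f)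
    with hg
  have hgi : Integrable g := by
    have : g = fun v => Real.exp (-(1/2 : ℝ) * (v ⬝ᵥ (Pᵀ * H * P) *ᵥ v) + (Pᵀ *ᵥ f) ⬝ᵥ v) := by
      funext v; rw [hg]; dsimp only; rw [config_quadForm, config_source, dotProduct_comm v (Pᵀ *ᵥ f)]
    rw [this]
    refine integrable_exp_source _ ?_ _
    rw [hP, jointParam_form H hH Q hW N hQN N₁]
    exact posDef_fromBlocks_diag hT₁ hT
  have hmp := MeasureTheory.volume_measurePreserving_sumPiEquivProdPi_symm (fun _ : σ ⊕ τ => ℝ)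
  have hsymm : ∀ p : (σ → ℝ) × (τ → ℝ),
      (MeasurableEquiv.sumPiEquivProdPi (fun _ : σ ⊕ τ => ℝ)).symm p = Sum.elim p.1 p.2 := fun p => by
    ext i; cases i <;> rfl
  have hPv : ∀ (w : σ → ℝ) (z : τ → ℝ), P *ᵥ Sum.elim w z = minOp H Q *ᵥ (N₁ *ᵥ w) + N *ᵥ z := fun w z => by
    rw [hP, fromCols_mulVec_sumElim, mulVec_mulVec]
  calc ∫ v, g v = ∫ p : (σ → ℝ) × (τ → ℝ), g ((MeasurableEquiv.sumPiEquivProdPi (fun _ : σ ⊕ τ => ℝ)).symm p) :=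
        (hmp.integral_comp' g).symm
    _ = ∫ w : σ → ℝ, ∫ z : τ → ℝ, g ((MeasurableEquiv.sumPiEquivProdPi (fun _ : σ ⊕ τ => ℝ)).symm (w, z)) :=
        integral_prod _ ((hmp.integrable_comp_emb (MeasurableEquiv.measurableEmbedding _)).mpr hgi)
    _ = _ := by simp_rw [hsymm, hg, hPv]

/-- (3.175) BY GAUSSIAN INTEGRATION — "The equality (3.173) gives 𝒢̃ = 𝒢 + H′C′^{(k)}(Λ)H′*": the covariance `𝒢̃` of
the joint δ-function Gaussian `δ(Q′₁μ)δ(Q′λ − μ)e^{−½λᵀHλ}` (= `flucCov H (Q′₁Q′)`, its generating function computed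
over the joint kernel basis `P` by (3.157)) equals `𝒢 + H′C′H′ᵀ` (the same generating function computed as the
iterated integral (3.173)), by uniqueness of the symmetric covariance (`eq_of_genFun_eq`).  Hypotheses: `H` symmetric,
kernel bases `N` of `Q′` (w.r.t. `H`) and `N₁` of `Q′₁` (w.r.t. `H_eff`) with positive definite reduced forms.  An
independent, measure-theoretic twin of §4's algebraic `eq_3175_symm`. [folklore] -/
theorem eq_3175_measure (e : ι ≃ τ ⊕ κ) (e₁ : κ ≃ σ ⊕ ρ) (H : Matrix ι ι ℝ) (hH : Hᵀ = H)
    (Q : Matrix κ ι ℝ) (N : Matrix ι τ ℝ) (hQN : Q * N = 0) (hNA : IsUnit (Nᵀ * N).det)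
    (hQM : IsUnit (Q * Qᵀ).det) (hT : (Nᵀ * H * N).PosDef)
    (Q₁ : Matrix ρ κ ℝ) (N₁ : Matrix κ σ ℝ) (hQN₁ : Q₁ * N₁ = 0) (hN₁A : IsUnit (N₁ᵀ * N₁).det)
    (hQ₁M : IsUnit (Q₁ * Q₁ᵀ).det) (hT₁ : (N₁ᵀ * effForm H Q * N₁).PosDef) :
    flucCov H (Q₁ * Q) = flucCov H Q + minOp H Q * flucCov (effForm H Q) Q₁ * (minOp H Q)ᵀ := by
  have hW : IsUnit (kkt H Q).det :=
    isUnit_kkt_det_of_kernelBasis e H Q N hQN hNA hQM ((Matrix.isUnit_iff_isUnit_det _).mp hT.isUnit)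
  set P := fromCols (minOp H Q * N₁) N with hP
  -- the joint kernel-basis data
  let e' : ι ≃ (σ ⊕ τ) ⊕ ρ :=
    e.trans (((Equiv.refl τ).sumCongr e₁).trans ((Equiv.sumAssoc τ σ ρ).symm.trans
      ((Equiv.sumComm τ σ).sumCongr (Equiv.refl ρ))))
  have hk : (Q₁ * Q) * P = 0 := jointParam_kernel H Q hW N hQN Q₁ N₁ hQN₁
  have hA : IsUnit (Pᵀ * P).det := jointParam_gram H Q hW N hQN hNA N₁ hN₁A
  have hM : IsUnit ((Q₁ * Q) * (Q₁ * Q)ᵀ).det := jointConstraint_gram Q hQM Q₁ hQ₁M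
  have hTP : (Pᵀ * H * P).PosDef := by
    rw [hP, jointParam_form H hH Q hW N hQN N₁]; exact posDef_fromBlocks_diag hT₁ hT
  -- the two evaluations of the joint generating function
  have hjoint : ∀ g : ι → ℝ, (∫ v : σ ⊕ τ → ℝ, Real.exp (-(1/2 : ℝ) * (v ⬝ᵥ (Pᵀ * H * P) *ᵥ v)))⁻¹ *
      ∫ v : σ ⊕ τ → ℝ, Real.exp (-(1/2 : ℝ) * ((P *ᵥ v) ⬝ᵥ H *ᵥ (P *ᵥ v)) + (P *ᵥ v) ⬝ᵥ g) =
        Real.exp ((1/2 : ℝ) * (g ⬝ᵥ flucCov H (Q₁ * Q) *ᵥ g)) := fun g => by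
    simp_rw [config_quadForm P H, config_source P g]
    exact eq_3157_flucCov e' H (Q₁ * Q) P hk hA hM hTP g
  have hiter : ∀ g : ι → ℝ,
      ∫ v : σ ⊕ τ → ℝ, Real.exp (-(1/2 : ℝ) * ((P *ᵥ v) ⬝ᵥ H *ᵥ (P *ᵥ v)) + (P *ᵥ v) ⬝ᵥ g) =
        (Real.sqrt (2 * π) ^ Fintype.card τ / Real.sqrt (Nᵀ * H * N).det) *
          (Real.sqrt (2 * π) ^ Fintype.card σ / Real.sqrt (N₁ᵀ * effForm H Q * N₁).det) *
          (Real.exp ((1/2 : ℝ) * (g ⬝ᵥ flucCov H Q *ᵥ g)) *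
            Real.exp ((1/2 : ℝ) * (g ⬝ᵥ (minOp H Q * flucCov (effForm H Q) Q₁ * (minOp H Q)ᵀ) *ᵥ g))) :=
    fun g => by
    rw [hP, eq_3173_joint H hH Q hW N hQN hT N₁ hT₁ g,
      eq_3173_iterated e e₁ H hH Q N hQN hNA hQM hT Q₁ N₁ hQN₁ hN₁A hQ₁M hT₁ g]
  -- normalisation: the source-free joint integral is `Z_N · Z₁`
  have hZ : ∫ v : σ ⊕ τ → ℝ, Real.exp (-(1/2 : ℝ) * (v ⬝ᵥ (Pᵀ * H * P) *ᵥ v)) =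
      (Real.sqrt (2 * π) ^ Fintype.card τ / Real.sqrt (Nᵀ * H * N).det) *
        (Real.sqrt (2 * π) ^ Fintype.card σ / Real.sqrt (N₁ᵀ * effForm H Q * N₁).det) := by
    have := hiter 0
    simp_rw [dotProduct_zero, add_zero, mulVec_zero, dotProduct_zero, mul_zero, Real.exp_zero, mul_one,
      config_quadForm P H] at this
    exact this
  have hZpos : 0 < (Real.sqrt (2 * π) ^ Fintype.card τ / Real.sqrt (Nᵀ * H * N).det) *
      (Real.sqrt (2 * π) ^ Fintype.card σ / Real.sqrt (N₁ᵀ * effForm H Q * N₁).det) :=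
    mul_pos (gaussNorm_pos hT) (gaussNorm_pos hT₁)
  -- symmetry of both sides
  have hS := minOpL_eq_transpose H Q hH
  have hS₁ := minOpL_eq_transpose (effForm H Q) Q₁ hS.2.2
  refine eq_of_genFun_eq (minOpL_eq_transpose H (Q₁ * Q) hH).2.1 ?_ fun g => ?_
  · rw [transpose_add, hS.2.1, transpose_mul, transpose_mul, transpose_transpose, hS₁.2.1, Matrix.mul_assoc]
  · rw [← hjoint g, hiter g, hZ, inv_mul_cancel_left₀ hZpos.ne', ← Real.exp_add, add_mulVec, dotProduct_add,
      mul_add]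

end Joint

/-! ## §8 (v1.2, APPEND-ONLY; claim B9-SECTE-R226)  B9 p. 426 L1–8 / (3.172) / B6 (2.25)–(2.27): `R = Δ𝒢Δ`,
`𝒢 = G′² − G′²Q′*(Q′G′²Q′*)⁻¹Q′G′²`, `Q′𝒢 = 𝒢Q′* = 0`, the chain `Δ𝒢D*J = … = RG′D*J`, (3.152) ⇐ (3.151), `G′R = 𝒢Δ`;
and the Gaussian MEANS behind (3.151)'s last equality and [adv1's] (3.164)

Print: file header, WHAT IS PRINTED, bullets "(§8)"; reading: THE READING (d).  Everything below is over [adv1's]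
`B9H163` dictionary (`Δ' Δ Q a = Δ + a•QᵀQ`, `G' = Δ'⁻¹`, `M' = QG′G′Qᵀ`, `R = 1 − G′QᵀM′⁻¹QG′`, `Hmin`, `h164_mean`,
`isMinimiser`, `integral_smul_even_eq_zero`, `G'_mul_Δ'`, `Δ'_mul_G'`, `R_mul_G'Qt`, `G'_isSymm`) and [an2's]
`Beta.CompositionSingular` (`flucCov`, `kkt`, `blocks_eq_kernelBasis`, `isUnit_kkt_det_of_kernelBasis`, `mul_flucCov`,
`flucCov_mul_transpose`), [pv16's] `Beta.GaussianIntegral`, and §§1, 7 of this file — all BY NAME, nothing restated.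
No declaration of §§1–7 is touched (APPEND-ONLY). -/

section R226

variable {n m τ : Type*} [Fintype n] [Fintype m] [Fintype τ] [DecidableEq n] [DecidableEq m] [DecidableEq τ]

omit [Fintype τ] [DecidableEq m] [DecidableEq τ] in
/-- `G′ΔN = N` for a kernel basis `N` of `Q′`: `Δ′_aN = ΔN` since `Q′N = 0` (coordinate form of gen-6's abstract
`B9Eq325Proj.g_lap`). [folklore] -/
theorem G'_mul_Δ_mul_kernel (Δ : Matrix n n ℝ) (Q : Matrix m n ℝ) (a : ℝ) (hΔ' : IsUnit (B9H163.Δ' Δ Q a))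
    (N : Matrix n τ ℝ) (hQN : Q * N = 0) : B9H163.G' Δ Q a * (Δ * N) = N := by
  have h : B9H163.Δ' Δ Q a * N = Δ * N := by
    unfold B9H163.Δ'
    rw [Matrix.add_mul, Matrix.smul_mul, Matrix.mul_assoc, hQN, Matrix.mul_zero, smul_zero, add_zero]
  rw [← h, ← Matrix.mul_assoc, B9H163.G'_mul_Δ' hΔ', Matrix.one_mul]

omit [Fintype τ] [DecidableEq m] [DecidableEq τ] in
/-- Transposed form: `NᵀΔG′ = Nᵀ` (symmetric `Δ`). [folklore] -/
theorem kernel_transpose_mul_Δ_mul_G' (Δ : Matrix n n ℝ) (Q : Matrix m n ℝ) (a : ℝ) (hΔ : Δ.IsSymm)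
    (hΔ' : IsUnit (B9H163.Δ' Δ Q a)) (N : Matrix n τ ℝ) (hQN : Q * N = 0) :
    Nᵀ * Δ * B9H163.G' Δ Q a = Nᵀ := by
  have h := congrArg Matrix.transpose (G'_mul_Δ_mul_kernel Δ Q a hΔ' N hQN)
  rwa [transpose_mul, transpose_mul, (B9H163.G'_isSymm (Q := Q) (a := a) hΔ).eq, hΔ.eq] at h

omit [Fintype τ] [DecidableEq m] [DecidableEq τ] in
/-- ORTHOGONALITY of the ranges `ΔN(Q′)` and `G′ Ran Q′*`: `NᵀΔ·G′Q′* = (Q′N)ᵀ = 0`. [folklore] -/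
theorem kernel_orth_G'Qt (Δ : Matrix n n ℝ) (Q : Matrix m n ℝ) (a : ℝ) (hΔ : Δ.IsSymm)
    (hΔ' : IsUnit (B9H163.Δ' Δ Q a)) (N : Matrix n τ ℝ) (hQN : Q * N = 0) :
    Nᵀ * Δ * (B9H163.G' Δ Q a * Qᵀ) = 0 := by
  rw [← Matrix.mul_assoc, kernel_transpose_mul_Δ_mul_G' Δ Q a hΔ hΔ' N hQN, ← transpose_mul, hQN, transpose_zero]

/-- `G′Q′*` is injective when `Q′Q′*` is nonsingular. [folklore] -/
theorem G'Qt_mulVec_injective (Δ : Matrix n n ℝ) (Q : Matrix m n ℝ) (a : ℝ) (hΔ' : IsUnit (B9H163.Δ' Δ Q a))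
    (hQM : IsUnit (Q * Qᵀ).det) : Function.Injective (B9H163.G' Δ Q a * Qᵀ).mulVec := by
  intro v₁ v₂ h
  rw [← sub_eq_zero] at h ⊢
  rw [← mulVec_sub] at h
  have h2 := congrArg ((B9H163.Δ' Δ Q a).mulVec) h
  rw [mulVec_mulVec, ← Matrix.mul_assoc, B9H163.Δ'_mul_G' hΔ', Matrix.one_mul, mulVec_zero,
    mulVec_transpose] at h2
  exact eq_zero_of_constraint hQM h2

/-- `M′ = Q′G′²Q′*` IS nonsingular — the Gram matrix of the injective `G′Q′*` (symmetric `Δ`): the inverse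
`(Q′G′²Q′*)⁻¹` written in (3.25) p. 394 exists as soon as `Δ′_a` and `Q′Q′*` are nonsingular; DERIVED, not assumed.
[folklore] -/
theorem isUnit_M' (Δ : Matrix n n ℝ) (Q : Matrix m n ℝ) (a : ℝ) (hΔ : Δ.IsSymm) (hΔ' : IsUnit (B9H163.Δ' Δ Q a))
    (hQM : IsUnit (Q * Qᵀ).det) : IsUnit (B9H163.M' Δ Q a) := by
  have hG's : (B9H163.G' Δ Q a)ᵀ = B9H163.G' Δ Q a := (B9H163.G'_isSymm (Q := Q) (a := a) hΔ).eq
  have hpd : ((B9H163.G' Δ Q a * Qᵀ)ᵀ * (B9H163.G' Δ Q a * Qᵀ)).PosDef := by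
    simpa only [conjTranspose_eq_transpose_of_trivial] using
      Matrix.PosDef.conjTranspose_mul_self _ (G'Qt_mulVec_injective Δ Q a hΔ' hQM)
  have hM : B9H163.M' Δ Q a = (B9H163.G' Δ Q a * Qᵀ)ᵀ * (B9H163.G' Δ Q a * Qᵀ) := by
    unfold B9H163.M'
    rw [transpose_mul, transpose_transpose, hG's]
    simp only [Matrix.mul_assoc]
  rw [hM]
  exact hpd.isUnit

omit [Fintype τ] [DecidableEq τ] in
/-- `R` FIXES `ΔN(Q′)`: `R·ΔN = ΔN` ((3.21) p. 394: the range of the projection `R` is `Δ^η_U N(Q′)`; coordinate form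
of gen-6's `B9Eq325Proj.R325_lap`). [folklore] -/
theorem R_mul_Δ_mul_kernel (Δ : Matrix n n ℝ) (Q : Matrix m n ℝ) (a : ℝ) (hΔ' : IsUnit (B9H163.Δ' Δ Q a))
    (N : Matrix n τ ℝ) (hQN : Q * N = 0) : B9H163.R Δ Q a * (Δ * N) = Δ * N := by
  unfold B9H163.R
  rw [Matrix.sub_mul, Matrix.one_mul, sub_eq_self]
  simp only [Matrix.mul_assoc]
  rw [G'_mul_Δ_mul_kernel Δ Q a hΔ' N hQN, hQN]
  simp only [Matrix.mul_zero]

/-- `R` is symmetric for symmetric `Δ` ((3.20) p. 394 "orthogonal projection"; coordinate form of gen-6's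
`B9Eq325Proj.R325_symm`). [folklore] -/
theorem R_transpose (Δ : Matrix n n ℝ) (Q : Matrix m n ℝ) (a : ℝ) (hΔ : Δ.IsSymm) :
    (B9H163.R Δ Q a)ᵀ = B9H163.R Δ Q a := by
  have hG := (B9H163.G'_isSymm (Q := Q) (a := a) hΔ).eq
  have hM : ((B9H163.M' Δ Q a)⁻¹)ᵀ = (B9H163.M' Δ Q a)⁻¹ := by
    rw [transpose_nonsing_inv]
    unfold B9H163.M'
    rw [transpose_mul, transpose_mul, transpose_mul, transpose_transpose, hG]
    simp only [Matrix.mul_assoc]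
  unfold B9H163.R
  rw [transpose_sub, transpose_one, transpose_mul, transpose_mul, transpose_mul, transpose_mul,
    transpose_transpose, hM, hG]
  simp only [Matrix.mul_assoc]

/-- THE PROJECTION FORMULA IN COORDINATES (B9 p. 394 (3.20)–(3.21): *"R = R(U) is an orthogonal projection … onto the
subspace R = Δ^η_U N(Q′)"*, with (3.25) *"Rf = (I − G′Q′*(Q′G′²Q′*)⁻¹Q′G′)f"*; used on p. 426 L3 as "R = Δ𝒢Δ"): for
symmetric `Δ`, `Δ′_a` nonsingular and a kernel basis `N` of `Q′` (`Q′N = 0`; `Q′Q′*` and `NᵀΔ²N` nonsingular; `n ≃ τ ⊕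
m`), (3.25) = [adv1's] `B9H163.R Δ Q′ a` (ANY admissible `a`) EQUALS `ΔN(NᵀΔ²N)⁻¹NᵀΔ`, the orthogonal projection onto
`Ran(ΔN) = ΔN(Q′)`: both operators fix `ΔN(Q′)` and kill `G′·Ran Q′*` (`R_mul_G'Qt` of adv1, `kernel_orth_G'Qt`), and
`[ΔN | G′Q′*]` is a basis.  The `Matrix`/scalar-`a`/explicit-kernel-basis counterpart of this lineage's gen-6 ABSTRACT
`B9Eq325Proj.R325_eq_starProjection_fd` (inner-product space, level-dependent `a`), re-proved in coordinates because
[adv1's] `R` and [an2's] `flucCov` are matrices (no transport through `EuclideanSpace` is attempted). [cite: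
Balaban1985BackgroundPropagators, (3.20)-(3.21) p.394, (3.25) p.394, p.426 L3] -/
theorem R_eq_kernelBasis (e : n ≃ τ ⊕ m) (Δ : Matrix n n ℝ) (Q : Matrix m n ℝ) (a : ℝ) (hΔ : Δ.IsSymm)
    (hΔ' : IsUnit (B9H163.Δ' Δ Q a)) (N : Matrix n τ ℝ) (hQN : Q * N = 0) (hQM : IsUnit (Q * Qᵀ).det)
    (hT : IsUnit (Nᵀ * (Δ * Δ) * N).det) :
    B9H163.R Δ Q a = Δ * N * (Nᵀ * (Δ * Δ) * N)⁻¹ * Nᵀ * Δ := by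
  have hM' : IsUnit (B9H163.M' Δ Q a) := isUnit_M' Δ Q a hΔ hΔ' hQM
  have hTN1 : Nᵀ * (Δ * (Δ * N)) = Nᵀ * (Δ * Δ) * N := by simp only [Matrix.mul_assoc]
  have hTN2 : Nᵀ * Δ * (Δ * N) = Nᵀ * (Δ * Δ) * N := by simp only [Matrix.mul_assoc]
  -- both operators act identically on the columns of `W = [ΔN | G′Q′ᵀ]`
  have hRW : B9H163.R Δ Q a * fromCols (Δ * N) (B9H163.G' Δ Q a * Qᵀ) = fromCols (Δ * N) 0 := by
    have h0 : B9H163.R Δ Q a * (B9H163.G' Δ Q a * Qᵀ) = 0 := by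
      simpa only [Matrix.mul_one] using B9H163.R_mul_G'Qt hM' (1 : Matrix m m ℝ)
    rw [mul_fromCols, R_mul_Δ_mul_kernel Δ Q a hΔ' N hQN, h0]
  have hPW : Δ * N * (Nᵀ * (Δ * Δ) * N)⁻¹ * Nᵀ * Δ * fromCols (Δ * N) (B9H163.G' Δ Q a * Qᵀ) =
      fromCols (Δ * N) 0 := by
    rw [mul_fromCols]
    congr 1
    · rw [Matrix.mul_assoc _ Δ (Δ * N), Matrix.mul_assoc _ Nᵀ, hTN1, Matrix.mul_assoc (Δ * N),
        nonsing_inv_mul _ hT, Matrix.mul_one]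
    · rw [Matrix.mul_assoc _ Δ (B9H163.G' Δ Q a * Qᵀ), Matrix.mul_assoc _ Nᵀ,
        ← Matrix.mul_assoc Nᵀ Δ (B9H163.G' Δ Q a * Qᵀ), kernel_orth_G'Qt Δ Q a hΔ hΔ' N hQN, Matrix.mul_zero]
  -- `W` reindexed to a square matrix (`W·E`, `E` the reindexing `τ ⊕ m → n`) is nonsingular
  set P : Matrix n n ℝ := Δ * N * (Nᵀ * (Δ * Δ) * N)⁻¹ * Nᵀ * Δ with hP
  set W : Matrix n (τ ⊕ m) ℝ := fromCols (Δ * N) (B9H163.G' Δ Q a * Qᵀ) with hW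
  set E : Matrix (τ ⊕ m) n ℝ := (1 : Matrix (τ ⊕ m) (τ ⊕ m) ℝ).submatrix id e with hE
  have hEv : ∀ v : n → ℝ, E *ᵥ v = v ∘ e.symm := fun v => by
    rw [hE, submatrix_mulVec_equiv, one_mulVec]; rfl
  have hWinj : Function.Injective W.mulVec := by
    intro v₁ v₂ h
    rw [← sub_eq_zero] at h ⊢
    rw [← mulVec_sub] at h
    set d := v₁ - v₂ with hd0
    have hd : W *ᵥ d = (Δ * N) *ᵥ (d ∘ Sum.inl) + (B9H163.G' Δ Q a * Qᵀ) *ᵥ (d ∘ Sum.inr) := by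
      rw [hW, fromCols_mulVec]
    have h1 : d ∘ Sum.inl = 0 := by
      have h' := congrArg ((Nᵀ * Δ).mulVec) h
      rw [hd, mulVec_add, mulVec_mulVec, mulVec_mulVec, hTN2, kernel_orth_G'Qt Δ Q a hΔ hΔ' N hQN, zero_mulVec,
        add_zero, mulVec_zero] at h'
      exact Matrix.eq_zero_of_mulVec_eq_zero hT.ne_zero h'
    have h2 : d ∘ Sum.inr = 0 := by
      have h' := h
      rw [hd, h1, mulVec_zero, zero_add] at h'
      exact G'Qt_mulVec_injective Δ Q a hΔ' hQM (by rw [h', mulVec_zero])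
    rw [← Sum.elim_comp_inl_inr d, h1, h2]
    ext i; cases i <;> rfl
  have hWEinj : Function.Injective (W * E).mulVec := by
    intro v₁ v₂ h
    rw [← mulVec_mulVec, ← mulVec_mulVec, hEv, hEv] at h
    have h' := hWinj h
    funext i
    simpa using congrFun h' (e i)
  have hWEd : IsUnit (W * E).det :=
    (Matrix.isUnit_iff_isUnit_det _).mp (Matrix.mulVec_injective_iff_isUnit.mp hWEinj)
  have key : B9H163.R Δ Q a * (W * E) = P * (W * E) := by
    rw [← Matrix.mul_assoc (B9H163.R Δ Q a), hRW, ← Matrix.mul_assoc P, hPW]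
  calc B9H163.R Δ Q a = B9H163.R Δ Q a * (W * E) * (W * E)⁻¹ :=
        (Matrix.mul_nonsing_inv_cancel_right _ _ hWEd).symm
    _ = P * (W * E) * (W * E)⁻¹ := by rw [key]
    _ = P := Matrix.mul_nonsing_inv_cancel_right _ _ hWEd

/-- `R` DOES NOT DEPEND ON `a`: every `a` with `Δ′_a` nonsingular gives the same operator (3.25) (coordinate form of
gen-6's `B9Eq325Proj.R325_indep`; B9 p. 394 takes level-dependent `a_j`, adv1's dictionary the printed scalar). [folklore] -/
theorem R_indep (e : n ≃ τ ⊕ m) (Δ : Matrix n n ℝ) (Q : Matrix m n ℝ) (a a' : ℝ) (hΔ : Δ.IsSymm)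
    (hΔ' : IsUnit (B9H163.Δ' Δ Q a)) (hΔ'' : IsUnit (B9H163.Δ' Δ Q a')) (N : Matrix n τ ℝ) (hQN : Q * N = 0)
    (hQM : IsUnit (Q * Qᵀ).det) (hT : IsUnit (Nᵀ * (Δ * Δ) * N).det) :
    B9H163.R Δ Q a = B9H163.R Δ Q a' := by
  rw [R_eq_kernelBasis e Δ Q a hΔ hΔ' N hQN hQM hT, R_eq_kernelBasis e Δ Q a' hΔ hΔ'' N hQN hQM hT]

/-- **B9 p. 426 L2–3 / B6 (2.26): `R = Δ𝒢Δ`** — *"Let us notice that 𝒢 is also a covariance of the integral (3.17)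
defining the operator R, and from this integral we get R = Δ𝒢Δ. It is the formula (2.26) in [4]"* — with 𝒢 ↦ `flucCov
(Δ·Δ) Q′` (the covariance of `e^{−½‖Δλ‖²}` under `δ(Q′λ)`: [an2's] bordered inverse, BY NAME; `= N(NᵀΔ²N)⁻¹Nᵀ` in a
kernel basis by an2's `blocks_eq_kernelBasis`) and `R` ↦ (3.25) ([adv1's] `B9H163.R`): kernel-checked for SYMMETRIC `Δ`,
without assuming `Δ` invertible, via `R_eq_kernelBasis`. [cite: Balaban1985BackgroundPropagators, p.426 L2-3;
Balaban1984PropagatorsII, (2.26) p.226] -/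
theorem R_eq_226 (e : n ≃ τ ⊕ m) (Δ : Matrix n n ℝ) (Q : Matrix m n ℝ) (a : ℝ) (hΔ : Δ.IsSymm)
    (hΔ' : IsUnit (B9H163.Δ' Δ Q a)) (N : Matrix n τ ℝ) (hQN : Q * N = 0) (hNA : IsUnit (Nᵀ * N).det)
    (hQM : IsUnit (Q * Qᵀ).det) (hT : IsUnit (Nᵀ * (Δ * Δ) * N).det) :
    B9H163.R Δ Q a = Δ * flucCov (Δ * Δ) Q * Δ := by
  rw [(blocks_eq_kernelBasis e (Δ * Δ) Q N hQN hNA hQM hT).1, R_eq_kernelBasis e Δ Q a hΔ hΔ' N hQN hQM hT]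
  unfold Beta.LogDetHessian.cov
  simp only [Matrix.mul_assoc]

/-- **(3.172) `G′R = 𝒢Δ`** (p. 430: *"This implies G′R = 𝒢Δ, G̃′R̃ = 𝒢̃Δ, (3.172)"*; the wavy identity is this theorem
for the wavy data): from `R = ΔN(NᵀΔ²N)⁻¹NᵀΔ`, `𝒢 = N(NᵀΔ²N)⁻¹Nᵀ` and `G′ΔN = N`. [cite: Balaban1985BackgroundPropagators,
(3.172) p.430] -/
theorem eq_3172 (e : n ≃ τ ⊕ m) (Δ : Matrix n n ℝ) (Q : Matrix m n ℝ) (a : ℝ) (hΔ : Δ.IsSymm)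
    (hΔ' : IsUnit (B9H163.Δ' Δ Q a)) (N : Matrix n τ ℝ) (hQN : Q * N = 0) (hNA : IsUnit (Nᵀ * N).det)
    (hQM : IsUnit (Q * Qᵀ).det) (hT : IsUnit (Nᵀ * (Δ * Δ) * N).det) :
    B9H163.G' Δ Q a * B9H163.R Δ Q a = flucCov (Δ * Δ) Q * Δ := by
  rw [R_eq_kernelBasis e Δ Q a hΔ hΔ' N hQN hQM hT, (blocks_eq_kernelBasis e (Δ * Δ) Q N hQN hNA hQM hT).1]
  unfold Beta.LogDetHessian.cov
  simp only [← Matrix.mul_assoc]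
  rw [Matrix.mul_assoc (B9H163.G' Δ Q a) Δ N, G'_mul_Δ_mul_kernel Δ Q a hΔ' N hQN]

/-- `𝒢Δ′_a = 𝒢(Δ + Q′*aQ′) = 𝒢Δ` — the middle step of the p. 426 chain, by `𝒢Q′* = 0` ([an2's] `flucCov_mul_transpose`).
[cite: Balaban1985BackgroundPropagators, p.426 L6-7] -/
theorem frakG_mul_Δ' (e : n ≃ τ ⊕ m) (Δ : Matrix n n ℝ) (Q : Matrix m n ℝ) (a : ℝ) (N : Matrix n τ ℝ)
    (hQN : Q * N = 0) (hNA : IsUnit (Nᵀ * N).det) (hQM : IsUnit (Q * Qᵀ).det)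
    (hT : IsUnit (Nᵀ * (Δ * Δ) * N).det) :
    flucCov (Δ * Δ) Q * B9H163.Δ' Δ Q a = flucCov (Δ * Δ) Q * Δ := by
  have hW : IsUnit (kkt (Δ * Δ) Q).det := isUnit_kkt_det_of_kernelBasis e (Δ * Δ) Q N hQN hNA hQM hT
  unfold B9H163.Δ'
  rw [Matrix.mul_add, Matrix.mul_smul, ← Matrix.mul_assoc _ Qᵀ Q, flucCov_mul_transpose _ _ hW,
    Matrix.zero_mul, smul_zero, add_zero]

/-- **The displayed chain of p. 426 L6–7, `Δ𝒢D*J = Δ𝒢(Δ + Q′*aQ′)G′D*J = Δ𝒢ΔG′D*J = RG′D*J`**, as operator identities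
with the common right factor `D*J` removed: (i) `Δ𝒢 = Δ𝒢·Δ′_a·G′` (`Δ′_aG′ = 1`, adv1's `Δ'_mul_G'`), (ii) `… = Δ𝒢ΔG′`
(`𝒢Q′* = 0`, `frakG_mul_Δ'`), (iii) `… = RG′` (`R = Δ𝒢Δ`, `R_eq_226`). [cite: Balaban1985BackgroundPropagators, p.426
L6-7] -/
theorem eq_p426_chain (e : n ≃ τ ⊕ m) (Δ : Matrix n n ℝ) (Q : Matrix m n ℝ) (a : ℝ) (hΔ : Δ.IsSymm)
    (hΔ' : IsUnit (B9H163.Δ' Δ Q a)) (N : Matrix n τ ℝ) (hQN : Q * N = 0) (hNA : IsUnit (Nᵀ * N).det)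
    (hQM : IsUnit (Q * Qᵀ).det) (hT : IsUnit (Nᵀ * (Δ * Δ) * N).det) :
    Δ * flucCov (Δ * Δ) Q = Δ * flucCov (Δ * Δ) Q * B9H163.Δ' Δ Q a * B9H163.G' Δ Q a ∧
    Δ * flucCov (Δ * Δ) Q * B9H163.Δ' Δ Q a * B9H163.G' Δ Q a = Δ * flucCov (Δ * Δ) Q * Δ * B9H163.G' Δ Q a ∧
    Δ * flucCov (Δ * Δ) Q * Δ * B9H163.G' Δ Q a = B9H163.R Δ Q a * B9H163.G' Δ Q a := by
  refine ⟨?_, ?_, ?_⟩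
  · rw [Matrix.mul_assoc, Matrix.mul_assoc, B9H163.Δ'_mul_G' hΔ', Matrix.mul_one]
  · rw [Matrix.mul_assoc Δ, frakG_mul_Δ' e Δ Q a N hQN hNA hQM hT, ← Matrix.mul_assoc]
  · rw [R_eq_226 e Δ Q a hΔ hΔ' N hQN hNA hQM hT]

/-- `𝒢ΔG′ = 𝒢` (kernel form of 𝒢 and `NᵀΔG′ = Nᵀ`). [folklore] -/
theorem frakG_mul_Δ_mul_G' (e : n ≃ τ ⊕ m) (Δ : Matrix n n ℝ) (Q : Matrix m n ℝ) (a : ℝ) (hΔ : Δ.IsSymm)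
    (hΔ' : IsUnit (B9H163.Δ' Δ Q a)) (N : Matrix n τ ℝ) (hQN : Q * N = 0) (hNA : IsUnit (Nᵀ * N).det)
    (hQM : IsUnit (Q * Qᵀ).det) (hT : IsUnit (Nᵀ * (Δ * Δ) * N).det) :
    flucCov (Δ * Δ) Q * Δ * B9H163.G' Δ Q a = flucCov (Δ * Δ) Q := by
  rw [(blocks_eq_kernelBasis e (Δ * Δ) Q N hQN hNA hQM hT).1]
  unfold Beta.LogDetHessian.cov
  rw [Matrix.mul_assoc _ Δ (B9H163.G' Δ Q a), Matrix.mul_assoc _ Nᵀ (Δ * B9H163.G' Δ Q a),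
    ← Matrix.mul_assoc Nᵀ Δ (B9H163.G' Δ Q a), kernel_transpose_mul_Δ_mul_G' Δ Q a hΔ hΔ' N hQN]

/-- **B6 (2.27) = B9 p. 426 L4: `𝒢 = G′² − G′²Q′*(Q′G′²Q′*)⁻¹Q′G′²`** (*"It can be easily proved by the usual Lagrange
function argument"*; B6 p. 227 *"It is easy to see that"*) — kernel-checked WITHOUT a Lagrange argument: the printed
right member is `G′RG′` by algebra ((3.25), `M′ = Q′G′²Q′*`), and `G′RG′ = (𝒢Δ)G′ = 𝒢` by (3.172) and `𝒢ΔG′ = 𝒢`.  In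
particular the printed member does not depend on `a` although `G′ = (Δ + aQ′*Q′)⁻¹` does. [cite:
Balaban1985BackgroundPropagators, p.426 L4; Balaban1984PropagatorsII, (2.27) p.227] -/
theorem eq_227 (e : n ≃ τ ⊕ m) (Δ : Matrix n n ℝ) (Q : Matrix m n ℝ) (a : ℝ) (hΔ : Δ.IsSymm)
    (hΔ' : IsUnit (B9H163.Δ' Δ Q a)) (N : Matrix n τ ℝ) (hQN : Q * N = 0) (hNA : IsUnit (Nᵀ * N).det)
    (hQM : IsUnit (Q * Qᵀ).det) (hT : IsUnit (Nᵀ * (Δ * Δ) * N).det) :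
    B9H163.G' Δ Q a * B9H163.G' Δ Q a -
        B9H163.G' Δ Q a * B9H163.G' Δ Q a * Qᵀ * (B9H163.M' Δ Q a)⁻¹ * Q * B9H163.G' Δ Q a * B9H163.G' Δ Q a =
      flucCov (Δ * Δ) Q := by
  have h1 : B9H163.G' Δ Q a * B9H163.G' Δ Q a -
      B9H163.G' Δ Q a * B9H163.G' Δ Q a * Qᵀ * (B9H163.M' Δ Q a)⁻¹ * Q * B9H163.G' Δ Q a * B9H163.G' Δ Q a =
        B9H163.G' Δ Q a * B9H163.R Δ Q a * B9H163.G' Δ Q a := by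
    unfold B9H163.R
    rw [Matrix.mul_sub, Matrix.sub_mul, Matrix.mul_one]
    simp only [Matrix.mul_assoc]
  rw [h1, eq_3172 e Δ Q a hΔ hΔ' N hQN hNA hQM hT, frakG_mul_Δ_mul_G' e Δ Q a hΔ hΔ' N hQN hNA hQM hT]

/-- *"From these identities we get Q′𝒢 = 𝒢Q′* = 0"* (p. 426 L5–6; B6 p. 227 "the equalities Q′𝒢 = 𝒢Q′* = 0"): for 𝒢 ↦
`flucCov (Δ·Δ) Q′` these are [an2's] bordered-inverse block identities `mul_flucCov` / `flucCov_mul_transpose` (BY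
NAME), the bordered matrix `[[Δ², Q′ᵀ],[Q′, 0]]` being nonsingular in the kernel-basis setting (an2's
`isUnit_kkt_det_of_kernelBasis`). [cite: Balaban1985BackgroundPropagators, p.426 L5-6; Balaban1984PropagatorsII, p.227] -/
theorem frakG_constraints (e : n ≃ τ ⊕ m) (Δ : Matrix n n ℝ) (Q : Matrix m n ℝ) (N : Matrix n τ ℝ)
    (hQN : Q * N = 0) (hNA : IsUnit (Nᵀ * N).det) (hQM : IsUnit (Q * Qᵀ).det)
    (hT : IsUnit (Nᵀ * (Δ * Δ) * N).det) :
    Q * flucCov (Δ * Δ) Q = 0 ∧ flucCov (Δ * Δ) Q * Qᵀ = 0 :=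
  have hW : IsUnit (kkt (Δ * Δ) Q).det := isUnit_kkt_det_of_kernelBasis e (Δ * Δ) Q N hQN hNA hQM hT
  ⟨mul_flucCov _ _ hW, flucCov_mul_transpose _ _ hW⟩

/-- **(3.152) ⇐ (3.151)** (*"hence (3.151) gives RD*G₁ = RG′D*, and G₁DR = DG′R. (3.152)"*): (3.151) read as the
OPERATOR identity `RD*G₁ = Δ𝒢D*` (it is printed for every source `J`) is the HYPOTHESIS `h3151` — its Faddeev–Popov
derivation (the `A`-integral, `δ_R`, `|det(Δ↾_{N(Q′)})|`, `Z⁻¹(J)`) is NOT reproduced (C-B9-57 (i)); from it and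
`eq_p426_chain`, `RD*G₁ = RG′D*`; transposing — `G₁` symmetric (a covariance), `Rᵀ = R` (`R_transpose`), `G′ᵀ = G′`
(adv1's `G'_isSymm`) — `G₁DR = DG′R`.  `D : Matrix p n ℝ` and `G₁ : Matrix p p ℝ` are ARBITRARY (the print's `D` =
covariant derivative, `G₁` = the propagator of (3.132)). [cite: Balaban1985BackgroundPropagators, (3.151)-(3.152)
pp.425-426] -/
theorem eq_3152_of_3151 {p : Type*} [Fintype p] (e : n ≃ τ ⊕ m) (Δ : Matrix n n ℝ) (Q : Matrix m n ℝ) (a : ℝ)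
    (hΔ : Δ.IsSymm) (hΔ' : IsUnit (B9H163.Δ' Δ Q a)) (N : Matrix n τ ℝ) (hQN : Q * N = 0)
    (hNA : IsUnit (Nᵀ * N).det) (hQM : IsUnit (Q * Qᵀ).det) (hT : IsUnit (Nᵀ * (Δ * Δ) * N).det)
    (D : Matrix p n ℝ) (G₁ : Matrix p p ℝ) (hG₁ : G₁ᵀ = G₁)
    (h3151 : B9H163.R Δ Q a * Dᵀ * G₁ = Δ * flucCov (Δ * Δ) Q * Dᵀ) :
    B9H163.R Δ Q a * Dᵀ * G₁ = B9H163.R Δ Q a * B9H163.G' Δ Q a * Dᵀ ∧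
    G₁ * D * B9H163.R Δ Q a = D * B9H163.G' Δ Q a * B9H163.R Δ Q a := by
  obtain ⟨c1, c2, c3⟩ := eq_p426_chain e Δ Q a hΔ hΔ' N hQN hNA hQM hT
  have h1 : B9H163.R Δ Q a * Dᵀ * G₁ = B9H163.R Δ Q a * B9H163.G' Δ Q a * Dᵀ := by
    rw [h3151, c1, c2, c3]
  refine ⟨h1, ?_⟩
  have h2 := congrArg Matrix.transpose h1
  rwa [transpose_mul, transpose_mul, transpose_mul, transpose_mul, transpose_transpose, hG₁,
    R_transpose Δ Q a hΔ, (B9H163.G'_isSymm (Q := Q) (a := a) hΔ).eq, ← Matrix.mul_assoc, ← Matrix.mul_assoc] at h2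

end R226

section Mean

variable {ι κ τ : Type*} [Fintype ι] [Fintype κ] [Fintype τ] [DecidableEq ι] [DecidableEq κ] [DecidableEq τ]

omit [DecidableEq ι] in
/-- `‖v‖_∞ ≤ Σᵢ |vᵢ|`. [folklore] -/
theorem norm_le_sum_abs (v : ι → ℝ) : ‖v‖ ≤ ∑ i, |v i| := by
  refine (pi_norm_le_iff_of_nonneg (Finset.sum_nonneg fun i _ => abs_nonneg (v i))).mpr fun i => ?_
  rw [Real.norm_eq_abs]
  exact Finset.single_le_sum (f := fun j => |v j|) (fun j _ => abs_nonneg (v j)) (Finset.mem_univ i)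

omit [Fintype κ] [Fintype τ] [DecidableEq κ] [DecidableEq τ] in
/-- FIRST-MOMENT INTEGRABILITY: `v ↦ e^{−½vᵀAv + hᵀv}·v` is Bochner-integrable (Lebesgue measure on `ι → ℝ`) for `A`
positive definite — domination `e^{…}‖v‖_∞ ≤ Σᵢ (e^{… + vᵢ} + e^{… − vᵢ})` by tilted Gaussians with the sources `h ±
eᵢ` (§7's `integrable_exp_source`). [folklore] -/
theorem integrable_exp_source_smul (A : Matrix ι ι ℝ) (hA : A.PosDef) (h : ι → ℝ) :
    Integrable (fun v : ι → ℝ => Real.exp (-(1/2 : ℝ) * (v ⬝ᵥ A *ᵥ v) + h ⬝ᵥ v) • v) := by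
  -- `|x| ≤ eˣ + e⁻ˣ` (from `x + 1 ≤ eˣ`)
  have habs : ∀ x : ℝ, |x| ≤ Real.exp x + Real.exp (-x) := fun x => by
    have h1 := Real.add_one_le_exp x
    have h2 := Real.add_one_le_exp (-x)
    have h3 := Real.exp_pos x
    have h4 := Real.exp_pos (-x)
    rw [abs_le]
    constructor <;> linarith
  have hplus : ∀ (i : ι) (v : ι → ℝ), -(1/2 : ℝ) * (v ⬝ᵥ A *ᵥ v) + h ⬝ᵥ v + v i =
      -(1/2 : ℝ) * (v ⬝ᵥ A *ᵥ v) + (h + Pi.single i 1) ⬝ᵥ v := fun i v => by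
    rw [add_dotProduct, single_dotProduct, one_mul, add_assoc]
  have hminus : ∀ (i : ι) (v : ι → ℝ), -(1/2 : ℝ) * (v ⬝ᵥ A *ᵥ v) + h ⬝ᵥ v - v i =
      -(1/2 : ℝ) * (v ⬝ᵥ A *ᵥ v) + (h - Pi.single i 1) ⬝ᵥ v := fun i v => by
    rw [sub_dotProduct, single_dotProduct, one_mul, add_sub_assoc]
  have hg : Integrable (fun v : ι → ℝ => ∑ i, (Real.exp (-(1/2 : ℝ) * (v ⬝ᵥ A *ᵥ v) + h ⬝ᵥ v + v i) +
      Real.exp (-(1/2 : ℝ) * (v ⬝ᵥ A *ᵥ v) + h ⬝ᵥ v - v i))) := by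
    refine integrable_finsetSum _ fun i _ => ?_
    simp_rw [hplus i, hminus i]
    exact (integrable_exp_source A hA _).add (integrable_exp_source A hA _)
  refine hg.mono' ((integrable_exp_source A hA h).aestronglyMeasurable.smul measurable_id.aestronglyMeasurable)
    (Filter.Eventually.of_forall fun v => ?_)
  rw [norm_smul, Real.norm_eq_abs, abs_of_pos (Real.exp_pos _)]
  calc Real.exp (-(1/2 : ℝ) * (v ⬝ᵥ A *ᵥ v) + h ⬝ᵥ v) * ‖v‖
      ≤ Real.exp (-(1/2 : ℝ) * (v ⬝ᵥ A *ᵥ v) + h ⬝ᵥ v) * ∑ i, (Real.exp (v i) + Real.exp (-(v i))) :=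
        mul_le_mul_of_nonneg_left ((norm_le_sum_abs v).trans (Finset.sum_le_sum fun i _ =>
          habs (v i))) (Real.exp_pos _).le
    _ = ∑ i, (Real.exp (-(1/2 : ℝ) * (v ⬝ᵥ A *ᵥ v) + h ⬝ᵥ v + v i) +
          Real.exp (-(1/2 : ℝ) * (v ⬝ᵥ A *ᵥ v) + h ⬝ᵥ v - v i)) := by
        rw [Finset.mul_sum]
        refine Finset.sum_congr rfl fun i _ => ?_
        rw [mul_add, ← Real.exp_add, ← Real.exp_add, ← sub_eq_add_neg]

omit [Fintype κ] [Fintype τ] [DecidableEq κ] [DecidableEq τ] in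
/-- THE MEAN OF THE TILTED GAUSSIAN: `∫ e^{−½vᵀAv + hᵀv} v dv = (∫ e^{−½vᵀAv + hᵀv} dv) · A⁻¹h` (`A` positive definite)
— the translation `v ↦ v + A⁻¹h` (Lebesgue measure is translation invariant, Mathlib's `integral_add_right_eq_self`),
§1's `complete_square`, and the vanishing odd moment of the centred Gaussian ([adv1's] `B9H163.integral_smul_even_eq_zero`
BY NAME, `volume` being negation invariant). [folklore] -/
theorem integral_exp_source_smul (A : Matrix ι ι ℝ) (hA : A.PosDef) (h : ι → ℝ) :
    ∫ v : ι → ℝ, Real.exp (-(1/2 : ℝ) * (v ⬝ᵥ A *ᵥ v) + h ⬝ᵥ v) • v =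
      (∫ v : ι → ℝ, Real.exp (-(1/2 : ℝ) * (v ⬝ᵥ A *ᵥ v) + h ⬝ᵥ v)) • (A⁻¹ *ᵥ h) := by
  have hAT : Aᵀ = A := transpose_eq_of_posDef hA
  have hAd : IsUnit A.det := (Matrix.isUnit_iff_isUnit_det _).mp hA.isUnit
  set u := A⁻¹ *ᵥ h with hu
  set c := Real.exp ((1/2 : ℝ) * (h ⬝ᵥ A⁻¹ *ᵥ h)) with hc
  have hshift : ∀ v : ι → ℝ, Real.exp (-(1/2 : ℝ) * ((v + u) ⬝ᵥ A *ᵥ (v + u)) + h ⬝ᵥ (v + u)) =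
      c * Real.exp (-(1/2 : ℝ) * (v ⬝ᵥ A *ᵥ v)) := fun v => by
    rw [hu, complete_square A hAT hAd h v, Real.exp_add]
    exact mul_comm _ _
  have heven : ∀ v : ι → ℝ, c * Real.exp (-(1/2 : ℝ) * ((-v) ⬝ᵥ A *ᵥ (-v))) =
      c * Real.exp (-(1/2 : ℝ) * (v ⬝ᵥ A *ᵥ v)) := fun v => by
    rw [neg_dotProduct, mulVec_neg, dotProduct_neg, neg_neg]
  have hwi : Integrable (fun v : ι → ℝ => c * Real.exp (-(1/2 : ℝ) * (v ⬝ᵥ A *ᵥ v))) :=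
    (Beta.GaussianIntegral.integrable_exp_neg_half_quadForm A hA).const_mul c
  have hint0 : Integrable (fun v : ι → ℝ => (c * Real.exp (-(1/2 : ℝ) * (v ⬝ᵥ A *ᵥ v))) • v) := by
    have h0 := (integrable_exp_source_smul A hA 0).smul c
    refine h0.congr (Filter.Eventually.of_forall fun v => ?_)
    simp only [Pi.smul_apply, smul_smul, zero_dotProduct, add_zero]
  have hodd : ∫ v : ι → ℝ, (c * Real.exp (-(1/2 : ℝ) * (v ⬝ᵥ A *ᵥ v))) • v = 0 :=
    B9H163.integral_smul_even_eq_zero volume (fun v : ι → ℝ => c * Real.exp (-(1/2 : ℝ) * (v ⬝ᵥ A *ᵥ v))) heven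
  calc ∫ v : ι → ℝ, Real.exp (-(1/2 : ℝ) * (v ⬝ᵥ A *ᵥ v) + h ⬝ᵥ v) • v
      = ∫ v : ι → ℝ, Real.exp (-(1/2 : ℝ) * ((v + u) ⬝ᵥ A *ᵥ (v + u)) + h ⬝ᵥ (v + u)) • (v + u) :=
        (integral_add_right_eq_self (μ := (volume : Measure (ι → ℝ)))
          (fun v : ι → ℝ => Real.exp (-(1/2 : ℝ) * (v ⬝ᵥ A *ᵥ v) + h ⬝ᵥ v) • v) u).symm
    _ = ∫ v : ι → ℝ, ((c * Real.exp (-(1/2 : ℝ) * (v ⬝ᵥ A *ᵥ v))) • v +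
          (c * Real.exp (-(1/2 : ℝ) * (v ⬝ᵥ A *ᵥ v))) • u) := by
        congr 1; funext v; rw [hshift v, smul_add]
    _ = (∫ v : ι → ℝ, (c * Real.exp (-(1/2 : ℝ) * (v ⬝ᵥ A *ᵥ v))) • v) +
          (∫ v : ι → ℝ, c * Real.exp (-(1/2 : ℝ) * (v ⬝ᵥ A *ᵥ v))) • u := by
        rw [integral_add hint0 (hwi.smul_const u), integral_smul_const]
    _ = (∫ v : ι → ℝ, c * Real.exp (-(1/2 : ℝ) * (v ⬝ᵥ A *ᵥ v))) • u := by rw [hodd, zero_add]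
    _ = (∫ v : ι → ℝ, Real.exp (-(1/2 : ℝ) * (v ⬝ᵥ A *ᵥ v) + h ⬝ᵥ v)) • u := by
        congr 1
        rw [← integral_add_right_eq_self (μ := (volume : Measure (ι → ℝ)))
          (fun v : ι → ℝ => Real.exp (-(1/2 : ℝ) * (v ⬝ᵥ A *ᵥ v) + h ⬝ᵥ v)) u]
        exact integral_congr_ae (Filter.Eventually.of_forall fun v => (hshift v).symm)

/-- THE MEAN OVER A KERNEL BASIS: for the δ-function Gaussian `δ(Qλ)e^{−½λᵀHλ + λᵀg}dλ` parametrised by `λ = Nz` (`QN =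
0`, `n ≃ τ ⊕ m`, `NᵀN`, `QQᵀ` nonsingular, `NᵀHN` positive definite): `∫ e^{…}·Nz dz = (∫ e^{…} dz) · 𝒢g` with 𝒢 =
`flucCov H Q` (`= N(NᵀHN)⁻¹Nᵀ`, an2's `blocks_eq_kernelBasis`) — the covariance of the δ-function Gaussian is also its
mean response to a source (the reading under which "𝒢 is a covariance of the last Gaussian integral in λ" turns the
λ-integral of (3.151) into `Δ𝒢D*J`). [folklore] -/
theorem mean_kernelBasis (e : ι ≃ τ ⊕ κ) (H : Matrix ι ι ℝ) (Q : Matrix κ ι ℝ) (N : Matrix ι τ ℝ)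
    (hQN : Q * N = 0) (hNA : IsUnit (Nᵀ * N).det) (hQM : IsUnit (Q * Qᵀ).det) (hT : (Nᵀ * H * N).PosDef)
    (g : ι → ℝ) :
    ∫ z : τ → ℝ, Real.exp (-(1/2 : ℝ) * ((N *ᵥ z) ⬝ᵥ H *ᵥ (N *ᵥ z)) + (N *ᵥ z) ⬝ᵥ g) • (N *ᵥ z) =
      (∫ z : τ → ℝ, Real.exp (-(1/2 : ℝ) * ((N *ᵥ z) ⬝ᵥ H *ᵥ (N *ᵥ z)) + (N *ᵥ z) ⬝ᵥ g)) • (flucCov H Q *ᵥ g) := by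
  have hTu : IsUnit (Nᵀ * H * N).det := (Matrix.isUnit_iff_isUnit_det _).mp hT.isUnit
  simp_rw [config_quadForm, config_source N g, dotProduct_comm _ (Nᵀ *ᵥ g)]
  set L : (τ → ℝ) →L[ℝ] (ι → ℝ) := LinearMap.toContinuousLinearMap (Matrix.mulVecLin N) with hL
  have hLz : ∀ z : τ → ℝ, N *ᵥ z = L z := fun z => rfl
  have hint := integrable_exp_source_smul (Nᵀ * H * N) hT (Nᵀ *ᵥ g)
  have hcomp : (fun z : τ → ℝ => Real.exp (-(1/2 : ℝ) * (z ⬝ᵥ (Nᵀ * H * N) *ᵥ z) + (Nᵀ *ᵥ g) ⬝ᵥ z) • (N *ᵥ z)) =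
      fun z => L (Real.exp (-(1/2 : ℝ) * (z ⬝ᵥ (Nᵀ * H * N) *ᵥ z) + (Nᵀ *ᵥ g) ⬝ᵥ z) • z) := by
    funext z; rw [map_smul, ← hLz]
  rw [hcomp, ContinuousLinearMap.integral_comp_comm L hint, integral_exp_source_smul (Nᵀ * H * N) hT (Nᵀ *ᵥ g),
    map_smul, ← hLz, (blocks_eq_kernelBasis e H Q N hQN hNA hQM hTu).1]
  unfold Beta.LogDetHessian.cov
  simp only [mulVec_mulVec, Matrix.mul_assoc]

end Mean

section Mean3151

variable {n m τ : Type*} [Fintype n] [Fintype m] [Fintype τ] [DecidableEq n] [DecidableEq m] [DecidableEq τ]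

/-- **(3.151), LAST EQUALITY, in the normalised-mean reading** (p. 425: *"·∫dλ δ(Q′λ)exp[−½‖Δλ‖² + ⟨Dλ,J⟩]Δλ =
Δ𝒢D*J, (3.151)"*, p. 426 L1 *"where 𝒢 is a covariance of the last Gaussian integral in λ"*): with `λ = Nz`, `‖Δλ‖² =
λᵀΔ²λ` (only `(NᵀΔ²N).PosDef` is needed here) and `⟨Dλ,J⟩ = λᵀ(DᵀJ)`: `∫dz e^{−½‖ΔNz‖² + ⟨DNz,J⟩}·ΔNz = (∫dz e^{…}) ·
Δ𝒢DᵀJ`.  The prefactor `Z⁻¹(J)|det(Δ↾_{N(Q′)})|∫dA δ_R(RD*A)e^{…}` of (3.151), which the print combines with this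
integral's mass to 1, is NOT typed (Faddeev–Popov bookkeeping, C-B9-57 (i)); `D : Matrix p n ℝ`, `J : p → ℝ` arbitrary.
[cite: Balaban1985BackgroundPropagators, (3.151) p.425, p.426 L1] -/
theorem eq_3151_mean {p : Type*} [Fintype p] (e : n ≃ τ ⊕ m) (Δ : Matrix n n ℝ) (Q : Matrix m n ℝ)
    (N : Matrix n τ ℝ) (hQN : Q * N = 0) (hNA : IsUnit (Nᵀ * N).det) (hQM : IsUnit (Q * Qᵀ).det)
    (hT : (Nᵀ * (Δ * Δ) * N).PosDef) (D : Matrix p n ℝ) (J : p → ℝ) :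
    ∫ z : τ → ℝ, Real.exp (-(1/2 : ℝ) * ((N *ᵥ z) ⬝ᵥ (Δ * Δ) *ᵥ (N *ᵥ z)) + (D *ᵥ (N *ᵥ z)) ⬝ᵥ J) •
        (Δ *ᵥ (N *ᵥ z)) =
      (∫ z : τ → ℝ, Real.exp (-(1/2 : ℝ) * ((N *ᵥ z) ⬝ᵥ (Δ * Δ) *ᵥ (N *ᵥ z)) + (D *ᵥ (N *ᵥ z)) ⬝ᵥ J)) •
        (Δ *ᵥ (flucCov (Δ * Δ) Q *ᵥ (Dᵀ *ᵥ J))) := by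
  have hs : ∀ z : τ → ℝ, (D *ᵥ (N *ᵥ z)) ⬝ᵥ J = (N *ᵥ z) ⬝ᵥ (Dᵀ *ᵥ J) := fun z => by
    rw [dotProduct_comm, dotProduct_mulVec, ← mulVec_transpose, dotProduct_comm]
  simp_rw [hs]
  set L : (n → ℝ) →L[ℝ] (n → ℝ) := LinearMap.toContinuousLinearMap (Matrix.mulVecLin Δ) with hL
  have hLz : ∀ x : n → ℝ, Δ *ᵥ x = L x := fun x => rfl
  have hint : Integrable (fun z : τ → ℝ => Real.exp (-(1/2 : ℝ) * ((N *ᵥ z) ⬝ᵥ (Δ * Δ) *ᵥ (N *ᵥ z)) +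
      (N *ᵥ z) ⬝ᵥ (Dᵀ *ᵥ J)) • (N *ᵥ z)) := by
    have h0 := (LinearMap.toContinuousLinearMap (Matrix.mulVecLin N)).integrable_comp
      (integrable_exp_source_smul (Nᵀ * (Δ * Δ) * N) hT (Nᵀ *ᵥ (Dᵀ *ᵥ J)))
    refine h0.congr (Filter.Eventually.of_forall fun z => ?_)
    simp only [LinearMap.coe_toContinuousLinearMap', Matrix.mulVecLin_apply, map_smul, config_quadForm,
      config_source N (Dᵀ *ᵥ J), dotProduct_comm z]
  have hcomp : (fun z : τ → ℝ => Real.exp (-(1/2 : ℝ) * ((N *ᵥ z) ⬝ᵥ (Δ * Δ) *ᵥ (N *ᵥ z)) +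
      (N *ᵥ z) ⬝ᵥ (Dᵀ *ᵥ J)) • (Δ *ᵥ (N *ᵥ z))) = fun z => L (Real.exp (-(1/2 : ℝ) * ((N *ᵥ z) ⬝ᵥ (Δ * Δ) *ᵥ
        (N *ᵥ z)) + (N *ᵥ z) ⬝ᵥ (Dᵀ *ᵥ J)) • (N *ᵥ z)) := by
    funext z; rw [map_smul, ← hLz]
  rw [hcomp, ContinuousLinearMap.integral_comp_comm L hint, mean_kernelBasis e (Δ * Δ) Q N hQN hNA hQM hT,
    map_smul, ← hLz]

/-- **[adv1's] (3.164) Gaussian mean — hypotheses discharged** (p. 429 [PDF 41]: *"H′μ = (Z′(μ))⁻¹∫dλ δ(Q′λ −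
μ)e^{−(1/2)‖Δλ‖²}. (3.164)"*): adv1's `B9H163.h164_mean` proves `(∫w)⁻¹ • ∫ w•(H′μ + ιν) dν = H′μ` for ANY
negation-invariant measure GIVEN (i) integrability of the weight `w = e^{−½‖Δ(H′μ + ιν)‖²}`, (ii) of its first moment,
(iii) `∫w ≠ 0`.  Here, for Lebesgue measure on a kernel basis (`ι = mulVecLin N`, `Q′N = 0`) and `(NᵀΔ²N).PosDef`,
(i)–(iii) are PROVED — adv1's `isMinimiser` splits `w = e^{−½‖ΔH′μ‖²}·e^{−½νᵀ(NᵀΔ²N)ν}`, then pv16's Gaussian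
integrability / normalisation and `integrable_exp_source_smul` — so (3.164)'s mean statement holds outright in this
reading.  `Δ` symmetric AND invertible: adv1's interface (`Hmin = Δ⁻²Q′ᵀ(Q′Δ⁻²Q′ᵀ)⁻¹`), consumed BY NAME. [cite:
Balaban1985BackgroundPropagators, (3.164) p.429] -/
theorem h164_mean_kernelBasis (Δ : Matrix n n ℝ) (Q : Matrix m n ℝ) (hΔsymm : Δ.IsSymm) (hΔ : IsUnit Δ)
    (N : Matrix n τ ℝ) (hQN : Q * N = 0) (hT : (Nᵀ * (Δ * Δ) * N).PosDef) (μ₀ : m → ℝ) :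
    (∫ ν : τ → ℝ, Real.exp (-(1/2 : ℝ) * ((Δ *ᵥ (B9H163.Hmin Δ Q *ᵥ μ₀ + N *ᵥ ν)) ⬝ᵥ
        (Δ *ᵥ (B9H163.Hmin Δ Q *ᵥ μ₀ + N *ᵥ ν)))))⁻¹ •
      ∫ ν : τ → ℝ, Real.exp (-(1/2 : ℝ) * ((Δ *ᵥ (B9H163.Hmin Δ Q *ᵥ μ₀ + N *ᵥ ν)) ⬝ᵥ
        (Δ *ᵥ (B9H163.Hmin Δ Q *ᵥ μ₀ + N *ᵥ ν)))) • (B9H163.Hmin Δ Q *ᵥ μ₀ + N *ᵥ ν)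
      = B9H163.Hmin Δ Q *ᵥ μ₀ := by
  set c : ℝ := (Δ *ᵥ (B9H163.Hmin Δ Q *ᵥ μ₀)) ⬝ᵥ (Δ *ᵥ (B9H163.Hmin Δ Q *ᵥ μ₀)) with hc
  have hq : ∀ ν : τ → ℝ, (Δ *ᵥ (N *ᵥ ν)) ⬝ᵥ (Δ *ᵥ (N *ᵥ ν)) = ν ⬝ᵥ (Nᵀ * (Δ * Δ) * N) *ᵥ ν := fun ν => by
    rw [mulVec_mulVec, ← Beta.GaussianIntegral.dotProduct_transpose_mul_self_mulVec, transpose_mul, hΔsymm.eq]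
    simp only [Matrix.mul_assoc]
  have hsplit : ∀ ν : τ → ℝ, Real.exp (-(1/2 : ℝ) * ((Δ *ᵥ (B9H163.Hmin Δ Q *ᵥ μ₀ + N *ᵥ ν)) ⬝ᵥ
      (Δ *ᵥ (B9H163.Hmin Δ Q *ᵥ μ₀ + N *ᵥ ν)))) =
        Real.exp (-(1/2 : ℝ) * c) * Real.exp (-(1/2 : ℝ) * (ν ⬝ᵥ (Nᵀ * (Δ * Δ) * N) *ᵥ ν)) := fun ν => by
    rw [B9H163.isMinimiser hΔsymm hΔ μ₀ (N *ᵥ ν) (by rw [mulVec_mulVec, hQN, zero_mulVec]), hq, ← hc, mul_add,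
      Real.exp_add]
  have hw1 : Integrable (fun ν : τ → ℝ => Real.exp (-(1/2 : ℝ) * ((Δ *ᵥ (B9H163.Hmin Δ Q *ᵥ μ₀ + N *ᵥ ν)) ⬝ᵥ
      (Δ *ᵥ (B9H163.Hmin Δ Q *ᵥ μ₀ + N *ᵥ ν))))) := by
    simp_rw [hsplit]
    exact (Beta.GaussianIntegral.integrable_exp_neg_half_quadForm _ hT).const_mul _
  have hint : Integrable (fun ν : τ → ℝ => Real.exp (-(1/2 : ℝ) * ((Δ *ᵥ (B9H163.Hmin Δ Q *ᵥ μ₀ + N *ᵥ ν)) ⬝ᵥ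
      (Δ *ᵥ (B9H163.Hmin Δ Q *ᵥ μ₀ + N *ᵥ ν)))) • ν) := by
    simp_rw [hsplit]
    have h0 := (integrable_exp_source_smul (Nᵀ * (Δ * Δ) * N) hT 0).smul (Real.exp (-(1/2 : ℝ) * c))
    refine h0.congr (Filter.Eventually.of_forall fun ν => ?_)
    simp only [Pi.smul_apply, smul_smul, zero_dotProduct, add_zero]
  have hZ : ∫ ν : τ → ℝ, Real.exp (-(1/2 : ℝ) * ((Δ *ᵥ (B9H163.Hmin Δ Q *ᵥ μ₀ + N *ᵥ ν)) ⬝ᵥ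
      (Δ *ᵥ (B9H163.Hmin Δ Q *ᵥ μ₀ + N *ᵥ ν)))) ≠ 0 := by
    simp_rw [hsplit]
    rw [integral_const_mul, Beta.GaussianIntegral.integral_exp_neg_half_quadForm _ hT]
    exact (mul_pos (Real.exp_pos _) (gaussNorm_pos hT)).ne'
  exact B9H163.h164_mean volume Δ Q hΔsymm hΔ (Matrix.mulVecLin N)
    (fun ν => by rw [Matrix.mulVecLin_apply, mulVec_mulVec, hQN, zero_mulVec]) μ₀ hw1 hint hZ

/-- **(3.171) with "𝒢 given by the formula (2.27) in [4]"** (p. 430): `Z′⁻¹∫dλ δ(Q′λ)e^{−½‖Δλ‖²+⟨λ,f⟩} = e^{½⟨f,𝒢f⟩}`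
with `𝒢 = G′² − G′²Q′*(Q′G′²Q′*)⁻¹Q′G′²` — §7's `integral_kernelBasis` (the δ-function Gaussian in a kernel basis
`λ = Nz`) composed with `eq_227`. [cite: Balaban1985BackgroundPropagators, (3.171) p.430] -/
theorem eq_3171 (e : n ≃ τ ⊕ m) (Δ : Matrix n n ℝ) (Q : Matrix m n ℝ) (a : ℝ) (hΔ : Δ.IsSymm)
    (hΔ' : IsUnit (B9H163.Δ' Δ Q a)) (N : Matrix n τ ℝ) (hQN : Q * N = 0) (hNA : IsUnit (Nᵀ * N).det)
    (hQM : IsUnit (Q * Qᵀ).det) (hT : (Nᵀ * (Δ * Δ) * N).PosDef) (f : n → ℝ) :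
    (∫ z : τ → ℝ, Real.exp (-(1/2 : ℝ) * ((N *ᵥ z) ⬝ᵥ (Δ * Δ) *ᵥ (N *ᵥ z))))⁻¹ *
        ∫ z : τ → ℝ, Real.exp (-(1/2 : ℝ) * ((N *ᵥ z) ⬝ᵥ (Δ * Δ) *ᵥ (N *ᵥ z)) + (N *ᵥ z) ⬝ᵥ f) =
      Real.exp ((1/2 : ℝ) * (f ⬝ᵥ (B9H163.G' Δ Q a * B9H163.G' Δ Q a -
        B9H163.G' Δ Q a * B9H163.G' Δ Q a * Qᵀ * (B9H163.M' Δ Q a)⁻¹ * Q * B9H163.G' Δ Q a * B9H163.G' Δ Q a)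
          *ᵥ f)) := by
  have hTu : IsUnit (Nᵀ * (Δ * Δ) * N).det := (Matrix.isUnit_iff_isUnit_det _).mp hT.isUnit
  rw [eq_227 e Δ Q a hΔ hΔ' N hQN hNA hQM hTu, integral_kernelBasis e (Δ * Δ) Q N hQN hNA hQM hT f]
  simp_rw [config_quadForm N (Δ * Δ)]
  rw [Beta.GaussianIntegral.integral_exp_neg_half_quadForm _ hT, inv_mul_cancel_left₀ (gaussNorm_pos hT).ne']

/-- **B6 (2.25): `e^{½⟨f,Rf⟩} = Z′⁻¹∫dλ δ(Q′λ)e^{−½‖Δλ‖²+⟨Δf,λ⟩}`** (the Gaussian representation of `R` from which B6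
reads off (2.26) "R = Δ𝒢Δ", and B9 p. 426 "𝒢 is also a covariance of the integral (3.17) defining the operator R") —
in a kernel basis `λ = Nz`, with `R` = [adv1's] `B9H163.R Δ Q′ a` ((3.25)): §7's `integral_kernelBasis` with the
source `Δf`, then `⟨Δf, 𝒢Δf⟩ = ⟨f, Δ𝒢Δf⟩ = ⟨f, Rf⟩` (`R_eq_226`).  This is the generating-function (tilted) form; the
density form (3.17) = (3.20) of B9 p. 394 (B6 (2.24)) is this lineage's gen-6 `B9Eq320Gauss.density_320` (abstract
level, not imported). [cite: Balaban1984PropagatorsII, (2.25)-(2.26) p.226; Balaban1985BackgroundPropagators, p.426 L2-3] -/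
theorem eq_B6_225 (e : n ≃ τ ⊕ m) (Δ : Matrix n n ℝ) (Q : Matrix m n ℝ) (a : ℝ) (hΔ : Δ.IsSymm)
    (hΔ' : IsUnit (B9H163.Δ' Δ Q a)) (N : Matrix n τ ℝ) (hQN : Q * N = 0) (hNA : IsUnit (Nᵀ * N).det)
    (hQM : IsUnit (Q * Qᵀ).det) (hT : (Nᵀ * (Δ * Δ) * N).PosDef) (f : n → ℝ) :
    (∫ z : τ → ℝ, Real.exp (-(1/2 : ℝ) * ((N *ᵥ z) ⬝ᵥ (Δ * Δ) *ᵥ (N *ᵥ z))))⁻¹ *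
        ∫ z : τ → ℝ, Real.exp (-(1/2 : ℝ) * ((N *ᵥ z) ⬝ᵥ (Δ * Δ) *ᵥ (N *ᵥ z)) + (N *ᵥ z) ⬝ᵥ (Δ *ᵥ f)) =
      Real.exp ((1/2 : ℝ) * (f ⬝ᵥ B9H163.R Δ Q a *ᵥ f)) := by
  have hTu : IsUnit (Nᵀ * (Δ * Δ) * N).det := (Matrix.isUnit_iff_isUnit_det _).mp hT.isUnit
  rw [integral_kernelBasis e (Δ * Δ) Q N hQN hNA hQM hT (Δ *ᵥ f)]
  simp_rw [config_quadForm N (Δ * Δ)]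
  rw [Beta.GaussianIntegral.integral_exp_neg_half_quadForm _ hT, inv_mul_cancel_left₀ (gaussNorm_pos hT).ne',
    R_eq_226 e Δ Q a hΔ hΔ' N hQN hNA hQM hTu, show Δ *ᵥ f = Δᵀ *ᵥ f by rw [hΔ.eq],
    transpose_mulVec_quadForm, hΔ.eq]

end Mean3151

/-! ## §9 (v1.3, APPEND-ONLY; claim B9-SECTE-P425)  B9 p. 425 / p. 426 L9: the two facts Sect. D's operator algebra
NEEDS — "(3.124)" (for `G₁`) and "`RD*G₁DR = R`" — PROVED for the explicit projection (3.25) from (3.152), (3.115), (3.23)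

Print (verbatim).  p. 425 [PDF 37]: *"It is easy to verify explicitly properties of the operator 𝔓, i.e. Q𝔓 = 0, RD*𝔓 =
0, 𝔓² = 𝔓, … Verifying the above properties we need to know only the identities (3.124) and RD*G₁DR = R. The last can
be proved by the same method as used in the proof of (3.124), and in the proof of the same identity in (2.30) [4]."*;
p. 426 [PDF 38] L9 (after (3.152) `RD*G₁ = RG′D*`, `G₁DR = DG′R`): *"Let us notice that these identities imply the
identities (3.124), because QG₁DR = QDG′R = D¹Q′G′R = 0."*; (3.124) p. 420 [PDF 32]: *"RD*GQ* = 0, hence QGDR = 0.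
(3.124)"* (printed for Sect. D's `G`, `G⁻¹ = Δ_π + DRD* + Q*aQ`, and proved there by the Gaussian symmetry computation
(3.125); p. 425 uses them "also for the operator G₁"); (3.115) p. 418 [PDF 30]: *"Q_jDλ = D^{L^jη}_{Ū^j}Q′_jλ = D̄^jQ′_jλ,
(3.115) where the last equality is a definition of the symbol D̄^j"*; (3.23) p. 394 [PDF 6]: *"Δ^η_U = D^{η*}_U D^η_U"*;
(3.25) p. 394: *"Rf = (I − G′Q′*(Q′G′²Q′*)⁻¹Q′G′)f"*.

Reading (THE READING (e) of the header; DIVERGENCE D-b09.47): `R`, `G′ = (Δ′_a)⁻¹`, `M′ = Q′G′²Q′*` as in (d) ([adv1's]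
`B9H163.R / G' / M' / Δ'`, BY NAME); the covariant derivative `D` ↦ `D : Matrix p n ℝ`, the propagator `G₁` ↦ `G₁ :
Matrix p p ℝ`, the bond average `Q` (= `Q_j`) ↦ `Qv : Matrix q p ℝ`, `D̄^j` (p. 426's `D¹`) ↦ `Dbar : Matrix q m ℝ` — ALL
ARBITRARY; (3.115) ↦ the HYPOTHESIS `Qv * D = Dbar * Q′` (`h3115`); (3.23) ↦ the HYPOTHESIS `Dᵀ * D = Δ` (`hDD`); (3.152)
↦ the hypotheses `h152b` (or both lines DERIVED from (3.151)-as-hypothesis by §8's `eq_3152_of_3151`).  What is PROVED: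
`Q′G′R = 0`, `R² = R`, `ΔG′R = R`, `RG′Δ = R` (identities of (3.25) alone, `M′⁻¹` a genuine inverse by §8's `isUnit_M'`),
hence `RG′D*DR = R` from (3.23) alone, `RD*G₁DR = R` from (3.152) + (3.23), and p. 426 L9's chain `QG₁DR = QDG′R =
D̄Q′G′R = 0` with its adjoint `RD*G₁Q* = 0` — i.e. EXACTLY the hypotheses `h124`/`h124a`/`h124b` (`q*g*d*r = 0`, `r*ds*g*qs
= 0`), `hR` (`r*ds*g*d*r = r`, resp. `r*g'*ds*d*r = r`) and `h152a`/`h152b` under which [r1's] RING-LEVEL `B9.frakP_of_3146`,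
`B9.q_mul_frakP`, `B9.rds_mul_frakP`, `B9.frakG_3150`, `B9.frakG_3153` certify (3.146) ⇒ (3.147), `Q𝔓 = 0`, `RD*𝔓 = 0`,
(3.150), (3.153).  r1's theorems live over ONE arbitrary ring (square data); they are neither restated nor instantiated
here (the data below are rectangular) — only their hypotheses are discharged, in the matrix reading, for the explicit
(3.25).  NOT typed: (3.124) for Sect. D's own `G` and its proof (3.125), (3.129), and the p. 425 route "by the same
method as used in the proof of (3.124)" (here `RD*G₁DR = R` comes from (3.152) by algebra instead).  NEIGHBOURS in the
tree (none imported, nothing restated; different objects and hypotheses): (3.124) for Sect. D's own `G` in the ABSTRACT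
slice reading (`τ ↦ RD*`, `K ↦ Δ_π`, hypotheses `KW = 0`, `QW = 0`, `τW` invertible) is [an2's]
`Beta.GaugeFixingPropagators.slice_mul_inv_mul_transpose` / `mul_inv_mul_slice_transpose`; the `U = 1` CONCRETE torus
identities of B5 (1.95)/(1.97) («R∂*GQ* = 0, QG∂R = 0», «R∂*G∂ = ∂*G∂R = R») and the projection (1.107) are [an5's]
`Beta.LandauMultiplierIdentities` / `Beta.FluctuationProjection`.  Here: the explicit background-field projection (3.25)
(= [adv1's] `B9H163.R`) and an ARBITRARY `G₁` subject to (3.152). -/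

section SectDHyps

variable {n m : Type*} [Fintype n] [Fintype m] [DecidableEq n] [DecidableEq m]

/-- `Q′G′R = 0` for `R` = (3.25): `Q′G′(I − G′Q′*M′⁻¹Q′G′) = Q′G′ − M′M′⁻¹Q′G′` (`M′ = Q′G′²Q′*` nonsingular — derived
in §8's `isUnit_M'` from `Δ′_a`, `Q′Q′*` nonsingular).  The last link of p. 426 L9's chain "`D¹Q′G′R = 0`". [folklore] -/
theorem Q_mul_G'_mul_R (Δ : Matrix n n ℝ) (Q : Matrix m n ℝ) (a : ℝ) (hM' : IsUnit (B9H163.M' Δ Q a)) :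
    Q * B9H163.G' Δ Q a * B9H163.R Δ Q a = 0 := by
  unfold B9H163.R
  rw [Matrix.mul_sub, Matrix.mul_one, sub_eq_zero]
  simp only [Matrix.mul_assoc]
  rw [B9H163.QG'G'Qt_Minv_mul hM']

/-- `R² = R` for `R` = (3.25) (p. 394 (3.20): "R = R(U) is an orthogonal projection"; coordinate form of gen-6's abstract
`B9Eq325Proj.R325_idem`): `R·G′Q′*(…) = 0` by [adv1's] `B9H163.R_mul_G'Qt`. [folklore] -/
theorem R_mul_R (Δ : Matrix n n ℝ) (Q : Matrix m n ℝ) (a : ℝ) (hM' : IsUnit (B9H163.M' Δ Q a)) :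
    B9H163.R Δ Q a * B9H163.R Δ Q a = B9H163.R Δ Q a := by
  conv_lhs => rhs; unfold B9H163.R
  rw [Matrix.mul_sub, Matrix.mul_one, sub_eq_self]
  simp only [Matrix.mul_assoc]
  exact B9H163.R_mul_G'Qt hM' _

omit [DecidableEq m] in
/-- `G′Δ = I − a·G′Q′*Q′` (`G′Δ′_a = I`, `Δ′_a = Δ + Q′*aQ′` (3.24); [adv1's] `B9H163.G'_mul_Δ'`). [folklore] -/
theorem G'_mul_Δ (Δ : Matrix n n ℝ) (Q : Matrix m n ℝ) (a : ℝ) (hΔ' : IsUnit (B9H163.Δ' Δ Q a)) :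
    B9H163.G' Δ Q a * Δ = 1 - a • (B9H163.G' Δ Q a * (Qᵀ * Q)) := by
  have h := B9H163.G'_mul_Δ' hΔ'
  unfold B9H163.Δ' at h
  rw [Matrix.mul_add, Matrix.mul_smul] at h
  rw [← h]; abel

omit [DecidableEq m] in
/-- `ΔG′ = I − a·Q′*Q′G′` ([adv1's] `B9H163.Δ_mul_G'_mul` at `Y = 1`). [folklore] -/
theorem Δ_mul_G' (Δ : Matrix n n ℝ) (Q : Matrix m n ℝ) (a : ℝ) (hΔ' : IsUnit (B9H163.Δ' Δ Q a)) :
    Δ * B9H163.G' Δ Q a = 1 - a • (Qᵀ * (Q * B9H163.G' Δ Q a)) := by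
  simpa only [Matrix.mul_one] using B9H163.Δ_mul_G'_mul hΔ' (1 : Matrix n n ℝ)

/-- `ΔG′R = R` — `ΔG′R = R − aQ′*(Q′G′R)` and `Q′G′R = 0`.  (Only the sandwiched identities `ΔG′R = R`, `RG′Δ = R` are
identities of (3.25); `G′ΔR` is `R − aG′Q′*Q′R`.) [folklore] -/
theorem Δ_mul_G'_mul_R (Δ : Matrix n n ℝ) (Q : Matrix m n ℝ) (a : ℝ) (hΔ' : IsUnit (B9H163.Δ' Δ Q a))
    (hM' : IsUnit (B9H163.M' Δ Q a)) : Δ * B9H163.G' Δ Q a * B9H163.R Δ Q a = B9H163.R Δ Q a := by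
  rw [Δ_mul_G' Δ Q a hΔ', Matrix.sub_mul, Matrix.one_mul, sub_eq_self, Matrix.smul_mul, Matrix.mul_assoc,
    Q_mul_G'_mul_R Δ Q a hM', Matrix.mul_zero, smul_zero]

/-- `RG′Δ = R`: `RG′Δ = R − a(RG′Q′*)Q′ = R` ([adv1's] `B9H163.R_mul_G'Qt`). [folklore] -/
theorem R_mul_G'_mul_Δ (Δ : Matrix n n ℝ) (Q : Matrix m n ℝ) (a : ℝ) (hΔ' : IsUnit (B9H163.Δ' Δ Q a))
    (hM' : IsUnit (B9H163.M' Δ Q a)) : B9H163.R Δ Q a * B9H163.G' Δ Q a * Δ = B9H163.R Δ Q a := by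
  rw [Matrix.mul_assoc, G'_mul_Δ Δ Q a hΔ', Matrix.mul_sub, Matrix.mul_one, sub_eq_self, Matrix.mul_smul,
    B9H163.R_mul_G'Qt hM', smul_zero]

/-- `RΔG′R = R` (`ΔG′R = R` and `R² = R`). [folklore] -/
theorem R_mul_Δ_mul_G'_mul_R (Δ : Matrix n n ℝ) (Q : Matrix m n ℝ) (a : ℝ) (hΔ' : IsUnit (B9H163.Δ' Δ Q a))
    (hM' : IsUnit (B9H163.M' Δ Q a)) :
    B9H163.R Δ Q a * Δ * B9H163.G' Δ Q a * B9H163.R Δ Q a = B9H163.R Δ Q a := by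
  rw [Matrix.mul_assoc (B9H163.R Δ Q a), Matrix.mul_assoc (B9H163.R Δ Q a), Δ_mul_G'_mul_R Δ Q a hΔ' hM',
    R_mul_R Δ Q a hM']

/-- `RG′ΔR = R` (`RG′Δ = R` and `R² = R`). [folklore] -/
theorem R_mul_G'_mul_Δ_mul_R (Δ : Matrix n n ℝ) (Q : Matrix m n ℝ) (a : ℝ) (hΔ' : IsUnit (B9H163.Δ' Δ Q a))
    (hM' : IsUnit (B9H163.M' Δ Q a)) :
    B9H163.R Δ Q a * B9H163.G' Δ Q a * Δ * B9H163.R Δ Q a = B9H163.R Δ Q a := by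
  rw [R_mul_G'_mul_Δ Δ Q a hΔ' hM', R_mul_R Δ Q a hM']

/-- **`RG′D*DR = R`** — the hypothesis `hR : r * g' * ds * d * r = r` of [r1's] `B9.frakG_3153` ("the adjoint form of
`RD*G₁DR = R`"), for the explicit (3.25): from (3.23) `Δ = D*D` (hypothesis `hDD`) ALONE — `RG′ΔR = R`; no use of (3.152).
[cite: Balaban1985BackgroundPropagators, p.425, (3.23) p.394] -/
theorem R_mul_G'_mul_DtD_mul_R {p : Type*} [Fintype p] (Δ : Matrix n n ℝ) (Q : Matrix m n ℝ) (a : ℝ)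
    (hΔ' : IsUnit (B9H163.Δ' Δ Q a)) (hM' : IsUnit (B9H163.M' Δ Q a)) (D : Matrix p n ℝ) (hDD : Dᵀ * D = Δ) :
    B9H163.R Δ Q a * B9H163.G' Δ Q a * Dᵀ * D * B9H163.R Δ Q a = B9H163.R Δ Q a := by
  rw [Matrix.mul_assoc (B9H163.R Δ Q a * B9H163.G' Δ Q a), hDD, R_mul_G'_mul_Δ_mul_R Δ Q a hΔ' hM']

/-- **p. 425: `RD*G₁DR = R`** (*"Verifying the above properties we need to know only the identities (3.124) and RD*G₁DR =
R. The last can be proved by the same method as used in the proof of (3.124)"*) — the hypothesis `hR : r * ds * g * d *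
r = r` of [r1's] `B9.rds_mul_frakP` — PROVED for the explicit (3.25) from (3.152)'s second line `G₁DR = DG′R` (hypothesis
`h152b`; derived from (3.151) in §8) and (3.23) `D*D = Δ` (`hDD`): `RD*(G₁DR) = RD*DG′R = RΔG′R = R`.  An ALGEBRAIC
certification; the print's Gaussian route ("the same method as … (3.124)", i.e. (3.125)) is not reproduced. [cite:
Balaban1985BackgroundPropagators, p.425, (3.152) p.426, (3.23) p.394] -/
theorem eq_p425_RDG₁DR {p : Type*} [Fintype p] (Δ : Matrix n n ℝ) (Q : Matrix m n ℝ) (a : ℝ)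
    (hΔ' : IsUnit (B9H163.Δ' Δ Q a)) (hM' : IsUnit (B9H163.M' Δ Q a)) (D : Matrix p n ℝ) (hDD : Dᵀ * D = Δ)
    (G₁ : Matrix p p ℝ) (h152b : G₁ * D * B9H163.R Δ Q a = D * B9H163.G' Δ Q a * B9H163.R Δ Q a) :
    B9H163.R Δ Q a * Dᵀ * G₁ * D * B9H163.R Δ Q a = B9H163.R Δ Q a := by
  calc B9H163.R Δ Q a * Dᵀ * G₁ * D * B9H163.R Δ Q a
      = B9H163.R Δ Q a * Dᵀ * (G₁ * D * B9H163.R Δ Q a) := by simp only [Matrix.mul_assoc]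
    _ = B9H163.R Δ Q a * (Dᵀ * D) * B9H163.G' Δ Q a * B9H163.R Δ Q a := by rw [h152b]; simp only [Matrix.mul_assoc]
    _ = B9H163.R Δ Q a := by rw [hDD, R_mul_Δ_mul_G'_mul_R Δ Q a hΔ' hM']

/-- **p. 426 L9: (3.152) ⇒ (3.124) for `G₁`** — *"these identities imply the identities (3.124), because QG₁DR = QDG′R =
D¹Q′G′R = 0"* — the three printed links as three conjuncts: `QG₁DR = QDG′R` ((3.152) `G₁DR = DG′R`, hypothesis `h152b`),
`QDG′R = D̄(Q′G′R)` ((3.115) `QD = D̄Q′`, hypothesis `h3115`), `D̄(Q′G′R) = 0` (`Q_mul_G'_mul_R`).  Their composite `QG₁DR =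
0` is the hypothesis `h124`/`h124b` (`q * g * d * r = 0`) of [r1's] `B9.frakP_of_3146`, `B9.q_mul_frakP`, `B9.frakG_3150`.
[cite: Balaban1985BackgroundPropagators, p.426 L9, (3.115) p.418, (3.124) p.420] -/
theorem eq_3124_of_3152 {p q : Type*} [Fintype p] [Fintype q] (Δ : Matrix n n ℝ) (Q : Matrix m n ℝ) (a : ℝ)
    (hM' : IsUnit (B9H163.M' Δ Q a)) (D : Matrix p n ℝ) (G₁ : Matrix p p ℝ) (Qv : Matrix q p ℝ)
    (Dbar : Matrix q m ℝ) (h3115 : Qv * D = Dbar * Q)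
    (h152b : G₁ * D * B9H163.R Δ Q a = D * B9H163.G' Δ Q a * B9H163.R Δ Q a) :
    Qv * G₁ * D * B9H163.R Δ Q a = Qv * D * B9H163.G' Δ Q a * B9H163.R Δ Q a ∧
    Qv * D * B9H163.G' Δ Q a * B9H163.R Δ Q a = Dbar * (Q * B9H163.G' Δ Q a * B9H163.R Δ Q a) ∧
    Dbar * (Q * B9H163.G' Δ Q a * B9H163.R Δ Q a) = 0 := by
  refine ⟨?_, ?_, ?_⟩
  · rw [Matrix.mul_assoc Qv, Matrix.mul_assoc Qv, h152b]; simp only [Matrix.mul_assoc]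
  · rw [h3115]; simp only [Matrix.mul_assoc]
  · rw [Q_mul_G'_mul_R Δ Q a hM', Matrix.mul_zero]

/-- **(3.124) for `G₁`, adjoint member: `RD*G₁Q* = 0`** — the hypothesis `h124`/`h124a` (`r * ds * g * qs = 0`) of [r1's]
`B9.rds_mul_frakP`, `B9.frakG_3150` — by transposing `QG₁DR = 0` (`eq_3124_of_3152`): `G₁` symmetric (a covariance;
hypothesis `hG₁`), `Rᵀ = R` (§8's `R_transpose`, symmetric `Δ`). [cite: Balaban1985BackgroundPropagators, (3.124) p.420,
p.426 L9] -/
theorem eq_3124a_of_3152 {p q : Type*} [Fintype p] [Fintype q] (Δ : Matrix n n ℝ) (Q : Matrix m n ℝ) (a : ℝ)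
    (hΔ : Δ.IsSymm) (hM' : IsUnit (B9H163.M' Δ Q a)) (D : Matrix p n ℝ) (G₁ : Matrix p p ℝ) (hG₁ : G₁ᵀ = G₁)
    (Qv : Matrix q p ℝ) (Dbar : Matrix q m ℝ) (h3115 : Qv * D = Dbar * Q)
    (h152b : G₁ * D * B9H163.R Δ Q a = D * B9H163.G' Δ Q a * B9H163.R Δ Q a) :
    B9H163.R Δ Q a * Dᵀ * G₁ * Qvᵀ = 0 := by
  obtain ⟨h1, h2, h3⟩ := eq_3124_of_3152 Δ Q a hM' D G₁ Qv Dbar h3115 h152b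
  have h := congrArg Matrix.transpose (h1.trans (h2.trans h3))
  rwa [transpose_mul, transpose_mul, transpose_mul, hG₁, R_transpose Δ Q a hΔ, transpose_zero,
    ← Matrix.mul_assoc, ← Matrix.mul_assoc] at h

/-- **ASSEMBLY — everything [r1's] `B9.lean` Sect. D algebra takes as HYPOTHESES, from (3.151), (3.115), (3.23) for the
explicit (3.25)**: in the kernel-basis setting of §8 (symmetric `Δ`, `Δ′_a`, `Q′Q′*`, `NᵀN`, `NᵀΔ²N` nonsingular, `n ≃ τ ⊕
m`), from (3.151) as the operator hypothesis `RD*G₁ = Δ𝒢D*` (`h3151`, `G₁` symmetric), (3.115) `QD = D̄Q′` (`h3115`) and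
(3.23) `D*D = Δ` (`hDD`): (3.152) both lines [`h152a`, `h152b`]; (3.124) for `G₁` both members [`h124a`: `RD*G₁Q* = 0`,
`h124b`: `QG₁DR = 0`]; and `RD*G₁DR = R`, `RG′D*DR = R` [the two `hR`].  `M′`'s invertibility is derived (`isUnit_M'`).
[cite: Balaban1985BackgroundPropagators, p.425, p.426 L1-9, (3.151)-(3.152)] -/
theorem sectD_hypotheses_of_3151 {p q τ : Type*} [Fintype p] [Fintype q] [Fintype τ] [DecidableEq τ] (e : n ≃ τ ⊕ m)
    (Δ : Matrix n n ℝ) (Q : Matrix m n ℝ) (a : ℝ) (hΔ : Δ.IsSymm) (hΔ' : IsUnit (B9H163.Δ' Δ Q a)) (N : Matrix n τ ℝ)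
    (hQN : Q * N = 0) (hNA : IsUnit (Nᵀ * N).det) (hQM : IsUnit (Q * Qᵀ).det) (hT : IsUnit (Nᵀ * (Δ * Δ) * N).det)
    (D : Matrix p n ℝ) (hDD : Dᵀ * D = Δ) (G₁ : Matrix p p ℝ) (hG₁ : G₁ᵀ = G₁)
    (Qv : Matrix q p ℝ) (Dbar : Matrix q m ℝ) (h3115 : Qv * D = Dbar * Q)
    (h3151 : B9H163.R Δ Q a * Dᵀ * G₁ = Δ * flucCov (Δ * Δ) Q * Dᵀ) :
    (B9H163.R Δ Q a * Dᵀ * G₁ = B9H163.R Δ Q a * B9H163.G' Δ Q a * Dᵀ ∧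
      G₁ * D * B9H163.R Δ Q a = D * B9H163.G' Δ Q a * B9H163.R Δ Q a) ∧
    (B9H163.R Δ Q a * Dᵀ * G₁ * Qvᵀ = 0 ∧ Qv * G₁ * D * B9H163.R Δ Q a = 0) ∧
    (B9H163.R Δ Q a * Dᵀ * G₁ * D * B9H163.R Δ Q a = B9H163.R Δ Q a ∧
      B9H163.R Δ Q a * B9H163.G' Δ Q a * Dᵀ * D * B9H163.R Δ Q a = B9H163.R Δ Q a) := by
  have hM' : IsUnit (B9H163.M' Δ Q a) := isUnit_M' Δ Q a hΔ hΔ' hQM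
  obtain ⟨h152a, h152b⟩ := eq_3152_of_3151 e Δ Q a hΔ hΔ' N hQN hNA hQM hT D G₁ hG₁ h3151
  obtain ⟨k1, k2, k3⟩ := eq_3124_of_3152 Δ Q a hM' D G₁ Qv Dbar h3115 h152b
  exact ⟨⟨h152a, h152b⟩, ⟨eq_3124a_of_3152 Δ Q a hΔ hM' D G₁ hG₁ Qv Dbar h3115 h152b, k1.trans (k2.trans k3)⟩,
    ⟨eq_p425_RDG₁DR Δ Q a hΔ' hM' D hDD G₁ h152b, R_mul_G'_mul_DtD_mul_R Δ Q a hΔ' hM' D hDD⟩⟩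

end SectDHyps

end Literature.MathematicalPhysics.QuantumFieldTheory.Balaban1983to89.B9SectECov
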